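import Literature.Probability.RandomPlanarGeometry.HexSAWSurfaceFourthOrderUpper
import Literature.Probability.RandomPlanarGeometry.HexSAWSurfaceFourthOrderExact
import HarnessLib

/-!
# Honeycomb SAW at the Duminil-Copin–Smirnov surface (brick-wall frame): the FIFTH-order term of the adsorbed-phase free energy from
# above — `β(y)² ≤ y + 1/y + 1/y² + 2/y³ + 4/y⁴ + 6377300/y⁵` (`y ≥ 36`) by SEVEN-step-extendable arches; hence, with the tree's
# fifth-order lower bound, **`y⁴ (β(y)² − y − 1/y − 1/y² − 2/y³) → 4`**: the fifth coefficient is EXACTLY `4`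

Topic `Literature/Probability/RandomPlanarGeometry` (lane «pcv-sawmu», car «WALL-FIFTH-ORDER-UPPER», a-p6 g17).  Continues
`HexSAWSurfaceFourthOrderUpper.lean` (a-p6 g16: `ExtK k`, `archsK`, `XKw`, the fixed-shape injection `sum_shape_le_XK`, the dip / flat / TEN fibres,
`X5w_le_rec`, `wallRate_sq_le_fourth`), `HexSAWSurfaceFifthOrderLower.lean` (a-p6 g16: the nine one-visit seeds of length twelve,
`four_sub_div_le_of_window`) and `HexSAWSurfaceFourthOrderExact.lean` (`four_sub_div_le_pow_four_mul : 4 − 53853213/y ≤ y⁴(β² − y − 1/y − 1/y² − 2/y³)`).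

The device.  Five fresh steps do not suffice at fifth order: the two «late hooks» of length twelve — the long flat
`…(x+9σ,−1)(x+9σ,0)(x+8σ,0)` and `…(x+6σ,−2)(x+6σ,−1)(x+7σ,−1)(x+7σ,0)(x+6σ,0)` — die only after SIX forced fresh steps, and eight backward
excursions of length twelve meet the arch only through its SEVEN preceding vertices.  So this module raises the requirement to a fresh
self-avoiding SEVEN-step continuation (`ExtK 7`) and a history of length `≥ 7` (`j ≥ 5`), and analyses the fibre of excursion length TWELVE:
an `ExtK 7` arch of length `j+14` whose last surface visit before the end is at time `j+2` ends with one of exactly NINE excursions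
(`twelve_coords7`) — the nine one-visit seeds `Twelve.TX s, Twelve.TY s` (`s : Fin 9`) of `HexSAWSurfaceFifthOrderLower`, read as excursions.  Two devices keep the
case analysis small: (i) a CLIMBING BOUND (`climb_le`: on the brick-wall lattice an up-step lands on a site whose only vertical bond is the one just
used, so the height gains at most `⌈s/2⌉` in `s` steps — every excursion that is too deep too late is discarded at once), and (ii) the fixed-shape
injection WITHOUT length restriction (`sum_shape_le_XK'`, through `prefixWalk_mem_archsK_of_extK`: the prefix cut at a surface visit of a
`k`-extendable walk is `k`-extendable, witnessed by the walk's own remaining steps followed by its fresh continuation), which lets the dip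
(six steps) serve under `k = 7`.  The case analysis of §4 (198 elementary steps, each an `omega` call on the brick-wall step relation, the
half-plane constraint, self-avoidance against at most seven earlier vertices, the climbing bound and the fresh continuation; the history
`ω j, ω (j−1), …, ω (j−5)` is revealed only where a backward excursion needs it) was laid out by a search script and is reproduced verbatim;
it is checked by the kernel like any other proof.

The recursion (§6): `X⁷_{j+14} ≤ y X⁷_{j+12} + y X⁷_{j+8} + y X⁷_{j+6} + 4y X⁷_{j+4} + 9y X⁷_{j+2} + 2y Σ_{t ≤ j} X⁷_t c_{j+13−t}(ℍ)`
(`j ≥ 5`; characteristic equation `1 = yz + yz³ + yz⁴ + 4yz⁵ + 9yz⁶ + O(yz⁷)` at `z = β⁻²`), the growth bound with tail constant `4·3¹³ = 6377292`,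
and the renewal condition at `B = y + 1/y + 1/y² + 2/y³ + 4/y⁴ + 6377300/y⁵` (§7: after `B ≥ y + 1/y + 1/y²` in `y/B²`, `B ≥ y + 1/y` in `y/B³` and
`B ≥ y` elsewhere, the polynomial inequality `5y¹² − 12y¹¹ + 26y¹⁰ − 28y⁹ + 38y⁸ + y⁷ + 24y⁶ + 46y⁵ + 19y⁴ + 41y³ + 20y² + 11y + 8 ≥ 0`, whose
coefficients in `y − 1` are all positive).

Sources.  N. R. Beaton, M. Bousquet-Mélou, J. de Gier, H. Duminil-Copin, A. J. Guttmann, CMP 326 (2014) = arXiv:1109.0358v5, §3.1,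
Proposition 5 (p. 9) and p. 10 (the first-order remark "`μ(y) ∼ √y`").  E. J. Janse van Rensburg, *The Statistical Mechanics of Interacting Walks,
Polygons, Animals and Vesicles* (OUP 2000), §3.3.2, Lemma 3.20.  J. M. Hammersley, G. M. Torrie, S. G. Whittington, J. Phys. A 15 (1982) 539, §2
(locator provisional, source not held).  I. G. Enting, I. Jensen, LNP 775 (2009), §7.4.2, Fig. 7.10 (brickwork form of the honeycomb lattice).
N. Madras, G. Slade, *The Self-Avoiding Walk* (1993), §1.1–§1.2.

## What is proved (namespace `…SAW.HexBW.Wall`)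

* §1 `climb_le`, `climb_le_even`, `climb_le_odd` — the climbing bound.
* §2 ★ `prefixWalk_mem_archsK_of_extK`, ★ `sum_shape_le_XK'` (fixed-shape injection for every `k`), `sum_fibW_dip_le_XK'` (`1 ≤ k`),
  `sum_fibW_ten_le_XK` (`5 ≤ k`).
* §3 `hpw_step`, `clash` (coordinate forms of one step / of self-avoidance); §4 (generated case analysis) `twelve_c1 … twelve_c6`, `twelve_main_gen`.
* §5 ★★★ **`twelve_coords7 (5 ≤ j) (7 ≤ k) : ∃ s : Fin 9, ∀ i ≤ 12, ω (j+2+i) = (X_{j+2} + Twelve.TX s i · σ, Twelve.TY s i)`**;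
  ★★ `sum_fibW_twelve_le_XK : Σ ≤ 9y · X^{(k)}_{j+2}`.
* §6 ★★ **`X7w_le_rec (5 ≤ j)`** (for `X⁷ = XKw 7`), `XKw_le_three_pow_mul_pow`, `X7w_le_mul_pow` (`6 ≤ ρ`,
  `y/ρ² + y/ρ⁶ + y/ρ⁸ + 4y/ρ¹⁰ + 9y/ρ¹² + 6377292 y/ρ¹⁴ ≤ 1 ⇒ X⁷_n ≤ 3¹⁹ y¹⁹ ρⁿ`).
* §7 `fifthB_condition`, ★★★ **`wallRate_sq_le_fifth (36 ≤ y) : β(y)² ≤ y + 1/y + 1/y² + 2/y³ + 4/y⁴ + 6377300/y⁵`**,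
  ★★★ `pow_four_mul_wallRate_sq_sub_le : y⁴ (β² − y − 1/y − 1/y² − 2/y³) ≤ 4 + 6377300/y`, `eventually_pow_four_mul_wallRate_sq_sub_le (4 < a)`.
* §8 ★★★ **THE FIFTH COEFFICIENT IS EXACTLY FOUR**: `pow_four_mul_wallRate_sq_sub_mem_Icc (36 ≤ y) : y⁴(…) ∈ [4 − 53853213/y, 4 + 6377300/y]`,
  `tendsto_pow_four_mul_wallRate_sq_sub : y⁴ (β(y)² − y − 1/y − 1/y² − 2/y³) → 4`, `wallRate_sq_fifth_mem_Icc`, `isBigO_wallRate_sq_fifth`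
  (`β² − y − 1/y − 1/y² − 2/y³ − 4/y⁴ = O(y⁻⁵)`), and the same for BBdGDCG's `μ(y) = HV.surfaceMu y`.

HONEST LABEL (author's proposal).  LANE THEOREM M, elementary, no new definitions (the nine shapes are the tree's `Twelve.TX/TY`); NEW-IN-WRITING (modest): the fifth coefficient of the strong-adsorption expansion
`β(y)² = y + 1/y + 1/y² + 2/y³ + 4/y⁴ + O(y⁻⁵)` of the Duminil-Copin–Smirnov-surface growth rate (print has first order only, BBdGDCG p. 10; the
lane's census conjecture continues `… + 6/y⁵ + O(y⁻⁶)`).  NOT CLAIMED: `y < 36`, the `O(y⁻⁵)` coefficient, optimal constants, the armchair wall.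
-/

noncomputable section

open Finset Filter Function
open Literature.Probability.LatticeModels Literature.Probability.Percolation SimpleGraph
open _root_.Topology

namespace Literature.Probability.RandomPlanarGeometry.SAW.HexBW.Wall

variable {y : ℝ} {n k : ℕ} {ω : ℕ → Site 2}

/-! ### §1  The climbing bound -/

/-- **Climbing costs two steps per level.** Along a brick-wall path, from a site whose vertical bond goes up (`X+Y` even) the height
gains at most `⌈s/2⌉` in `s` steps, and from a site whose vertical bond goes down (`X+Y` odd) at most `⌊s/2⌋`: after an up-step the
walk stands at a site whose vertical bond is the one just used. [cite: EntingJensen2009, §7.4.2, Fig. 7.10 (brickwork form of the honeycomb lattice)] -/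
theorem climb_le (hbw : IsBW n ω) : ∀ s t : ℕ, t + s ≤ n →
    ((ω t 0 + ω t 1) % 2 = 0 → ω (t + s) 1 ≤ ω t 1 + ((s + 1) / 2 : ℕ)) ∧
    ((ω t 0 + ω t 1) % 2 ≠ 0 → ω (t + s) 1 ≤ ω t 1 + (s / 2 : ℕ)) := by
  intro s
  induction s with
  | zero => intro t _; simp
  | succ s ih =>
    intro t ht
    have st := Arm.step_cases (hbw t (by omega))
    obtain ⟨h1, h2⟩ := ih (t + 1) (by omega)
    rw [show t + 1 + s = t + (s + 1) by omega] at h1 h2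
    have e1 : ((s + 1 + 1) / 2 : ℕ) = (s / 2 : ℕ) + 1 := by omega
    have e2 : ((s + 1) / 2 : ℕ) ≤ (s / 2 : ℕ) + 1 ∧ (s / 2 : ℕ) ≤ ((s + 1) / 2 : ℕ) := by omega
    refine ⟨fun hev => ?_, fun hodd => ?_⟩
    · rcases st with ⟨hy, hx⟩ | ⟨hx, hy, -⟩ | ⟨hx, hy, hpar⟩
      · have := h2 (by omega); push_cast [e1] at this ⊢; omega
      · have := h2 (by omega); push_cast [e1] at this ⊢; omega
      · exfalso; omega
    · rcases st with ⟨hy, hx⟩ | ⟨hx, hy, hpar⟩ | ⟨hx, hy, hpar⟩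
      · have := h1 (by omega); push_cast at this ⊢; omega
      · exfalso; omega
      · have := h1 (by omega); push_cast at this ⊢; omega

/-- Climbing bound at an even time `t` of a walk from the origin (the site has an up-bond): `Y_{t+s} ≤ Y_t + ⌈s/2⌉`.
[cite: EntingJensen2009, §7.4.2, Fig. 7.10; MadrasSlade1993, §1.1] -/
theorem climb_le_even (hω : ω ∈ saws n) {t s : ℕ} (ht : t % 2 = 0) (hts : t + s ≤ n) :
    ω (t + s) 1 ≤ ω t 1 + ((s + 1) / 2 : ℕ) := by
  obtain ⟨-, -, hbw, -⟩ := mem_saws_iff.1 hω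
  have hp := parity_apply hω (i := t) (by omega)
  exact (climb_le hbw s t hts).1 (by omega)

/-- Climbing bound at an odd time `t` of a walk from the origin (the site has a down-bond): `Y_{t+s} ≤ Y_t + ⌊s/2⌋`.
[cite: EntingJensen2009, §7.4.2, Fig. 7.10; MadrasSlade1993, §1.1] -/
theorem climb_le_odd (hω : ω ∈ saws n) {t s : ℕ} (ht : t % 2 = 1) (hts : t + s ≤ n) :
    ω (t + s) 1 ≤ ω t 1 + (s / 2 : ℕ) := by
  obtain ⟨-, -, hbw, -⟩ := mem_saws_iff.1 hω
  have hp := parity_apply hω (i := t) (by omega)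
  exact (climb_le hbw s t hts).2 (by omega)

/-! ### §2  Extendable prefixes and the fixed-shape injection for every `k` -/

/-- **The prefix of a `k`-step-extendable half-plane walk, cut at a surface visit at an even time `t ≤ n`, is a `k`-step-extendable arch**
(witness: the walk's own steps after time `t` followed by its fresh continuation), with the same visits up to time `t`.
[cite: MadrasSlade1993, §1.2, (1.2.3); HammersleyTorrieWhittington1982, §2] -/
theorem prefixWalk_mem_archsK_of_extK (hω : ω ∈ hpw n) (hE : ExtK k n ω) {t : ℕ} (ht : t ≤ n) (ht2 : t % 2 = 0) (hY : ω t 1 = 0) :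
    Zd.prefixWalk t ω ∈ archsK k t ∧ visits t (Zd.prefixWalk t ω) = visits t ω := by
  classical
  obtain ⟨hpa, hpv⟩ := prefixWalk_mem_archs hω ht ht2 hY
  refine ⟨mem_archsK.2 ⟨hpa, ?_⟩, hpv⟩
  obtain ⟨hωs, hH⟩ := mem_hpw.1 hω
  obtain ⟨-, -, hbw, hinj⟩ := mem_saws_iff.1 hωs
  obtain ⟨η, hη0, hadj, hηY, hηinj, hfresh⟩ := hE
  have hv : ∀ i ≤ t, Zd.prefixWalk t ω i = ω i := fun i hi => by simp [Zd.prefixWalk, min_eq_left hi]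
  have hne : ∀ a b : ℕ, a ≤ n → b ≤ n → ω a = ω b → a = b := fun a b ha hb h =>
    hinj (show a ∈ {j | j ≤ n} by simp only [Set.mem_setOf_eq]; exact ha)
      (show b ∈ {j | j ≤ n} by simp only [Set.mem_setOf_eq]; exact hb) h
  set c : ℕ := n - t with hc
  set θ : ℕ → Site 2 := fun i => if i ≤ c then ω (t + i) else η (i - c) with hθ
  have hle : ∀ i ≤ c, θ i = ω (t + i) := fun i hi => by simp only [hθ, if_pos hi]
  have hgt : ∀ i, c < i → θ i = η (i - c) := fun i hi => by simp only [hθ, if_neg (not_le.2 hi)]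
  have hθc : θ c = η 0 := by rw [hle c le_rfl, hη0, show t + c = n by omega]
  -- a uniform description of `θ i` for `i ≥ c`
  have hge : ∀ i, c ≤ i → θ i = η (i - c) := fun i hi => by
    rcases eq_or_lt_of_le hi with h | h
    · rw [← h, hθc, Nat.sub_self]
    · exact hgt i h
  refine ⟨θ, by rw [hle 0 (Nat.zero_le _), hv t le_rfl, add_zero], fun i hi => ?_, fun i hi1 hik => ?_, fun i hi i' hi' h => ?_,
    fun i hi j hj1 hjk h => ?_⟩
  · rcases Nat.lt_or_ge i c with h2 | h2
    · rw [hle i h2.le, hle (i + 1) h2, show t + (i + 1) = t + i + 1 by omega]; exact hbw _ (by omega)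
    · rw [hge i h2, hge (i + 1) (by omega), show i + 1 - c = i - c + 1 by omega]; exact hadj _ (by omega)
  · rcases Nat.lt_or_ge c i with h2 | h2
    · rw [hgt i h2]; exact hηY _ (by omega) (by omega)
    · rw [hle i h2]; exact hH _ (by omega)
  · rcases Nat.lt_or_ge i c with h2 | h2 <;> rcases Nat.lt_or_ge i' c with h2' | h2'
    · rw [hle i h2.le, hle i' h2'.le] at h; have := hne _ _ (by omega) (by omega) h; omega
    · rw [hle i h2.le, hge i' h2'] at h
      rcases eq_or_lt_of_le h2' with h3 | h3
      · rw [← h3, Nat.sub_self, hη0] at h; have := hne _ _ (by omega) (by omega) h; omega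
      · exact absurd h (hfresh _ (by omega) _ (by omega) (by omega))
    · rw [hge i h2, hle i' h2'.le] at h
      rcases eq_or_lt_of_le h2 with h3 | h3
      · rw [← h3, Nat.sub_self, hη0] at h; have := hne _ _ (by omega) (by omega) h; omega
      · exact absurd h.symm (hfresh _ (by omega) _ (by omega) (by omega))
    · rw [hge i h2, hge i' h2'] at h; have := hηinj _ (by omega) _ (by omega) h; omega
  · rw [hv i hi] at h
    rcases Nat.lt_or_ge c j with h2 | h2
    · rw [hgt j h2] at h; exact hfresh i (by omega) (j - c) (by omega) (by omega) h
    · rw [hle j h2] at h; have := hne _ _ (by omega) (by omega) h; omega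

open Classical in
/-- ★ **Fixed-shape injection, without the length restriction.**  Let `S` be a set of `k`-step-extendable arches of length `j+c+4` whose last
surface visit before the end is at time `j+2`, on which the last `c+2` steps are a FIXED function of `x = X_{j+2}` and `σ = X_{j+2} − X_{j+1}`.
Then `Σ_{S} y^{visits} ≤ y · X^{(k)}_{j+2}(y)` for EVERY `k`: the prefix map is injective on `S` and lands in `archsK k (j+2)` (witness: the excursion
itself followed by the arch's fresh continuation — `prefixWalk_mem_archsK_of_extK`). [cite: HammersleyTorrieWhittington1982, §2; MadrasSlade1993, §1.2, (1.2.3)] -/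
theorem sum_shape_le_XK' {j c : ℕ} (hy : 0 ≤ y) (d e : ℕ → ℤ) (S : Finset (ℕ → Site 2))
    (hS : S ⊆ (fibW (j + c) (j + 2)).filter (ExtK k (j + c + 4)))
    (hshape : ∀ ω ∈ S, ∀ i ≤ c + 2, ω (j + 2 + i) 0 = ω (j + 2) 0 + d i * (ω (j + 2) 0 - ω (j + 1) 0) ∧ ω (j + 2 + i) 1 = e i) :
    ∑ ω ∈ S, y ^ visits (j + c + 4) ω ≤ y * XKw k (j + 2) y := by
  set g : (ℕ → Site 2) → (ℕ → Site 2) := fun ω => Zd.prefixWalk (j + 2) ω with hg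
  have hmem : ∀ ω ∈ S, ω ∈ fibW (j + c) (j + 2) ∧ ExtK k (j + c + 4) ω := fun ω hω => Finset.mem_filter.1 (hS hω)
  have hprops : ∀ ω ∈ S, g ω ∈ archsK k (j + 2) ∧ visits (j + c + 4) ω = visits (j + 2) (g ω) + 1 := by
    intro ω hω
    obtain ⟨hωf, hE⟩ := hmem ω hω
    obtain ⟨hωh, hm, hend, -, hk2, hkY, hno, -⟩ := fibW_anatomy hωf
    rw [show j + c + 4 = j + c + 4 by rfl] at hend
    obtain ⟨hpa, hpv⟩ := prefixWalk_mem_archsK_of_extK (k := k) hωh hE (show j + 2 ≤ j + c + 4 by omega) hk2 hkY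
    refine ⟨hpa, ?_⟩
    have e1 := visits_add_eq_left (k := j + 2) (b := c + 1) (ζ := ω) (fun i hi1 hi5 h =>
      hno (j + 2 + i) (by omega) (by omega) h)
    rw [show j + c + 4 = j + 2 + (c + 1) + 1 by omega, visits_succ, e1, hpv]
    have h8 : (j + 2 + (c + 1) + 1) % 2 = 0 ∧ ω (j + 2 + (c + 1) + 1) 1 = 0 :=
      ⟨by omega, by rw [show j + 2 + (c + 1) + 1 = j + c + 4 by omega]; exact hend⟩
    rw [if_pos h8]
  have hinj : Set.InjOn g ↑S := by
    intro ω hω ω' hω' h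
    rw [Finset.mem_coe] at hω hω'
    have hc := hshape ω hω
    have hc' := hshape ω' hω'
    have hωs : ω ∈ saws (j + c + 4) := hpw_subset (fibW_anatomy (hmem ω hω).1).1
    have hωs' : ω' ∈ saws (j + c + 4) := hpw_subset (fibW_anatomy (hmem ω' hω').1).1
    have hagree : ∀ i ≤ j + 2, ω i = ω' i := fun i hi => by
      have := congrFun h i
      simpa [hg, Zd.prefixWalk, min_eq_left hi] using this
    have e1 : ω (j + 1) 0 = ω' (j + 1) 0 := by rw [hagree (j + 1) (by omega)]
    have e2 : ω (j + 2) 0 = ω' (j + 2) 0 := by rw [hagree (j + 2) le_rfl]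
    refine Arm.eq_of_agree hωs hωs' fun i hi => ?_
    rcases Nat.lt_or_ge i (j + 3) with hi' | hi'
    · exact hagree i (by omega)
    · obtain ⟨i', rfl⟩ : ∃ i', i = j + 2 + i' := ⟨i - (j + 2), by omega⟩
      obtain ⟨a0, a1⟩ := hc i' (by omega)
      obtain ⟨a0', a1'⟩ := hc' i' (by omega)
      rw [site_two_eq_iff]
      exact ⟨by rw [a0, a0', e1, e2], by rw [a1, a1']⟩
  calc ∑ ω ∈ S, y ^ visits (j + c + 4) ω = ∑ ω ∈ S, y * y ^ visits (j + 2) (g ω) :=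
        Finset.sum_congr rfl fun ω hω => by rw [(hprops ω hω).2, pow_succ, mul_comm]
    _ = y * ∑ ξ ∈ S.image g, y ^ visits (j + 2) ξ := by rw [Finset.mul_sum, Finset.sum_image hinj]
    _ ≤ y * XKw k (j + 2) y := by
        refine mul_le_mul_of_nonneg_left ?_ hy
        rw [XKw]
        refine Finset.sum_le_sum_of_subset_of_nonneg (fun ξ hξ => ?_) fun _ _ _ => pow_nonneg hy _
        obtain ⟨ω, hω, rfl⟩ := Finset.mem_image.1 hξ
        exact (hprops ω hω).1


/-! ### §3  Coordinate forms of one step and of self-avoidance -/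

/-- One step of a half-plane walk, unpacked in coordinates (`a + 1 = b ≤ n`): the brick-wall step relation between `ω a` and `ω b`, and both heights
`≤ 0`. [cite: EntingJensen2009, §7.4.2, Fig. 7.10; MadrasSlade1993, §1.1] -/
theorem hpw_step (hω : ω ∈ hpw n) {a b : ℕ} (hab : a + 1 = b) (hb : b ≤ n) :
    ((ω b 1 = ω a 1 ∧ (ω b 0 = ω a 0 + 1 ∨ ω a 0 = ω b 0 + 1)) ∨ (ω b 0 = ω a 0 ∧ ω b 1 = ω a 1 + 1 ∧ (ω a 0 + ω a 1) % 2 = 0) ∨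
      (ω b 0 = ω a 0 ∧ ω a 1 = ω b 1 + 1 ∧ (ω b 0 + ω b 1) % 2 = 0)) ∧ ω b 1 ≤ 0 ∧ ω a 1 ≤ 0 := by
  obtain ⟨hωs, hH⟩ := mem_hpw.1 hω
  obtain ⟨-, -, hbw, -⟩ := mem_saws_iff.1 hωs
  subst hab
  exact ⟨Arm.step_cases (hbw a (by omega)), hH _ hb, hH _ (by omega)⟩

/-- Self-avoidance in coordinates: two distinct times `a ≠ b ≤ n` of a half-plane walk cannot carry the same site.
[cite: MadrasSlade1993, §1.1] -/
theorem clash (hω : ω ∈ hpw n) {a b : ℕ} (h0 : ω a 0 = ω b 0) (h1 : ω a 1 = ω b 1) (ha : a ≤ n) (hb : b ≤ n) (hab : a ≠ b) : False := by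
  obtain ⟨hωs, -⟩ := mem_hpw.1 hω
  obtain ⟨-, -, -, hinj⟩ := mem_saws_iff.1 hωs
  exact hab (hinj (show a ∈ {i | i ≤ n} by simp only [Set.mem_setOf_eq]; exact ha)
    (show b ∈ {i | i ≤ n} by simp only [Set.mem_setOf_eq]; exact hb) ((site_two_eq_iff _ _).2 ⟨h0, h1⟩))

open Classical in
/-- **The dip fibre under `k`-step extendability, for every `k ≥ 1`**: `Σ_{fibW (j+4) (j+2) ∩ ExtK k} y^{visits} ≤ y · X^{(k)}_{j+2}(y)` (the parent's
`sum_fibW_dip_le_XK` needs `k ≤ 6`; here the excursion plus the fresh continuation witness extendability of the prefix).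
[cite: EntingJensen2009, §7.4.2, Fig. 7.10; HammersleyTorrieWhittington1982, §2] -/
theorem sum_fibW_dip_le_XK' (j : ℕ) (hy : 0 ≤ y) (hk1 : 1 ≤ k) :
    ∑ ω ∈ (fibW (j + 4) (j + 2)).filter (ExtK k (j + 8)), y ^ visits (j + 8) ω ≤ y * XKw k (j + 2) y := by
  refine sum_shape_le_XK' (c := 4) hy dipD dipE _ (fun ω hω => hω) fun ω hω i hi => ?_
  obtain ⟨hωf, hE⟩ := Finset.mem_filter.1 hω
  have hωa : ω ∈ archs (j + 8) := by
    have := (Finset.mem_filter.1 hωf).1; rwa [show j + 4 + 4 = j + 8 by omega] at this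
  obtain ⟨-, ⟨a0, a1⟩, ⟨b0, b1⟩, ⟨c0, c1⟩, ⟨d0, d1⟩, ⟨f0, f1⟩, ⟨g0, g1⟩⟩ := dip_coords hωf (hE.extRow hωa hk1)
  obtain ⟨-, -, -, -, -, hkY, -, -⟩ := fibW_anatomy hωf
  have hcase : i = 0 ∨ i = 1 ∨ i = 2 ∨ i = 3 ∨ i = 4 ∨ i = 5 ∨ i = 6 := by omega
  rcases hcase with rfl | rfl | rfl | rfl | rfl | rfl | rfl
  · exact ⟨by simp [dipD], by simpa [dipE] using hkY⟩
  · exact ⟨by rw [a0]; simp [dipD]; ring, by simpa [dipE] using a1⟩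
  · exact ⟨by rw [b0]; simp [dipD]; ring, by simpa [dipE] using b1⟩
  · exact ⟨by rw [c0]; simp [dipD]; ring, by simpa [dipE] using c1⟩
  · exact ⟨by rw [d0]; simp [dipD]; ring, by simpa [dipE] using d1⟩
  · exact ⟨by rw [f0]; simp [dipD]; ring, by simpa [dipE] using f1⟩
  · exact ⟨by rw [g0]; simp [dipD]; ring, by simpa [dipE] using g1⟩

/-- Union bound for a nonnegative summand (lane plumbing, as in the parent's private `sum_union_le_add`). [cite: MadrasSlade1993, §1.2, (1.2.3)] -/
private theorem sum_union_le_add' {α : Type*} [DecidableEq α] (A B : Finset α) (f : α → ℝ) (hf : ∀ x, 0 ≤ f x) :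
    ∑ x ∈ A ∪ B, f x ≤ ∑ x ∈ A, f x + ∑ x ∈ B, f x := by
  rw [← Finset.sum_union_inter]
  have : 0 ≤ ∑ x ∈ A ∩ B, f x := Finset.sum_nonneg fun x _ => hf x
  linarith

open Classical in
/-- **The ten-fibre under `k`-step extendability, `k ≥ 5`, weighs at most `4y · X^{(k)}_{j+2}(y)`** (`j ≥ 4`): the parent's `ten_coords5` holds for
every `k ≥ 5`; the injection is `sum_shape_le_XK'`. [cite: HammersleyTorrieWhittington1982, §2; EntingJensen2009, §7.4.2, Fig. 7.10] -/
theorem sum_fibW_ten_le_XK {j : ℕ} (hj : 4 ≤ j) (hy : 0 ≤ y) (hk : 5 ≤ k) :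
    ∑ ω ∈ (fibW (j + 8) (j + 2)).filter (ExtK k (j + 12)), y ^ visits (j + 12) ω ≤ 4 * y * XKw k (j + 2) y := by
  set S := (fibW (j + 8) (j + 2)).filter (ExtK k (j + 12)) with hS
  set Sa := S.filter (TenShape tenAD tenAE j)
  set Sb := S.filter (TenShape tenBD tenBE j)
  set Sc := S.filter (TenShape tenCD tenBE j)
  set Sl := S.filter (TenShape tenLD tenBE j)
  have hcover : S ⊆ Sa ∪ Sb ∪ Sc ∪ Sl := by
    intro ω hω
    obtain ⟨hωf, hE⟩ := Finset.mem_filter.1 hω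
    rcases ten_coords5 hj hωf hE hk with h | h | h | h
    · exact Finset.mem_union_left _ (Finset.mem_union_left _ (Finset.mem_union_left _ (Finset.mem_filter.2 ⟨hω, h⟩)))
    · exact Finset.mem_union_left _ (Finset.mem_union_left _ (Finset.mem_union_right _ (Finset.mem_filter.2 ⟨hω, h⟩)))
    · exact Finset.mem_union_left _ (Finset.mem_union_right _ (Finset.mem_filter.2 ⟨hω, h⟩))
    · exact Finset.mem_union_right _ (Finset.mem_filter.2 ⟨hω, h⟩)
  have hshape : ∀ (d e : ℕ → ℤ), ∑ ω ∈ S.filter (TenShape d e j), y ^ visits (j + 12) ω ≤ y * XKw k (j + 2) y := fun d e =>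
    sum_shape_le_XK' (c := 8) (k := k) hy d e _ (Finset.filter_subset _ _) fun ω hω => (Finset.mem_filter.1 hω).2
  have hf : ∀ ω : ℕ → Site 2, 0 ≤ y ^ visits (j + 12) ω := fun _ => pow_nonneg hy _
  calc ∑ ω ∈ S, y ^ visits (j + 12) ω ≤ ∑ ω ∈ Sa ∪ Sb ∪ Sc ∪ Sl, y ^ visits (j + 12) ω :=
        Finset.sum_le_sum_of_subset_of_nonneg hcover fun _ _ _ => pow_nonneg hy _
    _ ≤ ∑ ω ∈ Sa, y ^ visits (j + 12) ω + ∑ ω ∈ Sb, y ^ visits (j + 12) ω + ∑ ω ∈ Sc, y ^ visits (j + 12) ω +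
          ∑ ω ∈ Sl, y ^ visits (j + 12) ω := by
        have h1 := sum_union_le_add' (Sa ∪ Sb ∪ Sc) Sl _ hf
        have h2 := sum_union_le_add' (Sa ∪ Sb) Sc _ hf
        have h3 := sum_union_le_add' Sa Sb _ hf
        linarith
    _ ≤ 4 * y * XKw k (j + 2) y := by
        have ha := hshape tenAD tenAE
        have hb := hshape tenBD tenBE
        have hc := hshape tenCD tenBE
        have hl := hshape tenLD tenBE
        linarith

/-! ### §4  The case analysis of the twelve-fibre (laid out by a search script; every step is one `omega` call on the brick-wall step relation) -/

/-! ### §4  The case analysis of the twelve-fibre (generated by a search script; each step is one `omega` call) -/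

set_option maxHeartbeats 400000 in
/-- Case analysis of the twelve-fibre under seven-step extendability (generated; 39 steps): branch excursion prefix ⟨(1, 0), (1, -1), (2, -1), (3, -1), (4, -1)⟩. [cite: EntingJensen2009, §7.4.2, Fig. 7.10 (brickwork form of the honeycomb lattice); HammersleyTorrieWhittington1982, §2] -/
theorem twelve_c1 {j : ℕ} (hωh : ω ∈ hpw (j + 14)) (hend : ω (j + 14) 1 = 0) (hkY : ω (j + 2) 1 = 0) (hno : ∀ i, j + 2 < i → i ≤ j + 12 → ¬ (i % 2 = 0 ∧ ω i 1 = 0))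
    (hE : ExtK k (j + 14) ω) (hk : 7 ≤ k) (hX2 : ω (j + 2) 0 = ω (j + 1) 0 + 1 ∨ ω (j + 1) 0 = ω (j + 2) 0 + 1) (hxe : ω (j + 2) 0 % 2 = 0)
    (hj2 : j % 2 = 0) (h3 : ω (j + 3) 0 = 2 * ω (j + 2) 0 - ω (j + 1) 0 ∧ ω (j + 3) 1 = 0)
    (h4 : ω (j + 4) 0 = 2 * ω (j + 2) 0 - ω (j + 1) 0 ∧ ω (j + 4) 1 = -1) (h5 : ω (j + 5) 0 = 3 * ω (j + 2) 0 - 2 * ω (j + 1) 0 ∧ ω (j + 5) 1 = -1)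
    (h6 : ω (j + 6) 0 = 4 * ω (j + 2) 0 - 3 * ω (j + 1) 0 ∧ ω (j + 6) 1 = -1)
    (h7 : ω (j + 7) 0 = 5 * ω (j + 2) 0 - 4 * ω (j + 1) 0 ∧ ω (j + 7) 1 = -1)
    : ∃ s : Fin 9, ∀ i ≤ 12, ω (j + 2 + i) 0 = ω (j + 2) 0 + Twelve.TX s i * (ω (j + 2) 0 - ω (j + 1) 0) ∧ ω (j + 2 + i) 1 = Twelve.TY s i := by
  obtain ⟨x3, y3⟩ := h3; obtain ⟨x4, y4⟩ := h4; obtain ⟨x5, y5⟩ := h5; obtain ⟨x6, y6⟩ := h6; obtain ⟨x7, y7⟩ := h7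
  have hE' := hE; obtain ⟨η, hη0, hadj, hηY, hηinj, hfresh⟩ := hE'
  have A : (ω (j + 8) 0 = 6 * ω (j + 2) 0 - 5 * ω (j + 1) 0 ∧ ω (j + 8) 1 = -1) ∨ (ω (j + 8) 0 = 4 * ω (j + 2) 0 - 3 * ω (j + 1) 0 ∧ ω (j + 8) 1 = -1) ∨ (ω (j + 8) 0 = 5 * ω (j + 2) 0 - 4 * ω (j + 1) 0 ∧ ω (j + 8) 1 = -2) := by
    have s := hpw_step hωh (a := j + 7) (b := j + 8) (by omega) (by omega); clear * - s x7 y7 hX2 hxe; omega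
  rcases A with ⟨x8, y8⟩ | ⟨x8, y8⟩ | ⟨x8, y8⟩
  · have A : (ω (j + 9) 0 = 7 * ω (j + 2) 0 - 6 * ω (j + 1) 0 ∧ ω (j + 9) 1 = -1) ∨ (ω (j + 9) 0 = 5 * ω (j + 2) 0 - 4 * ω (j + 1) 0 ∧ ω (j + 9) 1 = -1) ∨ (ω (j + 9) 0 = 6 * ω (j + 2) 0 - 5 * ω (j + 1) 0 ∧ ω (j + 9) 1 = 0) := by
      have s := hpw_step hωh (a := j + 8) (b := j + 9) (by omega) (by omega); clear * - s x8 y8 hX2 hxe; omega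
    rcases A with ⟨x9, y9⟩ | ⟨x9, y9⟩ | ⟨x9, y9⟩
    · have A : (ω (j + 10) 0 = 8 * ω (j + 2) 0 - 7 * ω (j + 1) 0 ∧ ω (j + 10) 1 = -1) ∨ (ω (j + 10) 0 = 6 * ω (j + 2) 0 - 5 * ω (j + 1) 0 ∧ ω (j + 10) 1 = -1) ∨ (ω (j + 10) 0 = 7 * ω (j + 2) 0 - 6 * ω (j + 1) 0 ∧ ω (j + 10) 1 = -2) := by
        have s := hpw_step hωh (a := j + 9) (b := j + 10) (by omega) (by omega); clear * - s x9 y9 hX2 hxe; omega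
      rcases A with ⟨x10, y10⟩ | ⟨x10, y10⟩ | ⟨x10, y10⟩
      · have A : (ω (j + 11) 0 = 9 * ω (j + 2) 0 - 8 * ω (j + 1) 0 ∧ ω (j + 11) 1 = -1) ∨ (ω (j + 11) 0 = 7 * ω (j + 2) 0 - 6 * ω (j + 1) 0 ∧ ω (j + 11) 1 = -1) ∨ (ω (j + 11) 0 = 8 * ω (j + 2) 0 - 7 * ω (j + 1) 0 ∧ ω (j + 11) 1 = 0) := by
          have s := hpw_step hωh (a := j + 10) (b := j + 11) (by omega) (by omega); clear * - s x10 y10 hX2 hxe; omega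
        rcases A with ⟨x11, y11⟩ | ⟨x11, y11⟩ | ⟨x11, y11⟩
        · have A : (ω (j + 12) 0 = 10 * ω (j + 2) 0 - 9 * ω (j + 1) 0 ∧ ω (j + 12) 1 = -1) ∨ (ω (j + 12) 0 = 8 * ω (j + 2) 0 - 7 * ω (j + 1) 0 ∧ ω (j + 12) 1 = -1) ∨ (ω (j + 12) 0 = 9 * ω (j + 2) 0 - 8 * ω (j + 1) 0 ∧ ω (j + 12) 1 = -2) := by
            have s := hpw_step hωh (a := j + 11) (b := j + 12) (by omega) (by omega); clear * - s x11 y11 hX2 hxe; omega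
          rcases A with ⟨x12, y12⟩ | ⟨x12, y12⟩ | ⟨x12, y12⟩
          · have A : (ω (j + 13) 0 = 11 * ω (j + 2) 0 - 10 * ω (j + 1) 0 ∧ ω (j + 13) 1 = -1) ∨ (ω (j + 13) 0 = 9 * ω (j + 2) 0 - 8 * ω (j + 1) 0 ∧ ω (j + 13) 1 = -1) ∨ (ω (j + 13) 0 = 10 * ω (j + 2) 0 - 9 * ω (j + 1) 0 ∧ ω (j + 13) 1 = 0) := by
              have s := hpw_step hωh (a := j + 12) (b := j + 13) (by omega) (by omega); clear * - s x12 y12 hX2 hxe; omega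
            rcases A with ⟨x13, y13⟩ | ⟨x13, y13⟩ | ⟨x13, y13⟩
            · have hcl := climb_le_odd (hpw_subset hωh) (t := j + 13) (s := 1) (by omega) (by omega)
              rw [show j + 13 + 1 = j + 14 by omega] at hcl; clear * - hcl hend y13; exfalso; omega
            · exact (clash hωh (x13.trans x11.symm) (y13.trans y11.symm) (by omega) (by omega) (by omega)).elim
            · have A : (ω (j + 14) 0 = 11 * ω (j + 2) 0 - 10 * ω (j + 1) 0 ∧ ω (j + 14) 1 = 0) ∨ (ω (j + 14) 0 = 9 * ω (j + 2) 0 - 8 * ω (j + 1) 0 ∧ ω (j + 14) 1 = 0) := by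
                have s := hpw_step hωh (a := j + 13) (b := j + 14) (by omega) (by omega); clear * - s x13 y13 hX2 hxe hend; omega
              rcases A with ⟨x14, y14⟩ | ⟨x14, y14⟩
              · refine ⟨⟨0, by norm_num⟩, ?_⟩; rw [show Twelve.TX ⟨0, by norm_num⟩ = Twelve.x0 from rfl, show Twelve.TY ⟨0, by norm_num⟩ = Twelve.y0 from rfl]
                intro i hi; interval_cases i <;> simp only [Nat.add_assoc, Nat.reduceAdd, Nat.add_zero, Twelve.x0, Twelve.y0] <;> omega
              · have u0 : η 0 0 = 9 * ω (j + 2) 0 - 8 * ω (j + 1) 0 := by rw [hη0, x14]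
                have v0 : η 0 1 = 0 := by rw [hη0, y14]
                have A : (η 1 0 = 10 * ω (j + 2) 0 - 9 * ω (j + 1) 0 ∧ η 1 1 = 0) ∨ (η 1 0 = 8 * ω (j + 2) 0 - 7 * ω (j + 1) 0 ∧ η 1 1 = 0) := by
                  have s := Arm.step_cases (show brickWallGraph.Adj (η 0) (η 1) from hadj 0 (by omega)); have hH' := hηY 1 (by norm_num) (by omega)
                  clear * - s hH' u0 v0 hX2 hxe; omega
                rcases A with ⟨u1, v1⟩ | ⟨u1, v1⟩
                · exact (hfresh (j + 13) (by omega) 1 (by omega) (by omega) ((site_two_eq_iff _ _).2 ⟨(x13.trans u1.symm), (y13.trans v1.symm)⟩)).elim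
                · have A : (η 2 0 = 9 * ω (j + 2) 0 - 8 * ω (j + 1) 0 ∧ η 2 1 = 0) ∨ (η 2 0 = 7 * ω (j + 2) 0 - 6 * ω (j + 1) 0 ∧ η 2 1 = 0) ∨ (η 2 0 = 8 * ω (j + 2) 0 - 7 * ω (j + 1) 0 ∧ η 2 1 = -1) := by
                    have s := Arm.step_cases (show brickWallGraph.Adj (η 1) (η 2) from hadj 1 (by omega)); have hH' := hηY 2 (by norm_num) (by omega)
                    clear * - s hH' u1 v1 hX2 hxe; omega
                  rcases A with ⟨u2, v2⟩ | ⟨u2, v2⟩ | ⟨u2, v2⟩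
                  · exact (hfresh (j + 14) (by omega) 2 (by omega) (by omega) ((site_two_eq_iff _ _).2 ⟨(x14.trans u2.symm), (y14.trans v2.symm)⟩)).elim
                  · have A : (η 3 0 = 8 * ω (j + 2) 0 - 7 * ω (j + 1) 0 ∧ η 3 1 = 0) ∨ (η 3 0 = 6 * ω (j + 2) 0 - 5 * ω (j + 1) 0 ∧ η 3 1 = 0) := by
                      have s := Arm.step_cases (show brickWallGraph.Adj (η 2) (η 3) from hadj 2 (by omega)); have hH' := hηY 3 (by norm_num) (by omega)
                      clear * - s hH' u2 v2 hX2 hxe; omega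
                    rcases A with ⟨u3, v3⟩ | ⟨u3, v3⟩
                    · exact absurd (hηinj 1 (by omega) 3 (by omega) ((site_two_eq_iff _ _).2 ⟨u1.trans u3.symm, v1.trans v3.symm⟩)) (by omega)
                    · have A : (η 4 0 = 7 * ω (j + 2) 0 - 6 * ω (j + 1) 0 ∧ η 4 1 = 0) ∨ (η 4 0 = 5 * ω (j + 2) 0 - 4 * ω (j + 1) 0 ∧ η 4 1 = 0) ∨ (η 4 0 = 6 * ω (j + 2) 0 - 5 * ω (j + 1) 0 ∧ η 4 1 = -1) := by
                        have s := Arm.step_cases (show brickWallGraph.Adj (η 3) (η 4) from hadj 3 (by omega)); have hH' := hηY 4 (by norm_num) (by omega)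
                        clear * - s hH' u3 v3 hX2 hxe; omega
                      rcases A with ⟨u4, v4⟩ | ⟨u4, v4⟩ | ⟨u4, v4⟩
                      · exact absurd (hηinj 2 (by omega) 4 (by omega) ((site_two_eq_iff _ _).2 ⟨u2.trans u4.symm, v2.trans v4.symm⟩)) (by omega)
                      · have A : (η 5 0 = 6 * ω (j + 2) 0 - 5 * ω (j + 1) 0 ∧ η 5 1 = 0) ∨ (η 5 0 = 4 * ω (j + 2) 0 - 3 * ω (j + 1) 0 ∧ η 5 1 = 0) := by
                          have s := Arm.step_cases (show brickWallGraph.Adj (η 4) (η 5) from hadj 4 (by omega)); have hH' := hηY 5 (by norm_num) (by omega)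
                          clear * - s hH' u4 v4 hX2 hxe; omega
                        rcases A with ⟨u5, v5⟩ | ⟨u5, v5⟩
                        · exact absurd (hηinj 3 (by omega) 5 (by omega) ((site_two_eq_iff _ _).2 ⟨u3.trans u5.symm, v3.trans v5.symm⟩)) (by omega)
                        · have A : (η 6 0 = 5 * ω (j + 2) 0 - 4 * ω (j + 1) 0 ∧ η 6 1 = 0) ∨ (η 6 0 = 3 * ω (j + 2) 0 - 2 * ω (j + 1) 0 ∧ η 6 1 = 0) ∨ (η 6 0 = 4 * ω (j + 2) 0 - 3 * ω (j + 1) 0 ∧ η 6 1 = -1) := by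
                            have s := Arm.step_cases (show brickWallGraph.Adj (η 5) (η 6) from hadj 5 (by omega)); have hH' := hηY 6 (by norm_num) (by omega)
                            clear * - s hH' u5 v5 hX2 hxe; omega
                          rcases A with ⟨u6, v6⟩ | ⟨u6, v6⟩ | ⟨u6, v6⟩
                          · exact absurd (hηinj 4 (by omega) 6 (by omega) ((site_two_eq_iff _ _).2 ⟨u4.trans u6.symm, v4.trans v6.symm⟩)) (by omega)
                          · have A : (η 7 0 = 4 * ω (j + 2) 0 - 3 * ω (j + 1) 0 ∧ η 7 1 = 0) ∨ (η 7 0 = 2 * ω (j + 2) 0 - ω (j + 1) 0 ∧ η 7 1 = 0) := by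
                              have s := Arm.step_cases (show brickWallGraph.Adj (η 6) (η 7) from hadj 6 (by omega)); have hH' := hηY 7 (by norm_num) (by omega)
                              clear * - s hH' u6 v6 hX2 hxe; omega
                            rcases A with ⟨u7, v7⟩ | ⟨u7, v7⟩
                            · exact absurd (hηinj 5 (by omega) 7 (by omega) ((site_two_eq_iff _ _).2 ⟨u5.trans u7.symm, v5.trans v7.symm⟩)) (by omega)
                            · exact (hfresh (j + 3) (by omega) 7 (by omega) (by omega) ((site_two_eq_iff _ _).2 ⟨(x3.trans u7.symm), (y3.trans v7.symm)⟩)).elim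
                          · exact (hfresh (j + 6) (by omega) 6 (by omega) (by omega) ((site_two_eq_iff _ _).2 ⟨(x6.trans u6.symm), (y6.trans v6.symm)⟩)).elim
                      · exact (hfresh (j + 8) (by omega) 4 (by omega) (by omega) ((site_two_eq_iff _ _).2 ⟨(x8.trans u4.symm), (y8.trans v4.symm)⟩)).elim
                  · exact (hfresh (j + 10) (by omega) 2 (by omega) (by omega) ((site_two_eq_iff _ _).2 ⟨(x10.trans u2.symm), (y10.trans v2.symm)⟩)).elim
          · exact (clash hωh (x12.trans x10.symm) (y12.trans y10.symm) (by omega) (by omega) (by omega)).elim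
          · have hcl := climb_le_even (hpw_subset hωh) (t := j + 12) (s := 2) (by omega) (by omega)
            rw [show j + 12 + 2 = j + 14 by omega] at hcl; clear * - hcl hend y12; exfalso; omega
        · exact (clash hωh (x11.trans x9.symm) (y11.trans y9.symm) (by omega) (by omega) (by omega)).elim
        · have A : (ω (j + 12) 0 = 9 * ω (j + 2) 0 - 8 * ω (j + 1) 0 ∧ ω (j + 12) 1 = 0) ∨ (ω (j + 12) 0 = 7 * ω (j + 2) 0 - 6 * ω (j + 1) 0 ∧ ω (j + 12) 1 = 0) ∨ (ω (j + 12) 0 = 8 * ω (j + 2) 0 - 7 * ω (j + 1) 0 ∧ ω (j + 12) 1 = -1) := by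
            have s := hpw_step hωh (a := j + 11) (b := j + 12) (by omega) (by omega); clear * - s x11 y11 hX2 hxe; omega
          rcases A with ⟨x12, y12⟩ | ⟨x12, y12⟩ | ⟨x12, y12⟩
          · exact (hno (j + 12) (by omega) (by omega) ⟨by omega, y12⟩).elim
          · exact (hno (j + 12) (by omega) (by omega) ⟨by omega, y12⟩).elim
          · exact (clash hωh (x12.trans x10.symm) (y12.trans y10.symm) (by omega) (by omega) (by omega)).elim
      · exact (clash hωh (x10.trans x8.symm) (y10.trans y8.symm) (by omega) (by omega) (by omega)).elim
      · have A : (ω (j + 11) 0 = 8 * ω (j + 2) 0 - 7 * ω (j + 1) 0 ∧ ω (j + 11) 1 = -2) ∨ (ω (j + 11) 0 = 6 * ω (j + 2) 0 - 5 * ω (j + 1) 0 ∧ ω (j + 11) 1 = -2) ∨ (ω (j + 11) 0 = 7 * ω (j + 2) 0 - 6 * ω (j + 1) 0 ∧ ω (j + 11) 1 = -1) := by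
          have s := hpw_step hωh (a := j + 10) (b := j + 11) (by omega) (by omega); clear * - s x10 y10 hX2 hxe; omega
        rcases A with ⟨x11, y11⟩ | ⟨x11, y11⟩ | ⟨x11, y11⟩
        · have hcl := climb_le_odd (hpw_subset hωh) (t := j + 11) (s := 3) (by omega) (by omega)
          rw [show j + 11 + 3 = j + 14 by omega] at hcl; clear * - hcl hend y11; exfalso; omega
        · have hcl := climb_le_odd (hpw_subset hωh) (t := j + 11) (s := 3) (by omega) (by omega)
          rw [show j + 11 + 3 = j + 14 by omega] at hcl; clear * - hcl hend y11; exfalso; omega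
        · exact (clash hωh (x11.trans x9.symm) (y11.trans y9.symm) (by omega) (by omega) (by omega)).elim
    · exact (clash hωh (x9.trans x7.symm) (y9.trans y7.symm) (by omega) (by omega) (by omega)).elim
    · have A : (ω (j + 10) 0 = 7 * ω (j + 2) 0 - 6 * ω (j + 1) 0 ∧ ω (j + 10) 1 = 0) ∨ (ω (j + 10) 0 = 5 * ω (j + 2) 0 - 4 * ω (j + 1) 0 ∧ ω (j + 10) 1 = 0) ∨ (ω (j + 10) 0 = 6 * ω (j + 2) 0 - 5 * ω (j + 1) 0 ∧ ω (j + 10) 1 = -1) := by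
        have s := hpw_step hωh (a := j + 9) (b := j + 10) (by omega) (by omega); clear * - s x9 y9 hX2 hxe; omega
      rcases A with ⟨x10, y10⟩ | ⟨x10, y10⟩ | ⟨x10, y10⟩
      · exact (hno (j + 10) (by omega) (by omega) ⟨by omega, y10⟩).elim
      · exact (hno (j + 10) (by omega) (by omega) ⟨by omega, y10⟩).elim
      · exact (clash hωh (x10.trans x8.symm) (y10.trans y8.symm) (by omega) (by omega) (by omega)).elim
  · exact (clash hωh (x8.trans x6.symm) (y8.trans y6.symm) (by omega) (by omega) (by omega)).elim
  · have A : (ω (j + 9) 0 = 6 * ω (j + 2) 0 - 5 * ω (j + 1) 0 ∧ ω (j + 9) 1 = -2) ∨ (ω (j + 9) 0 = 4 * ω (j + 2) 0 - 3 * ω (j + 1) 0 ∧ ω (j + 9) 1 = -2) ∨ (ω (j + 9) 0 = 5 * ω (j + 2) 0 - 4 * ω (j + 1) 0 ∧ ω (j + 9) 1 = -1) := by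
      have s := hpw_step hωh (a := j + 8) (b := j + 9) (by omega) (by omega); clear * - s x8 y8 hX2 hxe; omega
    rcases A with ⟨x9, y9⟩ | ⟨x9, y9⟩ | ⟨x9, y9⟩
    · have A : (ω (j + 10) 0 = 7 * ω (j + 2) 0 - 6 * ω (j + 1) 0 ∧ ω (j + 10) 1 = -2) ∨ (ω (j + 10) 0 = 5 * ω (j + 2) 0 - 4 * ω (j + 1) 0 ∧ ω (j + 10) 1 = -2) ∨ (ω (j + 10) 0 = 6 * ω (j + 2) 0 - 5 * ω (j + 1) 0 ∧ ω (j + 10) 1 = -3) := by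
        have s := hpw_step hωh (a := j + 9) (b := j + 10) (by omega) (by omega); clear * - s x9 y9 hX2 hxe; omega
      rcases A with ⟨x10, y10⟩ | ⟨x10, y10⟩ | ⟨x10, y10⟩
      · have A : (ω (j + 11) 0 = 8 * ω (j + 2) 0 - 7 * ω (j + 1) 0 ∧ ω (j + 11) 1 = -2) ∨ (ω (j + 11) 0 = 6 * ω (j + 2) 0 - 5 * ω (j + 1) 0 ∧ ω (j + 11) 1 = -2) ∨ (ω (j + 11) 0 = 7 * ω (j + 2) 0 - 6 * ω (j + 1) 0 ∧ ω (j + 11) 1 = -1) := by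
          have s := hpw_step hωh (a := j + 10) (b := j + 11) (by omega) (by omega); clear * - s x10 y10 hX2 hxe; omega
        rcases A with ⟨x11, y11⟩ | ⟨x11, y11⟩ | ⟨x11, y11⟩
        · have hcl := climb_le_odd (hpw_subset hωh) (t := j + 11) (s := 3) (by omega) (by omega)
          rw [show j + 11 + 3 = j + 14 by omega] at hcl; clear * - hcl hend y11; exfalso; omega
        · exact (clash hωh (x11.trans x9.symm) (y11.trans y9.symm) (by omega) (by omega) (by omega)).elim
        · have A : (ω (j + 12) 0 = 8 * ω (j + 2) 0 - 7 * ω (j + 1) 0 ∧ ω (j + 12) 1 = -1) ∨ (ω (j + 12) 0 = 6 * ω (j + 2) 0 - 5 * ω (j + 1) 0 ∧ ω (j + 12) 1 = -1) ∨ (ω (j + 12) 0 = 7 * ω (j + 2) 0 - 6 * ω (j + 1) 0 ∧ ω (j + 12) 1 = -2) := by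
            have s := hpw_step hωh (a := j + 11) (b := j + 12) (by omega) (by omega); clear * - s x11 y11 hX2 hxe; omega
          rcases A with ⟨x12, y12⟩ | ⟨x12, y12⟩ | ⟨x12, y12⟩
          · have A : (ω (j + 13) 0 = 9 * ω (j + 2) 0 - 8 * ω (j + 1) 0 ∧ ω (j + 13) 1 = -1) ∨ (ω (j + 13) 0 = 7 * ω (j + 2) 0 - 6 * ω (j + 1) 0 ∧ ω (j + 13) 1 = -1) ∨ (ω (j + 13) 0 = 8 * ω (j + 2) 0 - 7 * ω (j + 1) 0 ∧ ω (j + 13) 1 = 0) := by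
              have s := hpw_step hωh (a := j + 12) (b := j + 13) (by omega) (by omega); clear * - s x12 y12 hX2 hxe; omega
            rcases A with ⟨x13, y13⟩ | ⟨x13, y13⟩ | ⟨x13, y13⟩
            · have hcl := climb_le_odd (hpw_subset hωh) (t := j + 13) (s := 1) (by omega) (by omega)
              rw [show j + 13 + 1 = j + 14 by omega] at hcl; clear * - hcl hend y13; exfalso; omega
            · exact (clash hωh (x13.trans x11.symm) (y13.trans y11.symm) (by omega) (by omega) (by omega)).elim
            · have A : (ω (j + 14) 0 = 9 * ω (j + 2) 0 - 8 * ω (j + 1) 0 ∧ ω (j + 14) 1 = 0) ∨ (ω (j + 14) 0 = 7 * ω (j + 2) 0 - 6 * ω (j + 1) 0 ∧ ω (j + 14) 1 = 0) := by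
                have s := hpw_step hωh (a := j + 13) (b := j + 14) (by omega) (by omega); clear * - s x13 y13 hX2 hxe hend; omega
              rcases A with ⟨x14, y14⟩ | ⟨x14, y14⟩
              · refine ⟨⟨1, by norm_num⟩, ?_⟩; rw [show Twelve.TX ⟨1, by norm_num⟩ = Twelve.x1 from rfl, show Twelve.TY ⟨1, by norm_num⟩ = Twelve.y1 from rfl]
                intro i hi; interval_cases i <;> simp only [Nat.add_assoc, Nat.reduceAdd, Nat.add_zero, Twelve.x1, Twelve.y1] <;> omega
              · have u0 : η 0 0 = 7 * ω (j + 2) 0 - 6 * ω (j + 1) 0 := by rw [hη0, x14]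
                have v0 : η 0 1 = 0 := by rw [hη0, y14]
                have A : (η 1 0 = 8 * ω (j + 2) 0 - 7 * ω (j + 1) 0 ∧ η 1 1 = 0) ∨ (η 1 0 = 6 * ω (j + 2) 0 - 5 * ω (j + 1) 0 ∧ η 1 1 = 0) := by
                  have s := Arm.step_cases (show brickWallGraph.Adj (η 0) (η 1) from hadj 0 (by omega)); have hH' := hηY 1 (by norm_num) (by omega)
                  clear * - s hH' u0 v0 hX2 hxe; omega
                rcases A with ⟨u1, v1⟩ | ⟨u1, v1⟩
                · exact (hfresh (j + 13) (by omega) 1 (by omega) (by omega) ((site_two_eq_iff _ _).2 ⟨(x13.trans u1.symm), (y13.trans v1.symm)⟩)).elim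
                · have A : (η 2 0 = 7 * ω (j + 2) 0 - 6 * ω (j + 1) 0 ∧ η 2 1 = 0) ∨ (η 2 0 = 5 * ω (j + 2) 0 - 4 * ω (j + 1) 0 ∧ η 2 1 = 0) ∨ (η 2 0 = 6 * ω (j + 2) 0 - 5 * ω (j + 1) 0 ∧ η 2 1 = -1) := by
                    have s := Arm.step_cases (show brickWallGraph.Adj (η 1) (η 2) from hadj 1 (by omega)); have hH' := hηY 2 (by norm_num) (by omega)
                    clear * - s hH' u1 v1 hX2 hxe; omega
                  rcases A with ⟨u2, v2⟩ | ⟨u2, v2⟩ | ⟨u2, v2⟩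
                  · exact (hfresh (j + 14) (by omega) 2 (by omega) (by omega) ((site_two_eq_iff _ _).2 ⟨(x14.trans u2.symm), (y14.trans v2.symm)⟩)).elim
                  · have A : (η 3 0 = 6 * ω (j + 2) 0 - 5 * ω (j + 1) 0 ∧ η 3 1 = 0) ∨ (η 3 0 = 4 * ω (j + 2) 0 - 3 * ω (j + 1) 0 ∧ η 3 1 = 0) := by
                      have s := Arm.step_cases (show brickWallGraph.Adj (η 2) (η 3) from hadj 2 (by omega)); have hH' := hηY 3 (by norm_num) (by omega)
                      clear * - s hH' u2 v2 hX2 hxe; omega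
                    rcases A with ⟨u3, v3⟩ | ⟨u3, v3⟩
                    · exact absurd (hηinj 1 (by omega) 3 (by omega) ((site_two_eq_iff _ _).2 ⟨u1.trans u3.symm, v1.trans v3.symm⟩)) (by omega)
                    · have A : (η 4 0 = 5 * ω (j + 2) 0 - 4 * ω (j + 1) 0 ∧ η 4 1 = 0) ∨ (η 4 0 = 3 * ω (j + 2) 0 - 2 * ω (j + 1) 0 ∧ η 4 1 = 0) ∨ (η 4 0 = 4 * ω (j + 2) 0 - 3 * ω (j + 1) 0 ∧ η 4 1 = -1) := by
                        have s := Arm.step_cases (show brickWallGraph.Adj (η 3) (η 4) from hadj 3 (by omega)); have hH' := hηY 4 (by norm_num) (by omega)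
                        clear * - s hH' u3 v3 hX2 hxe; omega
                      rcases A with ⟨u4, v4⟩ | ⟨u4, v4⟩ | ⟨u4, v4⟩
                      · exact absurd (hηinj 2 (by omega) 4 (by omega) ((site_two_eq_iff _ _).2 ⟨u2.trans u4.symm, v2.trans v4.symm⟩)) (by omega)
                      · have A : (η 5 0 = 4 * ω (j + 2) 0 - 3 * ω (j + 1) 0 ∧ η 5 1 = 0) ∨ (η 5 0 = 2 * ω (j + 2) 0 - ω (j + 1) 0 ∧ η 5 1 = 0) := by
                          have s := Arm.step_cases (show brickWallGraph.Adj (η 4) (η 5) from hadj 4 (by omega)); have hH' := hηY 5 (by norm_num) (by omega)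
                          clear * - s hH' u4 v4 hX2 hxe; omega
                        rcases A with ⟨u5, v5⟩ | ⟨u5, v5⟩
                        · exact absurd (hηinj 3 (by omega) 5 (by omega) ((site_two_eq_iff _ _).2 ⟨u3.trans u5.symm, v3.trans v5.symm⟩)) (by omega)
                        · exact (hfresh (j + 3) (by omega) 5 (by omega) (by omega) ((site_two_eq_iff _ _).2 ⟨(x3.trans u5.symm), (y3.trans v5.symm)⟩)).elim
                      · exact (hfresh (j + 6) (by omega) 4 (by omega) (by omega) ((site_two_eq_iff _ _).2 ⟨(x6.trans u4.symm), (y6.trans v4.symm)⟩)).elim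
                  · have A : (η 3 0 = 7 * ω (j + 2) 0 - 6 * ω (j + 1) 0 ∧ η 3 1 = -1) ∨ (η 3 0 = 5 * ω (j + 2) 0 - 4 * ω (j + 1) 0 ∧ η 3 1 = -1) ∨ (η 3 0 = 6 * ω (j + 2) 0 - 5 * ω (j + 1) 0 ∧ η 3 1 = 0) := by
                      have s := Arm.step_cases (show brickWallGraph.Adj (η 2) (η 3) from hadj 2 (by omega)); have hH' := hηY 3 (by norm_num) (by omega)
                      clear * - s hH' u2 v2 hX2 hxe; omega
                    rcases A with ⟨u3, v3⟩ | ⟨u3, v3⟩ | ⟨u3, v3⟩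
                    · exact (hfresh (j + 11) (by omega) 3 (by omega) (by omega) ((site_two_eq_iff _ _).2 ⟨(x11.trans u3.symm), (y11.trans v3.symm)⟩)).elim
                    · exact (hfresh (j + 7) (by omega) 3 (by omega) (by omega) ((site_two_eq_iff _ _).2 ⟨(x7.trans u3.symm), (y7.trans v3.symm)⟩)).elim
                    · exact absurd (hηinj 1 (by omega) 3 (by omega) ((site_two_eq_iff _ _).2 ⟨u1.trans u3.symm, v1.trans v3.symm⟩)) (by omega)
          · have A : (ω (j + 13) 0 = 7 * ω (j + 2) 0 - 6 * ω (j + 1) 0 ∧ ω (j + 13) 1 = -1) ∨ (ω (j + 13) 0 = 5 * ω (j + 2) 0 - 4 * ω (j + 1) 0 ∧ ω (j + 13) 1 = -1) ∨ (ω (j + 13) 0 = 6 * ω (j + 2) 0 - 5 * ω (j + 1) 0 ∧ ω (j + 13) 1 = 0) := by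
              have s := hpw_step hωh (a := j + 12) (b := j + 13) (by omega) (by omega); clear * - s x12 y12 hX2 hxe; omega
            rcases A with ⟨x13, y13⟩ | ⟨x13, y13⟩ | ⟨x13, y13⟩
            · exact (clash hωh (x13.trans x11.symm) (y13.trans y11.symm) (by omega) (by omega) (by omega)).elim
            · exact (clash hωh (x13.trans x7.symm) (y13.trans y7.symm) (by omega) (by omega) (by omega)).elim
            · have A : (ω (j + 14) 0 = 7 * ω (j + 2) 0 - 6 * ω (j + 1) 0 ∧ ω (j + 14) 1 = 0) ∨ (ω (j + 14) 0 = 5 * ω (j + 2) 0 - 4 * ω (j + 1) 0 ∧ ω (j + 14) 1 = 0) := by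
                have s := hpw_step hωh (a := j + 13) (b := j + 14) (by omega) (by omega); clear * - s x13 y13 hX2 hxe hend; omega
              rcases A with ⟨x14, y14⟩ | ⟨x14, y14⟩
              · refine ⟨⟨2, by norm_num⟩, ?_⟩; rw [show Twelve.TX ⟨2, by norm_num⟩ = Twelve.x2 from rfl, show Twelve.TY ⟨2, by norm_num⟩ = Twelve.y2 from rfl]
                intro i hi; interval_cases i <;> simp only [Nat.add_assoc, Nat.reduceAdd, Nat.add_zero, Twelve.x2, Twelve.y2] <;> omega
              · have u0 : η 0 0 = 5 * ω (j + 2) 0 - 4 * ω (j + 1) 0 := by rw [hη0, x14]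
                have v0 : η 0 1 = 0 := by rw [hη0, y14]
                have A : (η 1 0 = 6 * ω (j + 2) 0 - 5 * ω (j + 1) 0 ∧ η 1 1 = 0) ∨ (η 1 0 = 4 * ω (j + 2) 0 - 3 * ω (j + 1) 0 ∧ η 1 1 = 0) := by
                  have s := Arm.step_cases (show brickWallGraph.Adj (η 0) (η 1) from hadj 0 (by omega)); have hH' := hηY 1 (by norm_num) (by omega)
                  clear * - s hH' u0 v0 hX2 hxe; omega
                rcases A with ⟨u1, v1⟩ | ⟨u1, v1⟩
                · exact (hfresh (j + 13) (by omega) 1 (by omega) (by omega) ((site_two_eq_iff _ _).2 ⟨(x13.trans u1.symm), (y13.trans v1.symm)⟩)).elim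
                · have A : (η 2 0 = 5 * ω (j + 2) 0 - 4 * ω (j + 1) 0 ∧ η 2 1 = 0) ∨ (η 2 0 = 3 * ω (j + 2) 0 - 2 * ω (j + 1) 0 ∧ η 2 1 = 0) ∨ (η 2 0 = 4 * ω (j + 2) 0 - 3 * ω (j + 1) 0 ∧ η 2 1 = -1) := by
                    have s := Arm.step_cases (show brickWallGraph.Adj (η 1) (η 2) from hadj 1 (by omega)); have hH' := hηY 2 (by norm_num) (by omega)
                    clear * - s hH' u1 v1 hX2 hxe; omega
                  rcases A with ⟨u2, v2⟩ | ⟨u2, v2⟩ | ⟨u2, v2⟩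
                  · exact (hfresh (j + 14) (by omega) 2 (by omega) (by omega) ((site_two_eq_iff _ _).2 ⟨(x14.trans u2.symm), (y14.trans v2.symm)⟩)).elim
                  · have A : (η 3 0 = 4 * ω (j + 2) 0 - 3 * ω (j + 1) 0 ∧ η 3 1 = 0) ∨ (η 3 0 = 2 * ω (j + 2) 0 - ω (j + 1) 0 ∧ η 3 1 = 0) := by
                      have s := Arm.step_cases (show brickWallGraph.Adj (η 2) (η 3) from hadj 2 (by omega)); have hH' := hηY 3 (by norm_num) (by omega)
                      clear * - s hH' u2 v2 hX2 hxe; omega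
                    rcases A with ⟨u3, v3⟩ | ⟨u3, v3⟩
                    · exact absurd (hηinj 1 (by omega) 3 (by omega) ((site_two_eq_iff _ _).2 ⟨u1.trans u3.symm, v1.trans v3.symm⟩)) (by omega)
                    · exact (hfresh (j + 3) (by omega) 3 (by omega) (by omega) ((site_two_eq_iff _ _).2 ⟨(x3.trans u3.symm), (y3.trans v3.symm)⟩)).elim
                  · exact (hfresh (j + 6) (by omega) 2 (by omega) (by omega) ((site_two_eq_iff _ _).2 ⟨(x6.trans u2.symm), (y6.trans v2.symm)⟩)).elim
          · exact (clash hωh (x12.trans x10.symm) (y12.trans y10.symm) (by omega) (by omega) (by omega)).elim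
      · exact (clash hωh (x10.trans x8.symm) (y10.trans y8.symm) (by omega) (by omega) (by omega)).elim
      · have hcl := climb_le_even (hpw_subset hωh) (t := j + 10) (s := 4) (by omega) (by omega)
        rw [show j + 10 + 4 = j + 14 by omega] at hcl; clear * - hcl hend y10; exfalso; omega
    · have A : (ω (j + 10) 0 = 5 * ω (j + 2) 0 - 4 * ω (j + 1) 0 ∧ ω (j + 10) 1 = -2) ∨ (ω (j + 10) 0 = 3 * ω (j + 2) 0 - 2 * ω (j + 1) 0 ∧ ω (j + 10) 1 = -2) ∨ (ω (j + 10) 0 = 4 * ω (j + 2) 0 - 3 * ω (j + 1) 0 ∧ ω (j + 10) 1 = -3) := by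
        have s := hpw_step hωh (a := j + 9) (b := j + 10) (by omega) (by omega); clear * - s x9 y9 hX2 hxe; omega
      rcases A with ⟨x10, y10⟩ | ⟨x10, y10⟩ | ⟨x10, y10⟩
      · exact (clash hωh (x10.trans x8.symm) (y10.trans y8.symm) (by omega) (by omega) (by omega)).elim
      · have A : (ω (j + 11) 0 = 4 * ω (j + 2) 0 - 3 * ω (j + 1) 0 ∧ ω (j + 11) 1 = -2) ∨ (ω (j + 11) 0 = 2 * ω (j + 2) 0 - ω (j + 1) 0 ∧ ω (j + 11) 1 = -2) ∨ (ω (j + 11) 0 = 3 * ω (j + 2) 0 - 2 * ω (j + 1) 0 ∧ ω (j + 11) 1 = -1) := by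
          have s := hpw_step hωh (a := j + 10) (b := j + 11) (by omega) (by omega); clear * - s x10 y10 hX2 hxe; omega
        rcases A with ⟨x11, y11⟩ | ⟨x11, y11⟩ | ⟨x11, y11⟩
        · exact (clash hωh (x11.trans x9.symm) (y11.trans y9.symm) (by omega) (by omega) (by omega)).elim
        · have hcl := climb_le_odd (hpw_subset hωh) (t := j + 11) (s := 3) (by omega) (by omega)
          rw [show j + 11 + 3 = j + 14 by omega] at hcl; clear * - hcl hend y11; exfalso; omega
        · exact (clash hωh (x11.trans x5.symm) (y11.trans y5.symm) (by omega) (by omega) (by omega)).elim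
      · have hcl := climb_le_even (hpw_subset hωh) (t := j + 10) (s := 4) (by omega) (by omega)
        rw [show j + 10 + 4 = j + 14 by omega] at hcl; clear * - hcl hend y10; exfalso; omega
    · exact (clash hωh (x9.trans x7.symm) (y9.trans y7.symm) (by omega) (by omega) (by omega)).elim

set_option maxHeartbeats 400000 in
/-- Case analysis of the twelve-fibre under seven-step extendability (generated; 28 steps): branch excursion prefix ⟨(1, 0), (1, -1), (2, -1), (2, -2), (3, -2), (4, -2), (5, -2)⟩. [cite: EntingJensen2009, §7.4.2, Fig. 7.10 (brickwork form of the honeycomb lattice); HammersleyTorrieWhittington1982, §2] -/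
theorem twelve_c2 {j : ℕ} (hωh : ω ∈ hpw (j + 14)) (hend : ω (j + 14) 1 = 0) (hkY : ω (j + 2) 1 = 0) (hE : ExtK k (j + 14) ω)
    (hk : 7 ≤ k) (hX2 : ω (j + 2) 0 = ω (j + 1) 0 + 1 ∨ ω (j + 1) 0 = ω (j + 2) 0 + 1) (hxe : ω (j + 2) 0 % 2 = 0) (hj2 : j % 2 = 0)
    (h3 : ω (j + 3) 0 = 2 * ω (j + 2) 0 - ω (j + 1) 0 ∧ ω (j + 3) 1 = 0) (h4 : ω (j + 4) 0 = 2 * ω (j + 2) 0 - ω (j + 1) 0 ∧ ω (j + 4) 1 = -1)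
    (h5 : ω (j + 5) 0 = 3 * ω (j + 2) 0 - 2 * ω (j + 1) 0 ∧ ω (j + 5) 1 = -1)
    (h6 : ω (j + 6) 0 = 3 * ω (j + 2) 0 - 2 * ω (j + 1) 0 ∧ ω (j + 6) 1 = -2)
    (h7 : ω (j + 7) 0 = 4 * ω (j + 2) 0 - 3 * ω (j + 1) 0 ∧ ω (j + 7) 1 = -2)
    (h8 : ω (j + 8) 0 = 5 * ω (j + 2) 0 - 4 * ω (j + 1) 0 ∧ ω (j + 8) 1 = -2)
    (h9 : ω (j + 9) 0 = 6 * ω (j + 2) 0 - 5 * ω (j + 1) 0 ∧ ω (j + 9) 1 = -2)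
    : ∃ s : Fin 9, ∀ i ≤ 12, ω (j + 2 + i) 0 = ω (j + 2) 0 + Twelve.TX s i * (ω (j + 2) 0 - ω (j + 1) 0) ∧ ω (j + 2 + i) 1 = Twelve.TY s i := by
  obtain ⟨x3, y3⟩ := h3; obtain ⟨x4, y4⟩ := h4; obtain ⟨x5, y5⟩ := h5; obtain ⟨x6, y6⟩ := h6; obtain ⟨x7, y7⟩ := h7; obtain ⟨x8, y8⟩ := h8
  obtain ⟨x9, y9⟩ := h9
  have hE' := hE; obtain ⟨η, hη0, hadj, hηY, hηinj, hfresh⟩ := hE'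
  have A : (ω (j + 10) 0 = 7 * ω (j + 2) 0 - 6 * ω (j + 1) 0 ∧ ω (j + 10) 1 = -2) ∨ (ω (j + 10) 0 = 5 * ω (j + 2) 0 - 4 * ω (j + 1) 0 ∧ ω (j + 10) 1 = -2) ∨ (ω (j + 10) 0 = 6 * ω (j + 2) 0 - 5 * ω (j + 1) 0 ∧ ω (j + 10) 1 = -3) := by
    have s := hpw_step hωh (a := j + 9) (b := j + 10) (by omega) (by omega); clear * - s x9 y9 hX2 hxe; omega
  rcases A with ⟨x10, y10⟩ | ⟨x10, y10⟩ | ⟨x10, y10⟩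
  · have A : (ω (j + 11) 0 = 8 * ω (j + 2) 0 - 7 * ω (j + 1) 0 ∧ ω (j + 11) 1 = -2) ∨ (ω (j + 11) 0 = 6 * ω (j + 2) 0 - 5 * ω (j + 1) 0 ∧ ω (j + 11) 1 = -2) ∨ (ω (j + 11) 0 = 7 * ω (j + 2) 0 - 6 * ω (j + 1) 0 ∧ ω (j + 11) 1 = -1) := by
      have s := hpw_step hωh (a := j + 10) (b := j + 11) (by omega) (by omega); clear * - s x10 y10 hX2 hxe; omega
    rcases A with ⟨x11, y11⟩ | ⟨x11, y11⟩ | ⟨x11, y11⟩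
    · have hcl := climb_le_odd (hpw_subset hωh) (t := j + 11) (s := 3) (by omega) (by omega)
      rw [show j + 11 + 3 = j + 14 by omega] at hcl; clear * - hcl hend y11; exfalso; omega
    · exact (clash hωh (x11.trans x9.symm) (y11.trans y9.symm) (by omega) (by omega) (by omega)).elim
    · have A : (ω (j + 12) 0 = 8 * ω (j + 2) 0 - 7 * ω (j + 1) 0 ∧ ω (j + 12) 1 = -1) ∨ (ω (j + 12) 0 = 6 * ω (j + 2) 0 - 5 * ω (j + 1) 0 ∧ ω (j + 12) 1 = -1) ∨ (ω (j + 12) 0 = 7 * ω (j + 2) 0 - 6 * ω (j + 1) 0 ∧ ω (j + 12) 1 = -2) := by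
        have s := hpw_step hωh (a := j + 11) (b := j + 12) (by omega) (by omega); clear * - s x11 y11 hX2 hxe; omega
      rcases A with ⟨x12, y12⟩ | ⟨x12, y12⟩ | ⟨x12, y12⟩
      · have A : (ω (j + 13) 0 = 9 * ω (j + 2) 0 - 8 * ω (j + 1) 0 ∧ ω (j + 13) 1 = -1) ∨ (ω (j + 13) 0 = 7 * ω (j + 2) 0 - 6 * ω (j + 1) 0 ∧ ω (j + 13) 1 = -1) ∨ (ω (j + 13) 0 = 8 * ω (j + 2) 0 - 7 * ω (j + 1) 0 ∧ ω (j + 13) 1 = 0) := by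
          have s := hpw_step hωh (a := j + 12) (b := j + 13) (by omega) (by omega); clear * - s x12 y12 hX2 hxe; omega
        rcases A with ⟨x13, y13⟩ | ⟨x13, y13⟩ | ⟨x13, y13⟩
        · have hcl := climb_le_odd (hpw_subset hωh) (t := j + 13) (s := 1) (by omega) (by omega)
          rw [show j + 13 + 1 = j + 14 by omega] at hcl; clear * - hcl hend y13; exfalso; omega
        · exact (clash hωh (x13.trans x11.symm) (y13.trans y11.symm) (by omega) (by omega) (by omega)).elim
        · have A : (ω (j + 14) 0 = 9 * ω (j + 2) 0 - 8 * ω (j + 1) 0 ∧ ω (j + 14) 1 = 0) ∨ (ω (j + 14) 0 = 7 * ω (j + 2) 0 - 6 * ω (j + 1) 0 ∧ ω (j + 14) 1 = 0) := by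
            have s := hpw_step hωh (a := j + 13) (b := j + 14) (by omega) (by omega); clear * - s x13 y13 hX2 hxe hend; omega
          rcases A with ⟨x14, y14⟩ | ⟨x14, y14⟩
          · refine ⟨⟨3, by norm_num⟩, ?_⟩; rw [show Twelve.TX ⟨3, by norm_num⟩ = Twelve.x3 from rfl, show Twelve.TY ⟨3, by norm_num⟩ = Twelve.y3 from rfl]
            intro i hi; interval_cases i <;> simp only [Nat.add_assoc, Nat.reduceAdd, Nat.add_zero, Twelve.x3, Twelve.y3] <;> omega
          · have u0 : η 0 0 = 7 * ω (j + 2) 0 - 6 * ω (j + 1) 0 := by rw [hη0, x14]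
            have v0 : η 0 1 = 0 := by rw [hη0, y14]
            have A : (η 1 0 = 8 * ω (j + 2) 0 - 7 * ω (j + 1) 0 ∧ η 1 1 = 0) ∨ (η 1 0 = 6 * ω (j + 2) 0 - 5 * ω (j + 1) 0 ∧ η 1 1 = 0) := by
              have s := Arm.step_cases (show brickWallGraph.Adj (η 0) (η 1) from hadj 0 (by omega)); have hH' := hηY 1 (by norm_num) (by omega)
              clear * - s hH' u0 v0 hX2 hxe; omega
            rcases A with ⟨u1, v1⟩ | ⟨u1, v1⟩
            · exact (hfresh (j + 13) (by omega) 1 (by omega) (by omega) ((site_two_eq_iff _ _).2 ⟨(x13.trans u1.symm), (y13.trans v1.symm)⟩)).elim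
            · have A : (η 2 0 = 7 * ω (j + 2) 0 - 6 * ω (j + 1) 0 ∧ η 2 1 = 0) ∨ (η 2 0 = 5 * ω (j + 2) 0 - 4 * ω (j + 1) 0 ∧ η 2 1 = 0) ∨ (η 2 0 = 6 * ω (j + 2) 0 - 5 * ω (j + 1) 0 ∧ η 2 1 = -1) := by
                have s := Arm.step_cases (show brickWallGraph.Adj (η 1) (η 2) from hadj 1 (by omega)); have hH' := hηY 2 (by norm_num) (by omega)
                clear * - s hH' u1 v1 hX2 hxe; omega
              rcases A with ⟨u2, v2⟩ | ⟨u2, v2⟩ | ⟨u2, v2⟩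
              · exact (hfresh (j + 14) (by omega) 2 (by omega) (by omega) ((site_two_eq_iff _ _).2 ⟨(x14.trans u2.symm), (y14.trans v2.symm)⟩)).elim
              · have A : (η 3 0 = 6 * ω (j + 2) 0 - 5 * ω (j + 1) 0 ∧ η 3 1 = 0) ∨ (η 3 0 = 4 * ω (j + 2) 0 - 3 * ω (j + 1) 0 ∧ η 3 1 = 0) := by
                  have s := Arm.step_cases (show brickWallGraph.Adj (η 2) (η 3) from hadj 2 (by omega)); have hH' := hηY 3 (by norm_num) (by omega)
                  clear * - s hH' u2 v2 hX2 hxe; omega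
                rcases A with ⟨u3, v3⟩ | ⟨u3, v3⟩
                · exact absurd (hηinj 1 (by omega) 3 (by omega) ((site_two_eq_iff _ _).2 ⟨u1.trans u3.symm, v1.trans v3.symm⟩)) (by omega)
                · have A : (η 4 0 = 5 * ω (j + 2) 0 - 4 * ω (j + 1) 0 ∧ η 4 1 = 0) ∨ (η 4 0 = 3 * ω (j + 2) 0 - 2 * ω (j + 1) 0 ∧ η 4 1 = 0) ∨ (η 4 0 = 4 * ω (j + 2) 0 - 3 * ω (j + 1) 0 ∧ η 4 1 = -1) := by
                    have s := Arm.step_cases (show brickWallGraph.Adj (η 3) (η 4) from hadj 3 (by omega)); have hH' := hηY 4 (by norm_num) (by omega)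
                    clear * - s hH' u3 v3 hX2 hxe; omega
                  rcases A with ⟨u4, v4⟩ | ⟨u4, v4⟩ | ⟨u4, v4⟩
                  · exact absurd (hηinj 2 (by omega) 4 (by omega) ((site_two_eq_iff _ _).2 ⟨u2.trans u4.symm, v2.trans v4.symm⟩)) (by omega)
                  · have A : (η 5 0 = 4 * ω (j + 2) 0 - 3 * ω (j + 1) 0 ∧ η 5 1 = 0) ∨ (η 5 0 = 2 * ω (j + 2) 0 - ω (j + 1) 0 ∧ η 5 1 = 0) := by
                      have s := Arm.step_cases (show brickWallGraph.Adj (η 4) (η 5) from hadj 4 (by omega)); have hH' := hηY 5 (by norm_num) (by omega)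
                      clear * - s hH' u4 v4 hX2 hxe; omega
                    rcases A with ⟨u5, v5⟩ | ⟨u5, v5⟩
                    · exact absurd (hηinj 3 (by omega) 5 (by omega) ((site_two_eq_iff _ _).2 ⟨u3.trans u5.symm, v3.trans v5.symm⟩)) (by omega)
                    · exact (hfresh (j + 3) (by omega) 5 (by omega) (by omega) ((site_two_eq_iff _ _).2 ⟨(x3.trans u5.symm), (y3.trans v5.symm)⟩)).elim
                  · have A : (η 5 0 = 5 * ω (j + 2) 0 - 4 * ω (j + 1) 0 ∧ η 5 1 = -1) ∨ (η 5 0 = 3 * ω (j + 2) 0 - 2 * ω (j + 1) 0 ∧ η 5 1 = -1) ∨ (η 5 0 = 4 * ω (j + 2) 0 - 3 * ω (j + 1) 0 ∧ η 5 1 = 0) := by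
                      have s := Arm.step_cases (show brickWallGraph.Adj (η 4) (η 5) from hadj 4 (by omega)); have hH' := hηY 5 (by norm_num) (by omega)
                      clear * - s hH' u4 v4 hX2 hxe; omega
                    rcases A with ⟨u5, v5⟩ | ⟨u5, v5⟩ | ⟨u5, v5⟩
                    · have A : (η 6 0 = 6 * ω (j + 2) 0 - 5 * ω (j + 1) 0 ∧ η 6 1 = -1) ∨ (η 6 0 = 4 * ω (j + 2) 0 - 3 * ω (j + 1) 0 ∧ η 6 1 = -1) ∨ (η 6 0 = 5 * ω (j + 2) 0 - 4 * ω (j + 1) 0 ∧ η 6 1 = -2) := by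
                        have s := Arm.step_cases (show brickWallGraph.Adj (η 5) (η 6) from hadj 5 (by omega)); have hH' := hηY 6 (by norm_num) (by omega)
                        clear * - s hH' u5 v5 hX2 hxe; omega
                      rcases A with ⟨u6, v6⟩ | ⟨u6, v6⟩ | ⟨u6, v6⟩
                      · have A : (η 7 0 = 7 * ω (j + 2) 0 - 6 * ω (j + 1) 0 ∧ η 7 1 = -1) ∨ (η 7 0 = 5 * ω (j + 2) 0 - 4 * ω (j + 1) 0 ∧ η 7 1 = -1) ∨ (η 7 0 = 6 * ω (j + 2) 0 - 5 * ω (j + 1) 0 ∧ η 7 1 = 0) := by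
                          have s := Arm.step_cases (show brickWallGraph.Adj (η 6) (η 7) from hadj 6 (by omega)); have hH' := hηY 7 (by norm_num) (by omega)
                          clear * - s hH' u6 v6 hX2 hxe; omega
                        rcases A with ⟨u7, v7⟩ | ⟨u7, v7⟩ | ⟨u7, v7⟩
                        · exact (hfresh (j + 11) (by omega) 7 (by omega) (by omega) ((site_two_eq_iff _ _).2 ⟨(x11.trans u7.symm), (y11.trans v7.symm)⟩)).elim
                        · exact absurd (hηinj 5 (by omega) 7 (by omega) ((site_two_eq_iff _ _).2 ⟨u5.trans u7.symm, v5.trans v7.symm⟩)) (by omega)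
                        · exact absurd (hηinj 1 (by omega) 7 (by omega) ((site_two_eq_iff _ _).2 ⟨u1.trans u7.symm, v1.trans v7.symm⟩)) (by omega)
                      · exact absurd (hηinj 4 (by omega) 6 (by omega) ((site_two_eq_iff _ _).2 ⟨u4.trans u6.symm, v4.trans v6.symm⟩)) (by omega)
                      · exact (hfresh (j + 8) (by omega) 6 (by omega) (by omega) ((site_two_eq_iff _ _).2 ⟨(x8.trans u6.symm), (y8.trans v6.symm)⟩)).elim
                    · exact (hfresh (j + 5) (by omega) 5 (by omega) (by omega) ((site_two_eq_iff _ _).2 ⟨(x5.trans u5.symm), (y5.trans v5.symm)⟩)).elim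
                    · exact absurd (hηinj 3 (by omega) 5 (by omega) ((site_two_eq_iff _ _).2 ⟨u3.trans u5.symm, v3.trans v5.symm⟩)) (by omega)
              · have A : (η 3 0 = 7 * ω (j + 2) 0 - 6 * ω (j + 1) 0 ∧ η 3 1 = -1) ∨ (η 3 0 = 5 * ω (j + 2) 0 - 4 * ω (j + 1) 0 ∧ η 3 1 = -1) ∨ (η 3 0 = 6 * ω (j + 2) 0 - 5 * ω (j + 1) 0 ∧ η 3 1 = 0) := by
                  have s := Arm.step_cases (show brickWallGraph.Adj (η 2) (η 3) from hadj 2 (by omega)); have hH' := hηY 3 (by norm_num) (by omega)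
                  clear * - s hH' u2 v2 hX2 hxe; omega
                rcases A with ⟨u3, v3⟩ | ⟨u3, v3⟩ | ⟨u3, v3⟩
                · exact (hfresh (j + 11) (by omega) 3 (by omega) (by omega) ((site_two_eq_iff _ _).2 ⟨(x11.trans u3.symm), (y11.trans v3.symm)⟩)).elim
                · have A : (η 4 0 = 6 * ω (j + 2) 0 - 5 * ω (j + 1) 0 ∧ η 4 1 = -1) ∨ (η 4 0 = 4 * ω (j + 2) 0 - 3 * ω (j + 1) 0 ∧ η 4 1 = -1) ∨ (η 4 0 = 5 * ω (j + 2) 0 - 4 * ω (j + 1) 0 ∧ η 4 1 = -2) := by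
                    have s := Arm.step_cases (show brickWallGraph.Adj (η 3) (η 4) from hadj 3 (by omega)); have hH' := hηY 4 (by norm_num) (by omega)
                    clear * - s hH' u3 v3 hX2 hxe; omega
                  rcases A with ⟨u4, v4⟩ | ⟨u4, v4⟩ | ⟨u4, v4⟩
                  · exact absurd (hηinj 2 (by omega) 4 (by omega) ((site_two_eq_iff _ _).2 ⟨u2.trans u4.symm, v2.trans v4.symm⟩)) (by omega)
                  · have A : (η 5 0 = 5 * ω (j + 2) 0 - 4 * ω (j + 1) 0 ∧ η 5 1 = -1) ∨ (η 5 0 = 3 * ω (j + 2) 0 - 2 * ω (j + 1) 0 ∧ η 5 1 = -1) ∨ (η 5 0 = 4 * ω (j + 2) 0 - 3 * ω (j + 1) 0 ∧ η 5 1 = 0) := by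
                      have s := Arm.step_cases (show brickWallGraph.Adj (η 4) (η 5) from hadj 4 (by omega)); have hH' := hηY 5 (by norm_num) (by omega)
                      clear * - s hH' u4 v4 hX2 hxe; omega
                    rcases A with ⟨u5, v5⟩ | ⟨u5, v5⟩ | ⟨u5, v5⟩
                    · exact absurd (hηinj 3 (by omega) 5 (by omega) ((site_two_eq_iff _ _).2 ⟨u3.trans u5.symm, v3.trans v5.symm⟩)) (by omega)
                    · exact (hfresh (j + 5) (by omega) 5 (by omega) (by omega) ((site_two_eq_iff _ _).2 ⟨(x5.trans u5.symm), (y5.trans v5.symm)⟩)).elim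
                    · have A : (η 6 0 = 5 * ω (j + 2) 0 - 4 * ω (j + 1) 0 ∧ η 6 1 = 0) ∨ (η 6 0 = 3 * ω (j + 2) 0 - 2 * ω (j + 1) 0 ∧ η 6 1 = 0) ∨ (η 6 0 = 4 * ω (j + 2) 0 - 3 * ω (j + 1) 0 ∧ η 6 1 = -1) := by
                        have s := Arm.step_cases (show brickWallGraph.Adj (η 5) (η 6) from hadj 5 (by omega)); have hH' := hηY 6 (by norm_num) (by omega)
                        clear * - s hH' u5 v5 hX2 hxe; omega
                      rcases A with ⟨u6, v6⟩ | ⟨u6, v6⟩ | ⟨u6, v6⟩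
                      · have A : (η 7 0 = 6 * ω (j + 2) 0 - 5 * ω (j + 1) 0 ∧ η 7 1 = 0) ∨ (η 7 0 = 4 * ω (j + 2) 0 - 3 * ω (j + 1) 0 ∧ η 7 1 = 0) := by
                          have s := Arm.step_cases (show brickWallGraph.Adj (η 6) (η 7) from hadj 6 (by omega)); have hH' := hηY 7 (by norm_num) (by omega)
                          clear * - s hH' u6 v6 hX2 hxe; omega
                        rcases A with ⟨u7, v7⟩ | ⟨u7, v7⟩
                        · exact absurd (hηinj 1 (by omega) 7 (by omega) ((site_two_eq_iff _ _).2 ⟨u1.trans u7.symm, v1.trans v7.symm⟩)) (by omega)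
                        · exact absurd (hηinj 5 (by omega) 7 (by omega) ((site_two_eq_iff _ _).2 ⟨u5.trans u7.symm, v5.trans v7.symm⟩)) (by omega)
                      · have A : (η 7 0 = 4 * ω (j + 2) 0 - 3 * ω (j + 1) 0 ∧ η 7 1 = 0) ∨ (η 7 0 = 2 * ω (j + 2) 0 - ω (j + 1) 0 ∧ η 7 1 = 0) := by
                          have s := Arm.step_cases (show brickWallGraph.Adj (η 6) (η 7) from hadj 6 (by omega)); have hH' := hηY 7 (by norm_num) (by omega)
                          clear * - s hH' u6 v6 hX2 hxe; omega
                        rcases A with ⟨u7, v7⟩ | ⟨u7, v7⟩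
                        · exact absurd (hηinj 5 (by omega) 7 (by omega) ((site_two_eq_iff _ _).2 ⟨u5.trans u7.symm, v5.trans v7.symm⟩)) (by omega)
                        · exact (hfresh (j + 3) (by omega) 7 (by omega) (by omega) ((site_two_eq_iff _ _).2 ⟨(x3.trans u7.symm), (y3.trans v7.symm)⟩)).elim
                      · exact absurd (hηinj 4 (by omega) 6 (by omega) ((site_two_eq_iff _ _).2 ⟨u4.trans u6.symm, v4.trans v6.symm⟩)) (by omega)
                  · exact (hfresh (j + 8) (by omega) 4 (by omega) (by omega) ((site_two_eq_iff _ _).2 ⟨(x8.trans u4.symm), (y8.trans v4.symm)⟩)).elim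
                · exact absurd (hηinj 1 (by omega) 3 (by omega) ((site_two_eq_iff _ _).2 ⟨u1.trans u3.symm, v1.trans v3.symm⟩)) (by omega)
      · have A : (ω (j + 13) 0 = 7 * ω (j + 2) 0 - 6 * ω (j + 1) 0 ∧ ω (j + 13) 1 = -1) ∨ (ω (j + 13) 0 = 5 * ω (j + 2) 0 - 4 * ω (j + 1) 0 ∧ ω (j + 13) 1 = -1) ∨ (ω (j + 13) 0 = 6 * ω (j + 2) 0 - 5 * ω (j + 1) 0 ∧ ω (j + 13) 1 = 0) := by
          have s := hpw_step hωh (a := j + 12) (b := j + 13) (by omega) (by omega); clear * - s x12 y12 hX2 hxe; omega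
        rcases A with ⟨x13, y13⟩ | ⟨x13, y13⟩ | ⟨x13, y13⟩
        · exact (clash hωh (x13.trans x11.symm) (y13.trans y11.symm) (by omega) (by omega) (by omega)).elim
        · have hcl := climb_le_odd (hpw_subset hωh) (t := j + 13) (s := 1) (by omega) (by omega)
          rw [show j + 13 + 1 = j + 14 by omega] at hcl; clear * - hcl hend y13; exfalso; omega
        · have A : (ω (j + 14) 0 = 7 * ω (j + 2) 0 - 6 * ω (j + 1) 0 ∧ ω (j + 14) 1 = 0) ∨ (ω (j + 14) 0 = 5 * ω (j + 2) 0 - 4 * ω (j + 1) 0 ∧ ω (j + 14) 1 = 0) := by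
            have s := hpw_step hωh (a := j + 13) (b := j + 14) (by omega) (by omega); clear * - s x13 y13 hX2 hxe hend; omega
          rcases A with ⟨x14, y14⟩ | ⟨x14, y14⟩
          · refine ⟨⟨4, by norm_num⟩, ?_⟩; rw [show Twelve.TX ⟨4, by norm_num⟩ = Twelve.x4 from rfl, show Twelve.TY ⟨4, by norm_num⟩ = Twelve.y4 from rfl]
            intro i hi; interval_cases i <;> simp only [Nat.add_assoc, Nat.reduceAdd, Nat.add_zero, Twelve.x4, Twelve.y4] <;> omega
          · have u0 : η 0 0 = 5 * ω (j + 2) 0 - 4 * ω (j + 1) 0 := by rw [hη0, x14]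
            have v0 : η 0 1 = 0 := by rw [hη0, y14]
            have A : (η 1 0 = 6 * ω (j + 2) 0 - 5 * ω (j + 1) 0 ∧ η 1 1 = 0) ∨ (η 1 0 = 4 * ω (j + 2) 0 - 3 * ω (j + 1) 0 ∧ η 1 1 = 0) := by
              have s := Arm.step_cases (show brickWallGraph.Adj (η 0) (η 1) from hadj 0 (by omega)); have hH' := hηY 1 (by norm_num) (by omega)
              clear * - s hH' u0 v0 hX2 hxe; omega
            rcases A with ⟨u1, v1⟩ | ⟨u1, v1⟩
            · exact (hfresh (j + 13) (by omega) 1 (by omega) (by omega) ((site_two_eq_iff _ _).2 ⟨(x13.trans u1.symm), (y13.trans v1.symm)⟩)).elim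
            · have A : (η 2 0 = 5 * ω (j + 2) 0 - 4 * ω (j + 1) 0 ∧ η 2 1 = 0) ∨ (η 2 0 = 3 * ω (j + 2) 0 - 2 * ω (j + 1) 0 ∧ η 2 1 = 0) ∨ (η 2 0 = 4 * ω (j + 2) 0 - 3 * ω (j + 1) 0 ∧ η 2 1 = -1) := by
                have s := Arm.step_cases (show brickWallGraph.Adj (η 1) (η 2) from hadj 1 (by omega)); have hH' := hηY 2 (by norm_num) (by omega)
                clear * - s hH' u1 v1 hX2 hxe; omega
              rcases A with ⟨u2, v2⟩ | ⟨u2, v2⟩ | ⟨u2, v2⟩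
              · exact (hfresh (j + 14) (by omega) 2 (by omega) (by omega) ((site_two_eq_iff _ _).2 ⟨(x14.trans u2.symm), (y14.trans v2.symm)⟩)).elim
              · have A : (η 3 0 = 4 * ω (j + 2) 0 - 3 * ω (j + 1) 0 ∧ η 3 1 = 0) ∨ (η 3 0 = 2 * ω (j + 2) 0 - ω (j + 1) 0 ∧ η 3 1 = 0) := by
                  have s := Arm.step_cases (show brickWallGraph.Adj (η 2) (η 3) from hadj 2 (by omega)); have hH' := hηY 3 (by norm_num) (by omega)
                  clear * - s hH' u2 v2 hX2 hxe; omega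
                rcases A with ⟨u3, v3⟩ | ⟨u3, v3⟩
                · exact absurd (hηinj 1 (by omega) 3 (by omega) ((site_two_eq_iff _ _).2 ⟨u1.trans u3.symm, v1.trans v3.symm⟩)) (by omega)
                · exact (hfresh (j + 3) (by omega) 3 (by omega) (by omega) ((site_two_eq_iff _ _).2 ⟨(x3.trans u3.symm), (y3.trans v3.symm)⟩)).elim
              · have A : (η 3 0 = 5 * ω (j + 2) 0 - 4 * ω (j + 1) 0 ∧ η 3 1 = -1) ∨ (η 3 0 = 3 * ω (j + 2) 0 - 2 * ω (j + 1) 0 ∧ η 3 1 = -1) ∨ (η 3 0 = 4 * ω (j + 2) 0 - 3 * ω (j + 1) 0 ∧ η 3 1 = 0) := by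
                  have s := Arm.step_cases (show brickWallGraph.Adj (η 2) (η 3) from hadj 2 (by omega)); have hH' := hηY 3 (by norm_num) (by omega)
                  clear * - s hH' u2 v2 hX2 hxe; omega
                rcases A with ⟨u3, v3⟩ | ⟨u3, v3⟩ | ⟨u3, v3⟩
                · have A : (η 4 0 = 6 * ω (j + 2) 0 - 5 * ω (j + 1) 0 ∧ η 4 1 = -1) ∨ (η 4 0 = 4 * ω (j + 2) 0 - 3 * ω (j + 1) 0 ∧ η 4 1 = -1) ∨ (η 4 0 = 5 * ω (j + 2) 0 - 4 * ω (j + 1) 0 ∧ η 4 1 = -2) := by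
                    have s := Arm.step_cases (show brickWallGraph.Adj (η 3) (η 4) from hadj 3 (by omega)); have hH' := hηY 4 (by norm_num) (by omega)
                    clear * - s hH' u3 v3 hX2 hxe; omega
                  rcases A with ⟨u4, v4⟩ | ⟨u4, v4⟩ | ⟨u4, v4⟩
                  · exact (hfresh (j + 12) (by omega) 4 (by omega) (by omega) ((site_two_eq_iff _ _).2 ⟨(x12.trans u4.symm), (y12.trans v4.symm)⟩)).elim
                  · exact absurd (hηinj 2 (by omega) 4 (by omega) ((site_two_eq_iff _ _).2 ⟨u2.trans u4.symm, v2.trans v4.symm⟩)) (by omega)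
                  · exact (hfresh (j + 8) (by omega) 4 (by omega) (by omega) ((site_two_eq_iff _ _).2 ⟨(x8.trans u4.symm), (y8.trans v4.symm)⟩)).elim
                · exact (hfresh (j + 5) (by omega) 3 (by omega) (by omega) ((site_two_eq_iff _ _).2 ⟨(x5.trans u3.symm), (y5.trans v3.symm)⟩)).elim
                · exact absurd (hηinj 1 (by omega) 3 (by omega) ((site_two_eq_iff _ _).2 ⟨u1.trans u3.symm, v1.trans v3.symm⟩)) (by omega)
      · exact (clash hωh (x12.trans x10.symm) (y12.trans y10.symm) (by omega) (by omega) (by omega)).elim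
  · exact (clash hωh (x10.trans x8.symm) (y10.trans y8.symm) (by omega) (by omega) (by omega)).elim
  · have hcl := climb_le_even (hpw_subset hωh) (t := j + 10) (s := 4) (by omega) (by omega)
    rw [show j + 10 + 4 = j + 14 by omega] at hcl; clear * - hcl hend y10; exfalso; omega

set_option maxHeartbeats 400000 in
/-- Case analysis of the twelve-fibre under seven-step extendability (generated; 37 steps): branch excursion prefix ⟨(1, 0), (1, -1), (2, -1), (2, -2)⟩. [cite: EntingJensen2009, §7.4.2, Fig. 7.10 (brickwork form of the honeycomb lattice); HammersleyTorrieWhittington1982, §2] -/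
theorem twelve_c3 {j : ℕ} (hj : 5 ≤ j) (hωh : ω ∈ hpw (j + 14)) (hend : ω (j + 14) 1 = 0) (hkY : ω (j + 2) 1 = 0)
    (hno : ∀ i, j + 2 < i → i ≤ j + 12 → ¬ (i % 2 = 0 ∧ ω i 1 = 0)) (hE : ExtK k (j + 14) ω) (hk : 7 ≤ k)
    (hX2 : ω (j + 2) 0 = ω (j + 1) 0 + 1 ∨ ω (j + 1) 0 = ω (j + 2) 0 + 1) (hY1 : ω (j + 1) 1 = 0) (hxe : ω (j + 2) 0 % 2 = 0) (hj2 : j % 2 = 0)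
    (h3 : ω (j + 3) 0 = 2 * ω (j + 2) 0 - ω (j + 1) 0 ∧ ω (j + 3) 1 = 0) (h4 : ω (j + 4) 0 = 2 * ω (j + 2) 0 - ω (j + 1) 0 ∧ ω (j + 4) 1 = -1)
    (h5 : ω (j + 5) 0 = 3 * ω (j + 2) 0 - 2 * ω (j + 1) 0 ∧ ω (j + 5) 1 = -1)
    (h6 : ω (j + 6) 0 = 3 * ω (j + 2) 0 - 2 * ω (j + 1) 0 ∧ ω (j + 6) 1 = -2)
    : ∃ s : Fin 9, ∀ i ≤ 12, ω (j + 2 + i) 0 = ω (j + 2) 0 + Twelve.TX s i * (ω (j + 2) 0 - ω (j + 1) 0) ∧ ω (j + 2 + i) 1 = Twelve.TY s i := by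
  obtain ⟨x3, y3⟩ := h3; obtain ⟨x4, y4⟩ := h4; obtain ⟨x5, y5⟩ := h5; obtain ⟨x6, y6⟩ := h6
  have hE' := hE; obtain ⟨η, hη0, hadj, hηY, hηinj, hfresh⟩ := hE'
  have A : (ω (j + 7) 0 = 4 * ω (j + 2) 0 - 3 * ω (j + 1) 0 ∧ ω (j + 7) 1 = -2) ∨ (ω (j + 7) 0 = 2 * ω (j + 2) 0 - ω (j + 1) 0 ∧ ω (j + 7) 1 = -2) ∨ (ω (j + 7) 0 = 3 * ω (j + 2) 0 - 2 * ω (j + 1) 0 ∧ ω (j + 7) 1 = -1) := by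
    have s := hpw_step hωh (a := j + 6) (b := j + 7) (by omega) (by omega); clear * - s x6 y6 hX2 hxe; omega
  rcases A with ⟨x7, y7⟩ | ⟨x7, y7⟩ | ⟨x7, y7⟩
  · have A : (ω (j + 8) 0 = 5 * ω (j + 2) 0 - 4 * ω (j + 1) 0 ∧ ω (j + 8) 1 = -2) ∨ (ω (j + 8) 0 = 3 * ω (j + 2) 0 - 2 * ω (j + 1) 0 ∧ ω (j + 8) 1 = -2) ∨ (ω (j + 8) 0 = 4 * ω (j + 2) 0 - 3 * ω (j + 1) 0 ∧ ω (j + 8) 1 = -3) := by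
      have s := hpw_step hωh (a := j + 7) (b := j + 8) (by omega) (by omega); clear * - s x7 y7 hX2 hxe; omega
    rcases A with ⟨x8, y8⟩ | ⟨x8, y8⟩ | ⟨x8, y8⟩
    · have A : (ω (j + 9) 0 = 6 * ω (j + 2) 0 - 5 * ω (j + 1) 0 ∧ ω (j + 9) 1 = -2) ∨ (ω (j + 9) 0 = 4 * ω (j + 2) 0 - 3 * ω (j + 1) 0 ∧ ω (j + 9) 1 = -2) ∨ (ω (j + 9) 0 = 5 * ω (j + 2) 0 - 4 * ω (j + 1) 0 ∧ ω (j + 9) 1 = -1) := by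
        have s := hpw_step hωh (a := j + 8) (b := j + 9) (by omega) (by omega); clear * - s x8 y8 hX2 hxe; omega
      rcases A with ⟨x9, y9⟩ | ⟨x9, y9⟩ | ⟨x9, y9⟩
      · exact twelve_c2 hωh hend hkY hE hk hX2 hxe hj2 ⟨x3, y3⟩ ⟨x4, y4⟩ ⟨x5, y5⟩ ⟨x6, y6⟩ ⟨x7, y7⟩ ⟨x8, y8⟩ ⟨x9, y9⟩
      · exact (clash hωh (x9.trans x7.symm) (y9.trans y7.symm) (by omega) (by omega) (by omega)).elim
      · have A : (ω (j + 10) 0 = 6 * ω (j + 2) 0 - 5 * ω (j + 1) 0 ∧ ω (j + 10) 1 = -1) ∨ (ω (j + 10) 0 = 4 * ω (j + 2) 0 - 3 * ω (j + 1) 0 ∧ ω (j + 10) 1 = -1) ∨ (ω (j + 10) 0 = 5 * ω (j + 2) 0 - 4 * ω (j + 1) 0 ∧ ω (j + 10) 1 = -2) := by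
          have s := hpw_step hωh (a := j + 9) (b := j + 10) (by omega) (by omega); clear * - s x9 y9 hX2 hxe; omega
        rcases A with ⟨x10, y10⟩ | ⟨x10, y10⟩ | ⟨x10, y10⟩
        · have A : (ω (j + 11) 0 = 7 * ω (j + 2) 0 - 6 * ω (j + 1) 0 ∧ ω (j + 11) 1 = -1) ∨ (ω (j + 11) 0 = 5 * ω (j + 2) 0 - 4 * ω (j + 1) 0 ∧ ω (j + 11) 1 = -1) ∨ (ω (j + 11) 0 = 6 * ω (j + 2) 0 - 5 * ω (j + 1) 0 ∧ ω (j + 11) 1 = 0) := by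
            have s := hpw_step hωh (a := j + 10) (b := j + 11) (by omega) (by omega); clear * - s x10 y10 hX2 hxe; omega
          rcases A with ⟨x11, y11⟩ | ⟨x11, y11⟩ | ⟨x11, y11⟩
          · have A : (ω (j + 12) 0 = 8 * ω (j + 2) 0 - 7 * ω (j + 1) 0 ∧ ω (j + 12) 1 = -1) ∨ (ω (j + 12) 0 = 6 * ω (j + 2) 0 - 5 * ω (j + 1) 0 ∧ ω (j + 12) 1 = -1) ∨ (ω (j + 12) 0 = 7 * ω (j + 2) 0 - 6 * ω (j + 1) 0 ∧ ω (j + 12) 1 = -2) := by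
              have s := hpw_step hωh (a := j + 11) (b := j + 12) (by omega) (by omega); clear * - s x11 y11 hX2 hxe; omega
            rcases A with ⟨x12, y12⟩ | ⟨x12, y12⟩ | ⟨x12, y12⟩
            · have A : (ω (j + 13) 0 = 9 * ω (j + 2) 0 - 8 * ω (j + 1) 0 ∧ ω (j + 13) 1 = -1) ∨ (ω (j + 13) 0 = 7 * ω (j + 2) 0 - 6 * ω (j + 1) 0 ∧ ω (j + 13) 1 = -1) ∨ (ω (j + 13) 0 = 8 * ω (j + 2) 0 - 7 * ω (j + 1) 0 ∧ ω (j + 13) 1 = 0) := by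
                have s := hpw_step hωh (a := j + 12) (b := j + 13) (by omega) (by omega); clear * - s x12 y12 hX2 hxe; omega
              rcases A with ⟨x13, y13⟩ | ⟨x13, y13⟩ | ⟨x13, y13⟩
              · have hcl := climb_le_odd (hpw_subset hωh) (t := j + 13) (s := 1) (by omega) (by omega)
                rw [show j + 13 + 1 = j + 14 by omega] at hcl; clear * - hcl hend y13; exfalso; omega
              · exact (clash hωh (x13.trans x11.symm) (y13.trans y11.symm) (by omega) (by omega) (by omega)).elim
              · have A : (ω (j + 14) 0 = 9 * ω (j + 2) 0 - 8 * ω (j + 1) 0 ∧ ω (j + 14) 1 = 0) ∨ (ω (j + 14) 0 = 7 * ω (j + 2) 0 - 6 * ω (j + 1) 0 ∧ ω (j + 14) 1 = 0) := by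
                  have s := hpw_step hωh (a := j + 13) (b := j + 14) (by omega) (by omega); clear * - s x13 y13 hX2 hxe hend; omega
                rcases A with ⟨x14, y14⟩ | ⟨x14, y14⟩
                · refine ⟨⟨5, by norm_num⟩, ?_⟩; rw [show Twelve.TX ⟨5, by norm_num⟩ = Twelve.x5 from rfl, show Twelve.TY ⟨5, by norm_num⟩ = Twelve.y5 from rfl]
                  intro i hi; interval_cases i <;> simp only [Nat.add_assoc, Nat.reduceAdd, Nat.add_zero, Twelve.x5, Twelve.y5] <;> omega
                · have u0 : η 0 0 = 7 * ω (j + 2) 0 - 6 * ω (j + 1) 0 := by rw [hη0, x14]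
                  have v0 : η 0 1 = 0 := by rw [hη0, y14]
                  have A : (η 1 0 = 8 * ω (j + 2) 0 - 7 * ω (j + 1) 0 ∧ η 1 1 = 0) ∨ (η 1 0 = 6 * ω (j + 2) 0 - 5 * ω (j + 1) 0 ∧ η 1 1 = 0) := by
                    have s := Arm.step_cases (show brickWallGraph.Adj (η 0) (η 1) from hadj 0 (by omega)); have hH' := hηY 1 (by norm_num) (by omega)
                    clear * - s hH' u0 v0 hX2 hxe; omega
                  rcases A with ⟨u1, v1⟩ | ⟨u1, v1⟩
                  · exact (hfresh (j + 13) (by omega) 1 (by omega) (by omega) ((site_two_eq_iff _ _).2 ⟨(x13.trans u1.symm), (y13.trans v1.symm)⟩)).elim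
                  · have A : (η 2 0 = 7 * ω (j + 2) 0 - 6 * ω (j + 1) 0 ∧ η 2 1 = 0) ∨ (η 2 0 = 5 * ω (j + 2) 0 - 4 * ω (j + 1) 0 ∧ η 2 1 = 0) ∨ (η 2 0 = 6 * ω (j + 2) 0 - 5 * ω (j + 1) 0 ∧ η 2 1 = -1) := by
                      have s := Arm.step_cases (show brickWallGraph.Adj (η 1) (η 2) from hadj 1 (by omega)); have hH' := hηY 2 (by norm_num) (by omega)
                      clear * - s hH' u1 v1 hX2 hxe; omega
                    rcases A with ⟨u2, v2⟩ | ⟨u2, v2⟩ | ⟨u2, v2⟩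
                    · exact (hfresh (j + 14) (by omega) 2 (by omega) (by omega) ((site_two_eq_iff _ _).2 ⟨(x14.trans u2.symm), (y14.trans v2.symm)⟩)).elim
                    · have A : (η 3 0 = 6 * ω (j + 2) 0 - 5 * ω (j + 1) 0 ∧ η 3 1 = 0) ∨ (η 3 0 = 4 * ω (j + 2) 0 - 3 * ω (j + 1) 0 ∧ η 3 1 = 0) := by
                        have s := Arm.step_cases (show brickWallGraph.Adj (η 2) (η 3) from hadj 2 (by omega)); have hH' := hηY 3 (by norm_num) (by omega)
                        clear * - s hH' u2 v2 hX2 hxe; omega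
                      rcases A with ⟨u3, v3⟩ | ⟨u3, v3⟩
                      · exact absurd (hηinj 1 (by omega) 3 (by omega) ((site_two_eq_iff _ _).2 ⟨u1.trans u3.symm, v1.trans v3.symm⟩)) (by omega)
                      · have A : (η 4 0 = 5 * ω (j + 2) 0 - 4 * ω (j + 1) 0 ∧ η 4 1 = 0) ∨ (η 4 0 = 3 * ω (j + 2) 0 - 2 * ω (j + 1) 0 ∧ η 4 1 = 0) ∨ (η 4 0 = 4 * ω (j + 2) 0 - 3 * ω (j + 1) 0 ∧ η 4 1 = -1) := by
                          have s := Arm.step_cases (show brickWallGraph.Adj (η 3) (η 4) from hadj 3 (by omega)); have hH' := hηY 4 (by norm_num) (by omega)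
                          clear * - s hH' u3 v3 hX2 hxe; omega
                        rcases A with ⟨u4, v4⟩ | ⟨u4, v4⟩ | ⟨u4, v4⟩
                        · exact absurd (hηinj 2 (by omega) 4 (by omega) ((site_two_eq_iff _ _).2 ⟨u2.trans u4.symm, v2.trans v4.symm⟩)) (by omega)
                        · have A : (η 5 0 = 4 * ω (j + 2) 0 - 3 * ω (j + 1) 0 ∧ η 5 1 = 0) ∨ (η 5 0 = 2 * ω (j + 2) 0 - ω (j + 1) 0 ∧ η 5 1 = 0) := by
                            have s := Arm.step_cases (show brickWallGraph.Adj (η 4) (η 5) from hadj 4 (by omega)); have hH' := hηY 5 (by norm_num) (by omega)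
                            clear * - s hH' u4 v4 hX2 hxe; omega
                          rcases A with ⟨u5, v5⟩ | ⟨u5, v5⟩
                          · exact absurd (hηinj 3 (by omega) 5 (by omega) ((site_two_eq_iff _ _).2 ⟨u3.trans u5.symm, v3.trans v5.symm⟩)) (by omega)
                          · exact (hfresh (j + 3) (by omega) 5 (by omega) (by omega) ((site_two_eq_iff _ _).2 ⟨(x3.trans u5.symm), (y3.trans v5.symm)⟩)).elim
                        · have A : (η 5 0 = 5 * ω (j + 2) 0 - 4 * ω (j + 1) 0 ∧ η 5 1 = -1) ∨ (η 5 0 = 3 * ω (j + 2) 0 - 2 * ω (j + 1) 0 ∧ η 5 1 = -1) ∨ (η 5 0 = 4 * ω (j + 2) 0 - 3 * ω (j + 1) 0 ∧ η 5 1 = 0) := by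
                            have s := Arm.step_cases (show brickWallGraph.Adj (η 4) (η 5) from hadj 4 (by omega)); have hH' := hηY 5 (by norm_num) (by omega)
                            clear * - s hH' u4 v4 hX2 hxe; omega
                          rcases A with ⟨u5, v5⟩ | ⟨u5, v5⟩ | ⟨u5, v5⟩
                          · exact (hfresh (j + 9) (by omega) 5 (by omega) (by omega) ((site_two_eq_iff _ _).2 ⟨(x9.trans u5.symm), (y9.trans v5.symm)⟩)).elim
                          · exact (hfresh (j + 5) (by omega) 5 (by omega) (by omega) ((site_two_eq_iff _ _).2 ⟨(x5.trans u5.symm), (y5.trans v5.symm)⟩)).elim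
                          · exact absurd (hηinj 3 (by omega) 5 (by omega) ((site_two_eq_iff _ _).2 ⟨u3.trans u5.symm, v3.trans v5.symm⟩)) (by omega)
                    · exact (hfresh (j + 10) (by omega) 2 (by omega) (by omega) ((site_two_eq_iff _ _).2 ⟨(x10.trans u2.symm), (y10.trans v2.symm)⟩)).elim
            · exact (clash hωh (x12.trans x10.symm) (y12.trans y10.symm) (by omega) (by omega) (by omega)).elim
            · have hcl := climb_le_even (hpw_subset hωh) (t := j + 12) (s := 2) (by omega) (by omega)
              rw [show j + 12 + 2 = j + 14 by omega] at hcl; clear * - hcl hend y12; exfalso; omega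
          · exact (clash hωh (x11.trans x9.symm) (y11.trans y9.symm) (by omega) (by omega) (by omega)).elim
          · have A : (ω (j + 12) 0 = 7 * ω (j + 2) 0 - 6 * ω (j + 1) 0 ∧ ω (j + 12) 1 = 0) ∨ (ω (j + 12) 0 = 5 * ω (j + 2) 0 - 4 * ω (j + 1) 0 ∧ ω (j + 12) 1 = 0) ∨ (ω (j + 12) 0 = 6 * ω (j + 2) 0 - 5 * ω (j + 1) 0 ∧ ω (j + 12) 1 = -1) := by
              have s := hpw_step hωh (a := j + 11) (b := j + 12) (by omega) (by omega); clear * - s x11 y11 hX2 hxe; omega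
            rcases A with ⟨x12, y12⟩ | ⟨x12, y12⟩ | ⟨x12, y12⟩
            · exact (hno (j + 12) (by omega) (by omega) ⟨by omega, y12⟩).elim
            · exact (hno (j + 12) (by omega) (by omega) ⟨by omega, y12⟩).elim
            · exact (clash hωh (x12.trans x10.symm) (y12.trans y10.symm) (by omega) (by omega) (by omega)).elim
        · have A : (ω (j + 11) 0 = 5 * ω (j + 2) 0 - 4 * ω (j + 1) 0 ∧ ω (j + 11) 1 = -1) ∨ (ω (j + 11) 0 = 3 * ω (j + 2) 0 - 2 * ω (j + 1) 0 ∧ ω (j + 11) 1 = -1) ∨ (ω (j + 11) 0 = 4 * ω (j + 2) 0 - 3 * ω (j + 1) 0 ∧ ω (j + 11) 1 = 0) := by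
            have s := hpw_step hωh (a := j + 10) (b := j + 11) (by omega) (by omega); clear * - s x10 y10 hX2 hxe; omega
          rcases A with ⟨x11, y11⟩ | ⟨x11, y11⟩ | ⟨x11, y11⟩
          · exact (clash hωh (x11.trans x9.symm) (y11.trans y9.symm) (by omega) (by omega) (by omega)).elim
          · exact (clash hωh (x11.trans x5.symm) (y11.trans y5.symm) (by omega) (by omega) (by omega)).elim
          · have A : (ω (j + 12) 0 = 5 * ω (j + 2) 0 - 4 * ω (j + 1) 0 ∧ ω (j + 12) 1 = 0) ∨ (ω (j + 12) 0 = 3 * ω (j + 2) 0 - 2 * ω (j + 1) 0 ∧ ω (j + 12) 1 = 0) ∨ (ω (j + 12) 0 = 4 * ω (j + 2) 0 - 3 * ω (j + 1) 0 ∧ ω (j + 12) 1 = -1) := by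
              have s := hpw_step hωh (a := j + 11) (b := j + 12) (by omega) (by omega); clear * - s x11 y11 hX2 hxe; omega
            rcases A with ⟨x12, y12⟩ | ⟨x12, y12⟩ | ⟨x12, y12⟩
            · exact (hno (j + 12) (by omega) (by omega) ⟨by omega, y12⟩).elim
            · exact (hno (j + 12) (by omega) (by omega) ⟨by omega, y12⟩).elim
            · exact (clash hωh (x12.trans x10.symm) (y12.trans y10.symm) (by omega) (by omega) (by omega)).elim
        · exact (clash hωh (x10.trans x8.symm) (y10.trans y8.symm) (by omega) (by omega) (by omega)).elim
    · exact (clash hωh (x8.trans x6.symm) (y8.trans y6.symm) (by omega) (by omega) (by omega)).elim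
    · have A : (ω (j + 9) 0 = 5 * ω (j + 2) 0 - 4 * ω (j + 1) 0 ∧ ω (j + 9) 1 = -3) ∨ (ω (j + 9) 0 = 3 * ω (j + 2) 0 - 2 * ω (j + 1) 0 ∧ ω (j + 9) 1 = -3) ∨ (ω (j + 9) 0 = 4 * ω (j + 2) 0 - 3 * ω (j + 1) 0 ∧ ω (j + 9) 1 = -2) := by
        have s := hpw_step hωh (a := j + 8) (b := j + 9) (by omega) (by omega); clear * - s x8 y8 hX2 hxe; omega
      rcases A with ⟨x9, y9⟩ | ⟨x9, y9⟩ | ⟨x9, y9⟩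
      · have hcl := climb_le_odd (hpw_subset hωh) (t := j + 9) (s := 5) (by omega) (by omega)
        rw [show j + 9 + 5 = j + 14 by omega] at hcl; clear * - hcl hend y9; exfalso; omega
      · have hcl := climb_le_odd (hpw_subset hωh) (t := j + 9) (s := 5) (by omega) (by omega)
        rw [show j + 9 + 5 = j + 14 by omega] at hcl; clear * - hcl hend y9; exfalso; omega
      · exact (clash hωh (x9.trans x7.symm) (y9.trans y7.symm) (by omega) (by omega) (by omega)).elim
  · have A : (ω (j + 8) 0 = 3 * ω (j + 2) 0 - 2 * ω (j + 1) 0 ∧ ω (j + 8) 1 = -2) ∨ (ω (j + 8) 0 = ω (j + 2) 0 ∧ ω (j + 8) 1 = -2) ∨ (ω (j + 8) 0 = 2 * ω (j + 2) 0 - ω (j + 1) 0 ∧ ω (j + 8) 1 = -3) := by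
      have s := hpw_step hωh (a := j + 7) (b := j + 8) (by omega) (by omega); clear * - s x7 y7 hX2 hxe; omega
    rcases A with ⟨x8, y8⟩ | ⟨x8, y8⟩ | ⟨x8, y8⟩
    · exact (clash hωh (x8.trans x6.symm) (y8.trans y6.symm) (by omega) (by omega) (by omega)).elim
    · have A : (ω (j + 9) 0 = 2 * ω (j + 2) 0 - ω (j + 1) 0 ∧ ω (j + 9) 1 = -2) ∨ (ω (j + 9) 0 = ω (j + 1) 0 ∧ ω (j + 9) 1 = -2) ∨ (ω (j + 9) 0 = ω (j + 2) 0 ∧ ω (j + 9) 1 = -1) := by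
        have s := hpw_step hωh (a := j + 8) (b := j + 9) (by omega) (by omega); clear * - s x8 y8 hX2 hxe; omega
      rcases A with ⟨x9, y9⟩ | ⟨x9, y9⟩ | ⟨x9, y9⟩
      · exact (clash hωh (x9.trans x7.symm) (y9.trans y7.symm) (by omega) (by omega) (by omega)).elim
      · have A : (ω (j + 10) 0 = ω (j + 2) 0 ∧ ω (j + 10) 1 = -2) ∨ (ω (j + 10) 0 = 2 * ω (j + 1) 0 - ω (j + 2) 0 ∧ ω (j + 10) 1 = -2) ∨ (ω (j + 10) 0 = ω (j + 1) 0 ∧ ω (j + 10) 1 = -3) := by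
          have s := hpw_step hωh (a := j + 9) (b := j + 10) (by omega) (by omega); clear * - s x9 y9 hX2 hxe; omega
        rcases A with ⟨x10, y10⟩ | ⟨x10, y10⟩ | ⟨x10, y10⟩
        · exact (clash hωh (x10.trans x8.symm) (y10.trans y8.symm) (by omega) (by omega) (by omega)).elim
        · have A : (ω (j + 11) 0 = ω (j + 1) 0 ∧ ω (j + 11) 1 = -2) ∨ (ω (j + 11) 0 = 3 * ω (j + 1) 0 - 2 * ω (j + 2) 0 ∧ ω (j + 11) 1 = -2) ∨ (ω (j + 11) 0 = 2 * ω (j + 1) 0 - ω (j + 2) 0 ∧ ω (j + 11) 1 = -1) := by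
            have s := hpw_step hωh (a := j + 10) (b := j + 11) (by omega) (by omega); clear * - s x10 y10 hX2 hxe; omega
          rcases A with ⟨x11, y11⟩ | ⟨x11, y11⟩ | ⟨x11, y11⟩
          · exact (clash hωh (x11.trans x9.symm) (y11.trans y9.symm) (by omega) (by omega) (by omega)).elim
          · have hcl := climb_le_odd (hpw_subset hωh) (t := j + 11) (s := 3) (by omega) (by omega)
            rw [show j + 11 + 3 = j + 14 by omega] at hcl; clear * - hcl hend y11; exfalso; omega
          · have A : (ω (j + 12) 0 = ω (j + 1) 0 ∧ ω (j + 12) 1 = -1) ∨ (ω (j + 12) 0 = 3 * ω (j + 1) 0 - 2 * ω (j + 2) 0 ∧ ω (j + 12) 1 = -1) ∨ (ω (j + 12) 0 = 2 * ω (j + 1) 0 - ω (j + 2) 0 ∧ ω (j + 12) 1 = -2) := by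
              have s := hpw_step hωh (a := j + 11) (b := j + 12) (by omega) (by omega); clear * - s x11 y11 hX2 hxe; omega
            rcases A with ⟨x12, y12⟩ | ⟨x12, y12⟩ | ⟨x12, y12⟩
            · have A : (ω (j + 13) 0 = ω (j + 2) 0 ∧ ω (j + 13) 1 = -1) ∨ (ω (j + 13) 0 = 2 * ω (j + 1) 0 - ω (j + 2) 0 ∧ ω (j + 13) 1 = -1) ∨ (ω (j + 13) 0 = ω (j + 1) 0 ∧ ω (j + 13) 1 = 0) := by
                have s := hpw_step hωh (a := j + 12) (b := j + 13) (by omega) (by omega); clear * - s x12 y12 hX2 hxe; omega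
              rcases A with ⟨x13, y13⟩ | ⟨x13, y13⟩ | ⟨x13, y13⟩
              · have hcl := climb_le_odd (hpw_subset hωh) (t := j + 13) (s := 1) (by omega) (by omega)
                rw [show j + 13 + 1 = j + 14 by omega] at hcl; clear * - hcl hend y13; exfalso; omega
              · exact (clash hωh (x13.trans x11.symm) (y13.trans y11.symm) (by omega) (by omega) (by omega)).elim
              · exact (clash hωh x13 (y13.trans hY1.symm) (by omega) (by omega) (by omega)).elim
            · have A : (ω (j + 13) 0 = 2 * ω (j + 1) 0 - ω (j + 2) 0 ∧ ω (j + 13) 1 = -1) ∨ (ω (j + 13) 0 = 4 * ω (j + 1) 0 - 3 * ω (j + 2) 0 ∧ ω (j + 13) 1 = -1) ∨ (ω (j + 13) 0 = 3 * ω (j + 1) 0 - 2 * ω (j + 2) 0 ∧ ω (j + 13) 1 = 0) := by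
                have s := hpw_step hωh (a := j + 12) (b := j + 13) (by omega) (by omega); clear * - s x12 y12 hX2 hxe; omega
              rcases A with ⟨x13, y13⟩ | ⟨x13, y13⟩ | ⟨x13, y13⟩
              · exact (clash hωh (x13.trans x11.symm) (y13.trans y11.symm) (by omega) (by omega) (by omega)).elim
              · have hcl := climb_le_odd (hpw_subset hωh) (t := j + 13) (s := 1) (by omega) (by omega)
                rw [show j + 13 + 1 = j + 14 by omega] at hcl; clear * - hcl hend y13; exfalso; omega
              · have A : (ω j 0 = ω (j + 2) 0 ∧ ω j 1 = 0) ∨ (ω j 0 = 2 * ω (j + 1) 0 - ω (j + 2) 0 ∧ ω j 1 = 0) ∨ (ω j 0 = ω (j + 1) 0 ∧ ω j 1 = -1) := by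
                  have s := hpw_step hωh (a := j) (b := j + 1) (by omega) (by omega); clear * - s hY1 hX2 hxe; omega
                rcases A with ⟨x0, y0⟩ | ⟨x0, y0⟩ | ⟨x0, y0⟩
                · exact (clash hωh x0 (y0.trans hkY.symm) (by omega) (by omega) (by omega)).elim
                · have A : (ω (j - 1) 0 = ω (j + 1) 0 ∧ ω (j - 1) 1 = 0) ∨ (ω (j - 1) 0 = 3 * ω (j + 1) 0 - 2 * ω (j + 2) 0 ∧ ω (j - 1) 1 = 0) := by
                    have s := hpw_step hωh (a := j - 1) (b := j) (by omega) (by omega); clear * - s x0 y0 hX2 hxe; omega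
                  rcases A with ⟨xm1, ym1⟩ | ⟨xm1, ym1⟩
                  · exact (clash hωh xm1 (ym1.trans hY1.symm) (by omega) (by omega) (by omega)).elim
                  · exact (clash hωh (xm1.trans x13.symm) (ym1.trans y13.symm) (by omega) (by omega) (by omega)).elim
                · have A : (ω (j - 1) 0 = ω (j + 2) 0 ∧ ω (j - 1) 1 = -1) ∨ (ω (j - 1) 0 = 2 * ω (j + 1) 0 - ω (j + 2) 0 ∧ ω (j - 1) 1 = -1) ∨ (ω (j - 1) 0 = ω (j + 1) 0 ∧ ω (j - 1) 1 = 0) := by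
                    have s := hpw_step hωh (a := j - 1) (b := j) (by omega) (by omega); clear * - s x0 y0 hX2 hxe; omega
                  rcases A with ⟨xm1, ym1⟩ | ⟨xm1, ym1⟩ | ⟨xm1, ym1⟩
                  · have A : (ω (j - 2) 0 = 2 * ω (j + 2) 0 - ω (j + 1) 0 ∧ ω (j - 2) 1 = -1) ∨ (ω (j - 2) 0 = ω (j + 1) 0 ∧ ω (j - 2) 1 = -1) ∨ (ω (j - 2) 0 = ω (j + 2) 0 ∧ ω (j - 2) 1 = -2) := by
                      have s := hpw_step hωh (a := j - 2) (b := j - 1) (by omega) (by omega); clear * - s xm1 ym1 hX2 hxe; omega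
                    rcases A with ⟨xm2, ym2⟩ | ⟨xm2, ym2⟩ | ⟨xm2, ym2⟩
                    · exact (clash hωh (xm2.trans x4.symm) (ym2.trans y4.symm) (by omega) (by omega) (by omega)).elim
                    · exact (clash hωh (xm2.trans x0.symm) (ym2.trans y0.symm) (by omega) (by omega) (by omega)).elim
                    · exact (clash hωh (xm2.trans x8.symm) (ym2.trans y8.symm) (by omega) (by omega) (by omega)).elim
                  · exact (clash hωh (xm1.trans x11.symm) (ym1.trans y11.symm) (by omega) (by omega) (by omega)).elim
                  · exact (clash hωh xm1 (ym1.trans hY1.symm) (by omega) (by omega) (by omega)).elim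
            · exact (clash hωh (x12.trans x10.symm) (y12.trans y10.symm) (by omega) (by omega) (by omega)).elim
        · have hcl := climb_le_even (hpw_subset hωh) (t := j + 10) (s := 4) (by omega) (by omega)
          rw [show j + 10 + 4 = j + 14 by omega] at hcl; clear * - hcl hend y10; exfalso; omega
      · have A : (ω (j + 10) 0 = 2 * ω (j + 2) 0 - ω (j + 1) 0 ∧ ω (j + 10) 1 = -1) ∨ (ω (j + 10) 0 = ω (j + 1) 0 ∧ ω (j + 10) 1 = -1) ∨ (ω (j + 10) 0 = ω (j + 2) 0 ∧ ω (j + 10) 1 = -2) := by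
          have s := hpw_step hωh (a := j + 9) (b := j + 10) (by omega) (by omega); clear * - s x9 y9 hX2 hxe; omega
        rcases A with ⟨x10, y10⟩ | ⟨x10, y10⟩ | ⟨x10, y10⟩
        · exact (clash hωh (x10.trans x4.symm) (y10.trans y4.symm) (by omega) (by omega) (by omega)).elim
        · have A : (ω (j + 11) 0 = ω (j + 2) 0 ∧ ω (j + 11) 1 = -1) ∨ (ω (j + 11) 0 = 2 * ω (j + 1) 0 - ω (j + 2) 0 ∧ ω (j + 11) 1 = -1) ∨ (ω (j + 11) 0 = ω (j + 1) 0 ∧ ω (j + 11) 1 = 0) := by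
            have s := hpw_step hωh (a := j + 10) (b := j + 11) (by omega) (by omega); clear * - s x10 y10 hX2 hxe; omega
          rcases A with ⟨x11, y11⟩ | ⟨x11, y11⟩ | ⟨x11, y11⟩
          · exact (clash hωh (x11.trans x9.symm) (y11.trans y9.symm) (by omega) (by omega) (by omega)).elim
          · have A : (ω (j + 12) 0 = ω (j + 1) 0 ∧ ω (j + 12) 1 = -1) ∨ (ω (j + 12) 0 = 3 * ω (j + 1) 0 - 2 * ω (j + 2) 0 ∧ ω (j + 12) 1 = -1) ∨ (ω (j + 12) 0 = 2 * ω (j + 1) 0 - ω (j + 2) 0 ∧ ω (j + 12) 1 = -2) := by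
              have s := hpw_step hωh (a := j + 11) (b := j + 12) (by omega) (by omega); clear * - s x11 y11 hX2 hxe; omega
            rcases A with ⟨x12, y12⟩ | ⟨x12, y12⟩ | ⟨x12, y12⟩
            · exact (clash hωh (x12.trans x10.symm) (y12.trans y10.symm) (by omega) (by omega) (by omega)).elim
            · have A : (ω (j + 13) 0 = 2 * ω (j + 1) 0 - ω (j + 2) 0 ∧ ω (j + 13) 1 = -1) ∨ (ω (j + 13) 0 = 4 * ω (j + 1) 0 - 3 * ω (j + 2) 0 ∧ ω (j + 13) 1 = -1) ∨ (ω (j + 13) 0 = 3 * ω (j + 1) 0 - 2 * ω (j + 2) 0 ∧ ω (j + 13) 1 = 0) := by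
                have s := hpw_step hωh (a := j + 12) (b := j + 13) (by omega) (by omega); clear * - s x12 y12 hX2 hxe; omega
              rcases A with ⟨x13, y13⟩ | ⟨x13, y13⟩ | ⟨x13, y13⟩
              · exact (clash hωh (x13.trans x11.symm) (y13.trans y11.symm) (by omega) (by omega) (by omega)).elim
              · have hcl := climb_le_odd (hpw_subset hωh) (t := j + 13) (s := 1) (by omega) (by omega)
                rw [show j + 13 + 1 = j + 14 by omega] at hcl; clear * - hcl hend y13; exfalso; omega
              · have A : (ω j 0 = ω (j + 2) 0 ∧ ω j 1 = 0) ∨ (ω j 0 = 2 * ω (j + 1) 0 - ω (j + 2) 0 ∧ ω j 1 = 0) ∨ (ω j 0 = ω (j + 1) 0 ∧ ω j 1 = -1) := by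
                  have s := hpw_step hωh (a := j) (b := j + 1) (by omega) (by omega); clear * - s hY1 hX2 hxe; omega
                rcases A with ⟨x0, y0⟩ | ⟨x0, y0⟩ | ⟨x0, y0⟩
                · exact (clash hωh x0 (y0.trans hkY.symm) (by omega) (by omega) (by omega)).elim
                · have A : (ω (j - 1) 0 = ω (j + 1) 0 ∧ ω (j - 1) 1 = 0) ∨ (ω (j - 1) 0 = 3 * ω (j + 1) 0 - 2 * ω (j + 2) 0 ∧ ω (j - 1) 1 = 0) := by
                    have s := hpw_step hωh (a := j - 1) (b := j) (by omega) (by omega); clear * - s x0 y0 hX2 hxe; omega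
                  rcases A with ⟨xm1, ym1⟩ | ⟨xm1, ym1⟩
                  · exact (clash hωh xm1 (ym1.trans hY1.symm) (by omega) (by omega) (by omega)).elim
                  · exact (clash hωh (xm1.trans x13.symm) (ym1.trans y13.symm) (by omega) (by omega) (by omega)).elim
                · exact (clash hωh (x0.trans x10.symm) (y0.trans y10.symm) (by omega) (by omega) (by omega)).elim
            · have hcl := climb_le_even (hpw_subset hωh) (t := j + 12) (s := 2) (by omega) (by omega)
              rw [show j + 12 + 2 = j + 14 by omega] at hcl; clear * - hcl hend y12; exfalso; omega
          · exact (clash hωh x11 (y11.trans hY1.symm) (by omega) (by omega) (by omega)).elim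
        · exact (clash hωh (x10.trans x8.symm) (y10.trans y8.symm) (by omega) (by omega) (by omega)).elim
    · have A : (ω (j + 9) 0 = 3 * ω (j + 2) 0 - 2 * ω (j + 1) 0 ∧ ω (j + 9) 1 = -3) ∨ (ω (j + 9) 0 = ω (j + 2) 0 ∧ ω (j + 9) 1 = -3) ∨ (ω (j + 9) 0 = 2 * ω (j + 2) 0 - ω (j + 1) 0 ∧ ω (j + 9) 1 = -2) := by
        have s := hpw_step hωh (a := j + 8) (b := j + 9) (by omega) (by omega); clear * - s x8 y8 hX2 hxe; omega
      rcases A with ⟨x9, y9⟩ | ⟨x9, y9⟩ | ⟨x9, y9⟩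
      · have hcl := climb_le_odd (hpw_subset hωh) (t := j + 9) (s := 5) (by omega) (by omega)
        rw [show j + 9 + 5 = j + 14 by omega] at hcl; clear * - hcl hend y9; exfalso; omega
      · have hcl := climb_le_odd (hpw_subset hωh) (t := j + 9) (s := 5) (by omega) (by omega)
        rw [show j + 9 + 5 = j + 14 by omega] at hcl; clear * - hcl hend y9; exfalso; omega
      · exact (clash hωh (x9.trans x7.symm) (y9.trans y7.symm) (by omega) (by omega) (by omega)).elim
  · exact (clash hωh (x7.trans x5.symm) (y7.trans y5.symm) (by omega) (by omega) (by omega)).elim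

set_option maxHeartbeats 400000 in
/-- Case analysis of the twelve-fibre under seven-step extendability (generated; 28 steps): branch excursion prefix ⟨(1, 0), (1, -1), (0, -1), (0, -2), (1, -2)⟩. [cite: EntingJensen2009, §7.4.2, Fig. 7.10 (brickwork form of the honeycomb lattice); HammersleyTorrieWhittington1982, §2] -/
theorem twelve_c4 {j : ℕ} (hωh : ω ∈ hpw (j + 14)) (hend : ω (j + 14) 1 = 0) (hkY : ω (j + 2) 1 = 0) (hno : ∀ i, j + 2 < i → i ≤ j + 12 → ¬ (i % 2 = 0 ∧ ω i 1 = 0))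
    (hE : ExtK k (j + 14) ω) (hk : 7 ≤ k) (hX2 : ω (j + 2) 0 = ω (j + 1) 0 + 1 ∨ ω (j + 1) 0 = ω (j + 2) 0 + 1) (hxe : ω (j + 2) 0 % 2 = 0)
    (hj2 : j % 2 = 0) (h3 : ω (j + 3) 0 = 2 * ω (j + 2) 0 - ω (j + 1) 0 ∧ ω (j + 3) 1 = 0)
    (h4 : ω (j + 4) 0 = 2 * ω (j + 2) 0 - ω (j + 1) 0 ∧ ω (j + 4) 1 = -1) (h5 : ω (j + 5) 0 = ω (j + 2) 0 ∧ ω (j + 5) 1 = -1)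
    (h6 : ω (j + 6) 0 = ω (j + 2) 0 ∧ ω (j + 6) 1 = -2) (h7 : ω (j + 7) 0 = 2 * ω (j + 2) 0 - ω (j + 1) 0 ∧ ω (j + 7) 1 = -2)
    : ∃ s : Fin 9, ∀ i ≤ 12, ω (j + 2 + i) 0 = ω (j + 2) 0 + Twelve.TX s i * (ω (j + 2) 0 - ω (j + 1) 0) ∧ ω (j + 2 + i) 1 = Twelve.TY s i := by
  obtain ⟨x3, y3⟩ := h3; obtain ⟨x4, y4⟩ := h4; obtain ⟨x5, y5⟩ := h5; obtain ⟨x6, y6⟩ := h6; obtain ⟨x7, y7⟩ := h7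
  have hE' := hE; obtain ⟨η, hη0, hadj, hηY, hηinj, hfresh⟩ := hE'
  have A : (ω (j + 8) 0 = 3 * ω (j + 2) 0 - 2 * ω (j + 1) 0 ∧ ω (j + 8) 1 = -2) ∨ (ω (j + 8) 0 = ω (j + 2) 0 ∧ ω (j + 8) 1 = -2) ∨ (ω (j + 8) 0 = 2 * ω (j + 2) 0 - ω (j + 1) 0 ∧ ω (j + 8) 1 = -3) := by
    have s := hpw_step hωh (a := j + 7) (b := j + 8) (by omega) (by omega); clear * - s x7 y7 hX2 hxe; omega
  rcases A with ⟨x8, y8⟩ | ⟨x8, y8⟩ | ⟨x8, y8⟩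
  · have A : (ω (j + 9) 0 = 4 * ω (j + 2) 0 - 3 * ω (j + 1) 0 ∧ ω (j + 9) 1 = -2) ∨ (ω (j + 9) 0 = 2 * ω (j + 2) 0 - ω (j + 1) 0 ∧ ω (j + 9) 1 = -2) ∨ (ω (j + 9) 0 = 3 * ω (j + 2) 0 - 2 * ω (j + 1) 0 ∧ ω (j + 9) 1 = -1) := by
      have s := hpw_step hωh (a := j + 8) (b := j + 9) (by omega) (by omega); clear * - s x8 y8 hX2 hxe; omega
    rcases A with ⟨x9, y9⟩ | ⟨x9, y9⟩ | ⟨x9, y9⟩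
    · have A : (ω (j + 10) 0 = 5 * ω (j + 2) 0 - 4 * ω (j + 1) 0 ∧ ω (j + 10) 1 = -2) ∨ (ω (j + 10) 0 = 3 * ω (j + 2) 0 - 2 * ω (j + 1) 0 ∧ ω (j + 10) 1 = -2) ∨ (ω (j + 10) 0 = 4 * ω (j + 2) 0 - 3 * ω (j + 1) 0 ∧ ω (j + 10) 1 = -3) := by
        have s := hpw_step hωh (a := j + 9) (b := j + 10) (by omega) (by omega); clear * - s x9 y9 hX2 hxe; omega
      rcases A with ⟨x10, y10⟩ | ⟨x10, y10⟩ | ⟨x10, y10⟩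
      · have A : (ω (j + 11) 0 = 6 * ω (j + 2) 0 - 5 * ω (j + 1) 0 ∧ ω (j + 11) 1 = -2) ∨ (ω (j + 11) 0 = 4 * ω (j + 2) 0 - 3 * ω (j + 1) 0 ∧ ω (j + 11) 1 = -2) ∨ (ω (j + 11) 0 = 5 * ω (j + 2) 0 - 4 * ω (j + 1) 0 ∧ ω (j + 11) 1 = -1) := by
          have s := hpw_step hωh (a := j + 10) (b := j + 11) (by omega) (by omega); clear * - s x10 y10 hX2 hxe; omega
        rcases A with ⟨x11, y11⟩ | ⟨x11, y11⟩ | ⟨x11, y11⟩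
        · have hcl := climb_le_odd (hpw_subset hωh) (t := j + 11) (s := 3) (by omega) (by omega)
          rw [show j + 11 + 3 = j + 14 by omega] at hcl; clear * - hcl hend y11; exfalso; omega
        · exact (clash hωh (x11.trans x9.symm) (y11.trans y9.symm) (by omega) (by omega) (by omega)).elim
        · have A : (ω (j + 12) 0 = 6 * ω (j + 2) 0 - 5 * ω (j + 1) 0 ∧ ω (j + 12) 1 = -1) ∨ (ω (j + 12) 0 = 4 * ω (j + 2) 0 - 3 * ω (j + 1) 0 ∧ ω (j + 12) 1 = -1) ∨ (ω (j + 12) 0 = 5 * ω (j + 2) 0 - 4 * ω (j + 1) 0 ∧ ω (j + 12) 1 = -2) := by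
            have s := hpw_step hωh (a := j + 11) (b := j + 12) (by omega) (by omega); clear * - s x11 y11 hX2 hxe; omega
          rcases A with ⟨x12, y12⟩ | ⟨x12, y12⟩ | ⟨x12, y12⟩
          · have A : (ω (j + 13) 0 = 7 * ω (j + 2) 0 - 6 * ω (j + 1) 0 ∧ ω (j + 13) 1 = -1) ∨ (ω (j + 13) 0 = 5 * ω (j + 2) 0 - 4 * ω (j + 1) 0 ∧ ω (j + 13) 1 = -1) ∨ (ω (j + 13) 0 = 6 * ω (j + 2) 0 - 5 * ω (j + 1) 0 ∧ ω (j + 13) 1 = 0) := by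
              have s := hpw_step hωh (a := j + 12) (b := j + 13) (by omega) (by omega); clear * - s x12 y12 hX2 hxe; omega
            rcases A with ⟨x13, y13⟩ | ⟨x13, y13⟩ | ⟨x13, y13⟩
            · have hcl := climb_le_odd (hpw_subset hωh) (t := j + 13) (s := 1) (by omega) (by omega)
              rw [show j + 13 + 1 = j + 14 by omega] at hcl; clear * - hcl hend y13; exfalso; omega
            · exact (clash hωh (x13.trans x11.symm) (y13.trans y11.symm) (by omega) (by omega) (by omega)).elim
            · have A : (ω (j + 14) 0 = 7 * ω (j + 2) 0 - 6 * ω (j + 1) 0 ∧ ω (j + 14) 1 = 0) ∨ (ω (j + 14) 0 = 5 * ω (j + 2) 0 - 4 * ω (j + 1) 0 ∧ ω (j + 14) 1 = 0) := by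
                have s := hpw_step hωh (a := j + 13) (b := j + 14) (by omega) (by omega); clear * - s x13 y13 hX2 hxe hend; omega
              rcases A with ⟨x14, y14⟩ | ⟨x14, y14⟩
              · refine ⟨⟨6, by norm_num⟩, ?_⟩; rw [show Twelve.TX ⟨6, by norm_num⟩ = Twelve.x6 from rfl, show Twelve.TY ⟨6, by norm_num⟩ = Twelve.y6 from rfl]
                intro i hi; interval_cases i <;> simp only [Nat.add_assoc, Nat.reduceAdd, Nat.add_zero, Twelve.x6, Twelve.y6] <;> omega
              · have u0 : η 0 0 = 5 * ω (j + 2) 0 - 4 * ω (j + 1) 0 := by rw [hη0, x14]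
                have v0 : η 0 1 = 0 := by rw [hη0, y14]
                have A : (η 1 0 = 6 * ω (j + 2) 0 - 5 * ω (j + 1) 0 ∧ η 1 1 = 0) ∨ (η 1 0 = 4 * ω (j + 2) 0 - 3 * ω (j + 1) 0 ∧ η 1 1 = 0) := by
                  have s := Arm.step_cases (show brickWallGraph.Adj (η 0) (η 1) from hadj 0 (by omega)); have hH' := hηY 1 (by norm_num) (by omega)
                  clear * - s hH' u0 v0 hX2 hxe; omega
                rcases A with ⟨u1, v1⟩ | ⟨u1, v1⟩
                · exact (hfresh (j + 13) (by omega) 1 (by omega) (by omega) ((site_two_eq_iff _ _).2 ⟨(x13.trans u1.symm), (y13.trans v1.symm)⟩)).elim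
                · have A : (η 2 0 = 5 * ω (j + 2) 0 - 4 * ω (j + 1) 0 ∧ η 2 1 = 0) ∨ (η 2 0 = 3 * ω (j + 2) 0 - 2 * ω (j + 1) 0 ∧ η 2 1 = 0) ∨ (η 2 0 = 4 * ω (j + 2) 0 - 3 * ω (j + 1) 0 ∧ η 2 1 = -1) := by
                    have s := Arm.step_cases (show brickWallGraph.Adj (η 1) (η 2) from hadj 1 (by omega)); have hH' := hηY 2 (by norm_num) (by omega)
                    clear * - s hH' u1 v1 hX2 hxe; omega
                  rcases A with ⟨u2, v2⟩ | ⟨u2, v2⟩ | ⟨u2, v2⟩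
                  · exact (hfresh (j + 14) (by omega) 2 (by omega) (by omega) ((site_two_eq_iff _ _).2 ⟨(x14.trans u2.symm), (y14.trans v2.symm)⟩)).elim
                  · have A : (η 3 0 = 4 * ω (j + 2) 0 - 3 * ω (j + 1) 0 ∧ η 3 1 = 0) ∨ (η 3 0 = 2 * ω (j + 2) 0 - ω (j + 1) 0 ∧ η 3 1 = 0) := by
                      have s := Arm.step_cases (show brickWallGraph.Adj (η 2) (η 3) from hadj 2 (by omega)); have hH' := hηY 3 (by norm_num) (by omega)
                      clear * - s hH' u2 v2 hX2 hxe; omega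
                    rcases A with ⟨u3, v3⟩ | ⟨u3, v3⟩
                    · exact absurd (hηinj 1 (by omega) 3 (by omega) ((site_two_eq_iff _ _).2 ⟨u1.trans u3.symm, v1.trans v3.symm⟩)) (by omega)
                    · exact (hfresh (j + 3) (by omega) 3 (by omega) (by omega) ((site_two_eq_iff _ _).2 ⟨(x3.trans u3.symm), (y3.trans v3.symm)⟩)).elim
                  · have A : (η 3 0 = 5 * ω (j + 2) 0 - 4 * ω (j + 1) 0 ∧ η 3 1 = -1) ∨ (η 3 0 = 3 * ω (j + 2) 0 - 2 * ω (j + 1) 0 ∧ η 3 1 = -1) ∨ (η 3 0 = 4 * ω (j + 2) 0 - 3 * ω (j + 1) 0 ∧ η 3 1 = 0) := by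
                      have s := Arm.step_cases (show brickWallGraph.Adj (η 2) (η 3) from hadj 2 (by omega)); have hH' := hηY 3 (by norm_num) (by omega)
                      clear * - s hH' u2 v2 hX2 hxe; omega
                    rcases A with ⟨u3, v3⟩ | ⟨u3, v3⟩ | ⟨u3, v3⟩
                    · exact (hfresh (j + 11) (by omega) 3 (by omega) (by omega) ((site_two_eq_iff _ _).2 ⟨(x11.trans u3.symm), (y11.trans v3.symm)⟩)).elim
                    · have A : (η 4 0 = 4 * ω (j + 2) 0 - 3 * ω (j + 1) 0 ∧ η 4 1 = -1) ∨ (η 4 0 = 2 * ω (j + 2) 0 - ω (j + 1) 0 ∧ η 4 1 = -1) ∨ (η 4 0 = 3 * ω (j + 2) 0 - 2 * ω (j + 1) 0 ∧ η 4 1 = -2) := by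
                        have s := Arm.step_cases (show brickWallGraph.Adj (η 3) (η 4) from hadj 3 (by omega)); have hH' := hηY 4 (by norm_num) (by omega)
                        clear * - s hH' u3 v3 hX2 hxe; omega
                      rcases A with ⟨u4, v4⟩ | ⟨u4, v4⟩ | ⟨u4, v4⟩
                      · exact absurd (hηinj 2 (by omega) 4 (by omega) ((site_two_eq_iff _ _).2 ⟨u2.trans u4.symm, v2.trans v4.symm⟩)) (by omega)
                      · exact (hfresh (j + 4) (by omega) 4 (by omega) (by omega) ((site_two_eq_iff _ _).2 ⟨(x4.trans u4.symm), (y4.trans v4.symm)⟩)).elim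
                      · exact (hfresh (j + 8) (by omega) 4 (by omega) (by omega) ((site_two_eq_iff _ _).2 ⟨(x8.trans u4.symm), (y8.trans v4.symm)⟩)).elim
                    · exact absurd (hηinj 1 (by omega) 3 (by omega) ((site_two_eq_iff _ _).2 ⟨u1.trans u3.symm, v1.trans v3.symm⟩)) (by omega)
          · have A : (ω (j + 13) 0 = 5 * ω (j + 2) 0 - 4 * ω (j + 1) 0 ∧ ω (j + 13) 1 = -1) ∨ (ω (j + 13) 0 = 3 * ω (j + 2) 0 - 2 * ω (j + 1) 0 ∧ ω (j + 13) 1 = -1) ∨ (ω (j + 13) 0 = 4 * ω (j + 2) 0 - 3 * ω (j + 1) 0 ∧ ω (j + 13) 1 = 0) := by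
              have s := hpw_step hωh (a := j + 12) (b := j + 13) (by omega) (by omega); clear * - s x12 y12 hX2 hxe; omega
            rcases A with ⟨x13, y13⟩ | ⟨x13, y13⟩ | ⟨x13, y13⟩
            · exact (clash hωh (x13.trans x11.symm) (y13.trans y11.symm) (by omega) (by omega) (by omega)).elim
            · have hcl := climb_le_odd (hpw_subset hωh) (t := j + 13) (s := 1) (by omega) (by omega)
              rw [show j + 13 + 1 = j + 14 by omega] at hcl; clear * - hcl hend y13; exfalso; omega
            · have A : (ω (j + 14) 0 = 5 * ω (j + 2) 0 - 4 * ω (j + 1) 0 ∧ ω (j + 14) 1 = 0) ∨ (ω (j + 14) 0 = 3 * ω (j + 2) 0 - 2 * ω (j + 1) 0 ∧ ω (j + 14) 1 = 0) := by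
                have s := hpw_step hωh (a := j + 13) (b := j + 14) (by omega) (by omega); clear * - s x13 y13 hX2 hxe hend; omega
              rcases A with ⟨x14, y14⟩ | ⟨x14, y14⟩
              · refine ⟨⟨7, by norm_num⟩, ?_⟩; rw [show Twelve.TX ⟨7, by norm_num⟩ = Twelve.x7 from rfl, show Twelve.TY ⟨7, by norm_num⟩ = Twelve.y7 from rfl]
                intro i hi; interval_cases i <;> simp only [Nat.add_assoc, Nat.reduceAdd, Nat.add_zero, Twelve.x7, Twelve.y7] <;> omega
              · have u0 : η 0 0 = 3 * ω (j + 2) 0 - 2 * ω (j + 1) 0 := by rw [hη0, x14]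
                have v0 : η 0 1 = 0 := by rw [hη0, y14]
                have A : (η 1 0 = 4 * ω (j + 2) 0 - 3 * ω (j + 1) 0 ∧ η 1 1 = 0) ∨ (η 1 0 = 2 * ω (j + 2) 0 - ω (j + 1) 0 ∧ η 1 1 = 0) := by
                  have s := Arm.step_cases (show brickWallGraph.Adj (η 0) (η 1) from hadj 0 (by omega)); have hH' := hηY 1 (by norm_num) (by omega)
                  clear * - s hH' u0 v0 hX2 hxe; omega
                rcases A with ⟨u1, v1⟩ | ⟨u1, v1⟩
                · exact (hfresh (j + 13) (by omega) 1 (by omega) (by omega) ((site_two_eq_iff _ _).2 ⟨(x13.trans u1.symm), (y13.trans v1.symm)⟩)).elim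
                · exact (hfresh (j + 3) (by omega) 1 (by omega) (by omega) ((site_two_eq_iff _ _).2 ⟨(x3.trans u1.symm), (y3.trans v1.symm)⟩)).elim
          · exact (clash hωh (x12.trans x10.symm) (y12.trans y10.symm) (by omega) (by omega) (by omega)).elim
      · exact (clash hωh (x10.trans x8.symm) (y10.trans y8.symm) (by omega) (by omega) (by omega)).elim
      · have hcl := climb_le_even (hpw_subset hωh) (t := j + 10) (s := 4) (by omega) (by omega)
        rw [show j + 10 + 4 = j + 14 by omega] at hcl; clear * - hcl hend y10; exfalso; omega
    · exact (clash hωh (x9.trans x7.symm) (y9.trans y7.symm) (by omega) (by omega) (by omega)).elim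
    · have A : (ω (j + 10) 0 = 4 * ω (j + 2) 0 - 3 * ω (j + 1) 0 ∧ ω (j + 10) 1 = -1) ∨ (ω (j + 10) 0 = 2 * ω (j + 2) 0 - ω (j + 1) 0 ∧ ω (j + 10) 1 = -1) ∨ (ω (j + 10) 0 = 3 * ω (j + 2) 0 - 2 * ω (j + 1) 0 ∧ ω (j + 10) 1 = -2) := by
        have s := hpw_step hωh (a := j + 9) (b := j + 10) (by omega) (by omega); clear * - s x9 y9 hX2 hxe; omega
      rcases A with ⟨x10, y10⟩ | ⟨x10, y10⟩ | ⟨x10, y10⟩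
      · have A : (ω (j + 11) 0 = 5 * ω (j + 2) 0 - 4 * ω (j + 1) 0 ∧ ω (j + 11) 1 = -1) ∨ (ω (j + 11) 0 = 3 * ω (j + 2) 0 - 2 * ω (j + 1) 0 ∧ ω (j + 11) 1 = -1) ∨ (ω (j + 11) 0 = 4 * ω (j + 2) 0 - 3 * ω (j + 1) 0 ∧ ω (j + 11) 1 = 0) := by
          have s := hpw_step hωh (a := j + 10) (b := j + 11) (by omega) (by omega); clear * - s x10 y10 hX2 hxe; omega
        rcases A with ⟨x11, y11⟩ | ⟨x11, y11⟩ | ⟨x11, y11⟩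
        · have A : (ω (j + 12) 0 = 6 * ω (j + 2) 0 - 5 * ω (j + 1) 0 ∧ ω (j + 12) 1 = -1) ∨ (ω (j + 12) 0 = 4 * ω (j + 2) 0 - 3 * ω (j + 1) 0 ∧ ω (j + 12) 1 = -1) ∨ (ω (j + 12) 0 = 5 * ω (j + 2) 0 - 4 * ω (j + 1) 0 ∧ ω (j + 12) 1 = -2) := by
            have s := hpw_step hωh (a := j + 11) (b := j + 12) (by omega) (by omega); clear * - s x11 y11 hX2 hxe; omega
          rcases A with ⟨x12, y12⟩ | ⟨x12, y12⟩ | ⟨x12, y12⟩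
          · have A : (ω (j + 13) 0 = 7 * ω (j + 2) 0 - 6 * ω (j + 1) 0 ∧ ω (j + 13) 1 = -1) ∨ (ω (j + 13) 0 = 5 * ω (j + 2) 0 - 4 * ω (j + 1) 0 ∧ ω (j + 13) 1 = -1) ∨ (ω (j + 13) 0 = 6 * ω (j + 2) 0 - 5 * ω (j + 1) 0 ∧ ω (j + 13) 1 = 0) := by
              have s := hpw_step hωh (a := j + 12) (b := j + 13) (by omega) (by omega); clear * - s x12 y12 hX2 hxe; omega
            rcases A with ⟨x13, y13⟩ | ⟨x13, y13⟩ | ⟨x13, y13⟩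
            · have hcl := climb_le_odd (hpw_subset hωh) (t := j + 13) (s := 1) (by omega) (by omega)
              rw [show j + 13 + 1 = j + 14 by omega] at hcl; clear * - hcl hend y13; exfalso; omega
            · exact (clash hωh (x13.trans x11.symm) (y13.trans y11.symm) (by omega) (by omega) (by omega)).elim
            · have A : (ω (j + 14) 0 = 7 * ω (j + 2) 0 - 6 * ω (j + 1) 0 ∧ ω (j + 14) 1 = 0) ∨ (ω (j + 14) 0 = 5 * ω (j + 2) 0 - 4 * ω (j + 1) 0 ∧ ω (j + 14) 1 = 0) := by
                have s := hpw_step hωh (a := j + 13) (b := j + 14) (by omega) (by omega); clear * - s x13 y13 hX2 hxe hend; omega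
              rcases A with ⟨x14, y14⟩ | ⟨x14, y14⟩
              · refine ⟨⟨8, by norm_num⟩, ?_⟩; rw [show Twelve.TX ⟨8, by norm_num⟩ = Twelve.x8 from rfl, show Twelve.TY ⟨8, by norm_num⟩ = Twelve.y8 from rfl]
                intro i hi; interval_cases i <;> simp only [Nat.add_assoc, Nat.reduceAdd, Nat.add_zero, Twelve.x8, Twelve.y8] <;> omega
              · have u0 : η 0 0 = 5 * ω (j + 2) 0 - 4 * ω (j + 1) 0 := by rw [hη0, x14]
                have v0 : η 0 1 = 0 := by rw [hη0, y14]
                have A : (η 1 0 = 6 * ω (j + 2) 0 - 5 * ω (j + 1) 0 ∧ η 1 1 = 0) ∨ (η 1 0 = 4 * ω (j + 2) 0 - 3 * ω (j + 1) 0 ∧ η 1 1 = 0) := by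
                  have s := Arm.step_cases (show brickWallGraph.Adj (η 0) (η 1) from hadj 0 (by omega)); have hH' := hηY 1 (by norm_num) (by omega)
                  clear * - s hH' u0 v0 hX2 hxe; omega
                rcases A with ⟨u1, v1⟩ | ⟨u1, v1⟩
                · exact (hfresh (j + 13) (by omega) 1 (by omega) (by omega) ((site_two_eq_iff _ _).2 ⟨(x13.trans u1.symm), (y13.trans v1.symm)⟩)).elim
                · have A : (η 2 0 = 5 * ω (j + 2) 0 - 4 * ω (j + 1) 0 ∧ η 2 1 = 0) ∨ (η 2 0 = 3 * ω (j + 2) 0 - 2 * ω (j + 1) 0 ∧ η 2 1 = 0) ∨ (η 2 0 = 4 * ω (j + 2) 0 - 3 * ω (j + 1) 0 ∧ η 2 1 = -1) := by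
                    have s := Arm.step_cases (show brickWallGraph.Adj (η 1) (η 2) from hadj 1 (by omega)); have hH' := hηY 2 (by norm_num) (by omega)
                    clear * - s hH' u1 v1 hX2 hxe; omega
                  rcases A with ⟨u2, v2⟩ | ⟨u2, v2⟩ | ⟨u2, v2⟩
                  · exact (hfresh (j + 14) (by omega) 2 (by omega) (by omega) ((site_two_eq_iff _ _).2 ⟨(x14.trans u2.symm), (y14.trans v2.symm)⟩)).elim
                  · have A : (η 3 0 = 4 * ω (j + 2) 0 - 3 * ω (j + 1) 0 ∧ η 3 1 = 0) ∨ (η 3 0 = 2 * ω (j + 2) 0 - ω (j + 1) 0 ∧ η 3 1 = 0) := by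
                      have s := Arm.step_cases (show brickWallGraph.Adj (η 2) (η 3) from hadj 2 (by omega)); have hH' := hηY 3 (by norm_num) (by omega)
                      clear * - s hH' u2 v2 hX2 hxe; omega
                    rcases A with ⟨u3, v3⟩ | ⟨u3, v3⟩
                    · exact absurd (hηinj 1 (by omega) 3 (by omega) ((site_two_eq_iff _ _).2 ⟨u1.trans u3.symm, v1.trans v3.symm⟩)) (by omega)
                    · exact (hfresh (j + 3) (by omega) 3 (by omega) (by omega) ((site_two_eq_iff _ _).2 ⟨(x3.trans u3.symm), (y3.trans v3.symm)⟩)).elim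
                  · exact (hfresh (j + 10) (by omega) 2 (by omega) (by omega) ((site_two_eq_iff _ _).2 ⟨(x10.trans u2.symm), (y10.trans v2.symm)⟩)).elim
          · exact (clash hωh (x12.trans x10.symm) (y12.trans y10.symm) (by omega) (by omega) (by omega)).elim
          · have hcl := climb_le_even (hpw_subset hωh) (t := j + 12) (s := 2) (by omega) (by omega)
            rw [show j + 12 + 2 = j + 14 by omega] at hcl; clear * - hcl hend y12; exfalso; omega
        · exact (clash hωh (x11.trans x9.symm) (y11.trans y9.symm) (by omega) (by omega) (by omega)).elim
        · have A : (ω (j + 12) 0 = 5 * ω (j + 2) 0 - 4 * ω (j + 1) 0 ∧ ω (j + 12) 1 = 0) ∨ (ω (j + 12) 0 = 3 * ω (j + 2) 0 - 2 * ω (j + 1) 0 ∧ ω (j + 12) 1 = 0) ∨ (ω (j + 12) 0 = 4 * ω (j + 2) 0 - 3 * ω (j + 1) 0 ∧ ω (j + 12) 1 = -1) := by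
            have s := hpw_step hωh (a := j + 11) (b := j + 12) (by omega) (by omega); clear * - s x11 y11 hX2 hxe; omega
          rcases A with ⟨x12, y12⟩ | ⟨x12, y12⟩ | ⟨x12, y12⟩
          · exact (hno (j + 12) (by omega) (by omega) ⟨by omega, y12⟩).elim
          · exact (hno (j + 12) (by omega) (by omega) ⟨by omega, y12⟩).elim
          · exact (clash hωh (x12.trans x10.symm) (y12.trans y10.symm) (by omega) (by omega) (by omega)).elim
      · exact (clash hωh (x10.trans x4.symm) (y10.trans y4.symm) (by omega) (by omega) (by omega)).elim
      · exact (clash hωh (x10.trans x8.symm) (y10.trans y8.symm) (by omega) (by omega) (by omega)).elim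
  · exact (clash hωh (x8.trans x6.symm) (y8.trans y6.symm) (by omega) (by omega) (by omega)).elim
  · have A : (ω (j + 9) 0 = 3 * ω (j + 2) 0 - 2 * ω (j + 1) 0 ∧ ω (j + 9) 1 = -3) ∨ (ω (j + 9) 0 = ω (j + 2) 0 ∧ ω (j + 9) 1 = -3) ∨ (ω (j + 9) 0 = 2 * ω (j + 2) 0 - ω (j + 1) 0 ∧ ω (j + 9) 1 = -2) := by
      have s := hpw_step hωh (a := j + 8) (b := j + 9) (by omega) (by omega); clear * - s x8 y8 hX2 hxe; omega
    rcases A with ⟨x9, y9⟩ | ⟨x9, y9⟩ | ⟨x9, y9⟩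
    · have hcl := climb_le_odd (hpw_subset hωh) (t := j + 9) (s := 5) (by omega) (by omega)
      rw [show j + 9 + 5 = j + 14 by omega] at hcl; clear * - hcl hend y9; exfalso; omega
    · have hcl := climb_le_odd (hpw_subset hωh) (t := j + 9) (s := 5) (by omega) (by omega)
      rw [show j + 9 + 5 = j + 14 by omega] at hcl; clear * - hcl hend y9; exfalso; omega
    · exact (clash hωh (x9.trans x7.symm) (y9.trans y7.symm) (by omega) (by omega) (by omega)).elim

set_option maxHeartbeats 400000 in
/-- Case analysis of the twelve-fibre under seven-step extendability (generated; 31 steps): branch excursion prefix ⟨(1, 0), (1, -1), (0, -1), (0, -2), (-1, -2), (-2, -2)⟩. [cite: EntingJensen2009, §7.4.2, Fig. 7.10 (brickwork form of the honeycomb lattice); HammersleyTorrieWhittington1982, §2] -/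
theorem twelve_c5 {j : ℕ} (hj : 5 ≤ j) (hωh : ω ∈ hpw (j + 14)) (hend : ω (j + 14) 1 = 0) (hkY : ω (j + 2) 1 = 0)
    (hX2 : ω (j + 2) 0 = ω (j + 1) 0 + 1 ∨ ω (j + 1) 0 = ω (j + 2) 0 + 1) (hY1 : ω (j + 1) 1 = 0) (hxe : ω (j + 2) 0 % 2 = 0) (hj2 : j % 2 = 0)
    (h5 : ω (j + 5) 0 = ω (j + 2) 0 ∧ ω (j + 5) 1 = -1) (h7 : ω (j + 7) 0 = ω (j + 1) 0 ∧ ω (j + 7) 1 = -2)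
    (h8 : ω (j + 8) 0 = 2 * ω (j + 1) 0 - ω (j + 2) 0 ∧ ω (j + 8) 1 = -2)
    : ∃ s : Fin 9, ∀ i ≤ 12, ω (j + 2 + i) 0 = ω (j + 2) 0 + Twelve.TX s i * (ω (j + 2) 0 - ω (j + 1) 0) ∧ ω (j + 2 + i) 1 = Twelve.TY s i := by
  obtain ⟨x5, y5⟩ := h5; obtain ⟨x7, y7⟩ := h7; obtain ⟨x8, y8⟩ := h8
  have A : (ω (j + 9) 0 = ω (j + 1) 0 ∧ ω (j + 9) 1 = -2) ∨ (ω (j + 9) 0 = 3 * ω (j + 1) 0 - 2 * ω (j + 2) 0 ∧ ω (j + 9) 1 = -2) ∨ (ω (j + 9) 0 = 2 * ω (j + 1) 0 - ω (j + 2) 0 ∧ ω (j + 9) 1 = -1) := by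
    have s := hpw_step hωh (a := j + 8) (b := j + 9) (by omega) (by omega); clear * - s x8 y8 hX2 hxe; omega
  rcases A with ⟨x9, y9⟩ | ⟨x9, y9⟩ | ⟨x9, y9⟩
  · exact (clash hωh (x9.trans x7.symm) (y9.trans y7.symm) (by omega) (by omega) (by omega)).elim
  · have A : (ω (j + 10) 0 = 2 * ω (j + 1) 0 - ω (j + 2) 0 ∧ ω (j + 10) 1 = -2) ∨ (ω (j + 10) 0 = 4 * ω (j + 1) 0 - 3 * ω (j + 2) 0 ∧ ω (j + 10) 1 = -2) ∨ (ω (j + 10) 0 = 3 * ω (j + 1) 0 - 2 * ω (j + 2) 0 ∧ ω (j + 10) 1 = -3) := by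
      have s := hpw_step hωh (a := j + 9) (b := j + 10) (by omega) (by omega); clear * - s x9 y9 hX2 hxe; omega
    rcases A with ⟨x10, y10⟩ | ⟨x10, y10⟩ | ⟨x10, y10⟩
    · exact (clash hωh (x10.trans x8.symm) (y10.trans y8.symm) (by omega) (by omega) (by omega)).elim
    · have A : (ω (j + 11) 0 = 3 * ω (j + 1) 0 - 2 * ω (j + 2) 0 ∧ ω (j + 11) 1 = -2) ∨ (ω (j + 11) 0 = 5 * ω (j + 1) 0 - 4 * ω (j + 2) 0 ∧ ω (j + 11) 1 = -2) ∨ (ω (j + 11) 0 = 4 * ω (j + 1) 0 - 3 * ω (j + 2) 0 ∧ ω (j + 11) 1 = -1) := by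
        have s := hpw_step hωh (a := j + 10) (b := j + 11) (by omega) (by omega); clear * - s x10 y10 hX2 hxe; omega
      rcases A with ⟨x11, y11⟩ | ⟨x11, y11⟩ | ⟨x11, y11⟩
      · exact (clash hωh (x11.trans x9.symm) (y11.trans y9.symm) (by omega) (by omega) (by omega)).elim
      · have hcl := climb_le_odd (hpw_subset hωh) (t := j + 11) (s := 3) (by omega) (by omega)
        rw [show j + 11 + 3 = j + 14 by omega] at hcl; clear * - hcl hend y11; exfalso; omega
      · have A : (ω j 0 = ω (j + 2) 0 ∧ ω j 1 = 0) ∨ (ω j 0 = 2 * ω (j + 1) 0 - ω (j + 2) 0 ∧ ω j 1 = 0) ∨ (ω j 0 = ω (j + 1) 0 ∧ ω j 1 = -1) := by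
          have s := hpw_step hωh (a := j) (b := j + 1) (by omega) (by omega); clear * - s hY1 hX2 hxe; omega
        rcases A with ⟨x0, y0⟩ | ⟨x0, y0⟩ | ⟨x0, y0⟩
        · exact (clash hωh x0 (y0.trans hkY.symm) (by omega) (by omega) (by omega)).elim
        · have A : (ω (j - 1) 0 = ω (j + 1) 0 ∧ ω (j - 1) 1 = 0) ∨ (ω (j - 1) 0 = 3 * ω (j + 1) 0 - 2 * ω (j + 2) 0 ∧ ω (j - 1) 1 = 0) := by
            have s := hpw_step hωh (a := j - 1) (b := j) (by omega) (by omega); clear * - s x0 y0 hX2 hxe; omega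
          rcases A with ⟨xm1, ym1⟩ | ⟨xm1, ym1⟩
          · exact (clash hωh xm1 (ym1.trans hY1.symm) (by omega) (by omega) (by omega)).elim
          · have A : (ω (j + 12) 0 = 3 * ω (j + 1) 0 - 2 * ω (j + 2) 0 ∧ ω (j + 12) 1 = -1) ∨ (ω (j + 12) 0 = 5 * ω (j + 1) 0 - 4 * ω (j + 2) 0 ∧ ω (j + 12) 1 = -1) ∨ (ω (j + 12) 0 = 4 * ω (j + 1) 0 - 3 * ω (j + 2) 0 ∧ ω (j + 12) 1 = -2) := by
              have s := hpw_step hωh (a := j + 11) (b := j + 12) (by omega) (by omega); clear * - s x11 y11 hX2 hxe; omega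
            rcases A with ⟨x12, y12⟩ | ⟨x12, y12⟩ | ⟨x12, y12⟩
            · have A : (ω (j + 13) 0 = 2 * ω (j + 1) 0 - ω (j + 2) 0 ∧ ω (j + 13) 1 = -1) ∨ (ω (j + 13) 0 = 4 * ω (j + 1) 0 - 3 * ω (j + 2) 0 ∧ ω (j + 13) 1 = -1) ∨ (ω (j + 13) 0 = 3 * ω (j + 1) 0 - 2 * ω (j + 2) 0 ∧ ω (j + 13) 1 = 0) := by
                have s := hpw_step hωh (a := j + 12) (b := j + 13) (by omega) (by omega); clear * - s x12 y12 hX2 hxe; omega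
              rcases A with ⟨x13, y13⟩ | ⟨x13, y13⟩ | ⟨x13, y13⟩
              · have hcl := climb_le_odd (hpw_subset hωh) (t := j + 13) (s := 1) (by omega) (by omega)
                rw [show j + 13 + 1 = j + 14 by omega] at hcl; clear * - hcl hend y13; exfalso; omega
              · exact (clash hωh (x13.trans x11.symm) (y13.trans y11.symm) (by omega) (by omega) (by omega)).elim
              · exact (clash hωh (x13.trans xm1.symm) (y13.trans ym1.symm) (by omega) (by omega) (by omega)).elim
            · have A : (ω (j + 13) 0 = 4 * ω (j + 1) 0 - 3 * ω (j + 2) 0 ∧ ω (j + 13) 1 = -1) ∨ (ω (j + 13) 0 = 6 * ω (j + 1) 0 - 5 * ω (j + 2) 0 ∧ ω (j + 13) 1 = -1) ∨ (ω (j + 13) 0 = 5 * ω (j + 1) 0 - 4 * ω (j + 2) 0 ∧ ω (j + 13) 1 = 0) := by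
                have s := hpw_step hωh (a := j + 12) (b := j + 13) (by omega) (by omega); clear * - s x12 y12 hX2 hxe; omega
              rcases A with ⟨x13, y13⟩ | ⟨x13, y13⟩ | ⟨x13, y13⟩
              · exact (clash hωh (x13.trans x11.symm) (y13.trans y11.symm) (by omega) (by omega) (by omega)).elim
              · have hcl := climb_le_odd (hpw_subset hωh) (t := j + 13) (s := 1) (by omega) (by omega)
                rw [show j + 13 + 1 = j + 14 by omega] at hcl; clear * - hcl hend y13; exfalso; omega
              · have A : (ω (j - 2) 0 = 2 * ω (j + 1) 0 - ω (j + 2) 0 ∧ ω (j - 2) 1 = 0) ∨ (ω (j - 2) 0 = 4 * ω (j + 1) 0 - 3 * ω (j + 2) 0 ∧ ω (j - 2) 1 = 0) ∨ (ω (j - 2) 0 = 3 * ω (j + 1) 0 - 2 * ω (j + 2) 0 ∧ ω (j - 2) 1 = -1) := by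
                  have s := hpw_step hωh (a := j - 2) (b := j - 1) (by omega) (by omega); clear * - s xm1 ym1 hX2 hxe; omega
                rcases A with ⟨xm2, ym2⟩ | ⟨xm2, ym2⟩ | ⟨xm2, ym2⟩
                · exact (clash hωh (xm2.trans x0.symm) (ym2.trans y0.symm) (by omega) (by omega) (by omega)).elim
                · have A : (ω (j - 3) 0 = 3 * ω (j + 1) 0 - 2 * ω (j + 2) 0 ∧ ω (j - 3) 1 = 0) ∨ (ω (j - 3) 0 = 5 * ω (j + 1) 0 - 4 * ω (j + 2) 0 ∧ ω (j - 3) 1 = 0) := by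
                    have s := hpw_step hωh (a := j - 3) (b := j - 2) (by omega) (by omega); clear * - s xm2 ym2 hX2 hxe; omega
                  rcases A with ⟨xm3, ym3⟩ | ⟨xm3, ym3⟩
                  · exact (clash hωh (xm3.trans xm1.symm) (ym3.trans ym1.symm) (by omega) (by omega) (by omega)).elim
                  · exact (clash hωh (xm3.trans x13.symm) (ym3.trans y13.symm) (by omega) (by omega) (by omega)).elim
                · have A : (ω (j - 3) 0 = 2 * ω (j + 1) 0 - ω (j + 2) 0 ∧ ω (j - 3) 1 = -1) ∨ (ω (j - 3) 0 = 4 * ω (j + 1) 0 - 3 * ω (j + 2) 0 ∧ ω (j - 3) 1 = -1) ∨ (ω (j - 3) 0 = 3 * ω (j + 1) 0 - 2 * ω (j + 2) 0 ∧ ω (j - 3) 1 = 0) := by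
                    have s := hpw_step hωh (a := j - 3) (b := j - 2) (by omega) (by omega); clear * - s xm2 ym2 hX2 hxe; omega
                  rcases A with ⟨xm3, ym3⟩ | ⟨xm3, ym3⟩ | ⟨xm3, ym3⟩
                  · have A : (ω (j - 4) 0 = ω (j + 1) 0 ∧ ω (j - 4) 1 = -1) ∨ (ω (j - 4) 0 = 3 * ω (j + 1) 0 - 2 * ω (j + 2) 0 ∧ ω (j - 4) 1 = -1) ∨ (ω (j - 4) 0 = 2 * ω (j + 1) 0 - ω (j + 2) 0 ∧ ω (j - 4) 1 = -2) := by
                      have s := hpw_step hωh (a := j - 4) (b := j - 3) (by omega) (by omega); clear * - s xm3 ym3 hX2 hxe; omega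
                    rcases A with ⟨xm4, ym4⟩ | ⟨xm4, ym4⟩ | ⟨xm4, ym4⟩
                    · have A : (ω (j - 5) 0 = ω (j + 2) 0 ∧ ω (j - 5) 1 = -1) ∨ (ω (j - 5) 0 = 2 * ω (j + 1) 0 - ω (j + 2) 0 ∧ ω (j - 5) 1 = -1) ∨ (ω (j - 5) 0 = ω (j + 1) 0 ∧ ω (j - 5) 1 = 0) := by
                        have s := hpw_step hωh (a := j - 5) (b := j - 4) (by omega) (by omega); clear * - s xm4 ym4 hX2 hxe; omega
                      rcases A with ⟨xm5, ym5⟩ | ⟨xm5, ym5⟩ | ⟨xm5, ym5⟩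
                      · exact (clash hωh (xm5.trans x5.symm) (ym5.trans y5.symm) (by omega) (by omega) (by omega)).elim
                      · exact (clash hωh (xm5.trans xm3.symm) (ym5.trans ym3.symm) (by omega) (by omega) (by omega)).elim
                      · exact (clash hωh xm5 (ym5.trans hY1.symm) (by omega) (by omega) (by omega)).elim
                    · exact (clash hωh (xm4.trans xm2.symm) (ym4.trans ym2.symm) (by omega) (by omega) (by omega)).elim
                    · exact (clash hωh (xm4.trans x8.symm) (ym4.trans y8.symm) (by omega) (by omega) (by omega)).elim
                  · exact (clash hωh (xm3.trans x11.symm) (ym3.trans y11.symm) (by omega) (by omega) (by omega)).elim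
                  · exact (clash hωh (xm3.trans xm1.symm) (ym3.trans ym1.symm) (by omega) (by omega) (by omega)).elim
            · exact (clash hωh (x12.trans x10.symm) (y12.trans y10.symm) (by omega) (by omega) (by omega)).elim
        · have A : (ω (j - 1) 0 = ω (j + 2) 0 ∧ ω (j - 1) 1 = -1) ∨ (ω (j - 1) 0 = 2 * ω (j + 1) 0 - ω (j + 2) 0 ∧ ω (j - 1) 1 = -1) ∨ (ω (j - 1) 0 = ω (j + 1) 0 ∧ ω (j - 1) 1 = 0) := by
            have s := hpw_step hωh (a := j - 1) (b := j) (by omega) (by omega); clear * - s x0 y0 hX2 hxe; omega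
          rcases A with ⟨xm1, ym1⟩ | ⟨xm1, ym1⟩ | ⟨xm1, ym1⟩
          · exact (clash hωh (xm1.trans x5.symm) (ym1.trans y5.symm) (by omega) (by omega) (by omega)).elim
          · have A : (ω (j - 2) 0 = ω (j + 1) 0 ∧ ω (j - 2) 1 = -1) ∨ (ω (j - 2) 0 = 3 * ω (j + 1) 0 - 2 * ω (j + 2) 0 ∧ ω (j - 2) 1 = -1) ∨ (ω (j - 2) 0 = 2 * ω (j + 1) 0 - ω (j + 2) 0 ∧ ω (j - 2) 1 = -2) := by
              have s := hpw_step hωh (a := j - 2) (b := j - 1) (by omega) (by omega); clear * - s xm1 ym1 hX2 hxe; omega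
            rcases A with ⟨xm2, ym2⟩ | ⟨xm2, ym2⟩ | ⟨xm2, ym2⟩
            · exact (clash hωh (xm2.trans x0.symm) (ym2.trans y0.symm) (by omega) (by omega) (by omega)).elim
            · have A : (ω (j + 12) 0 = 3 * ω (j + 1) 0 - 2 * ω (j + 2) 0 ∧ ω (j + 12) 1 = -1) ∨ (ω (j + 12) 0 = 5 * ω (j + 1) 0 - 4 * ω (j + 2) 0 ∧ ω (j + 12) 1 = -1) ∨ (ω (j + 12) 0 = 4 * ω (j + 1) 0 - 3 * ω (j + 2) 0 ∧ ω (j + 12) 1 = -2) := by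
                have s := hpw_step hωh (a := j + 11) (b := j + 12) (by omega) (by omega); clear * - s x11 y11 hX2 hxe; omega
              rcases A with ⟨x12, y12⟩ | ⟨x12, y12⟩ | ⟨x12, y12⟩
              · exact (clash hωh (x12.trans xm2.symm) (y12.trans ym2.symm) (by omega) (by omega) (by omega)).elim
              · have A : (ω (j + 13) 0 = 4 * ω (j + 1) 0 - 3 * ω (j + 2) 0 ∧ ω (j + 13) 1 = -1) ∨ (ω (j + 13) 0 = 6 * ω (j + 1) 0 - 5 * ω (j + 2) 0 ∧ ω (j + 13) 1 = -1) ∨ (ω (j + 13) 0 = 5 * ω (j + 1) 0 - 4 * ω (j + 2) 0 ∧ ω (j + 13) 1 = 0) := by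
                  have s := hpw_step hωh (a := j + 12) (b := j + 13) (by omega) (by omega); clear * - s x12 y12 hX2 hxe; omega
                rcases A with ⟨x13, y13⟩ | ⟨x13, y13⟩ | ⟨x13, y13⟩
                · exact (clash hωh (x13.trans x11.symm) (y13.trans y11.symm) (by omega) (by omega) (by omega)).elim
                · have hcl := climb_le_odd (hpw_subset hωh) (t := j + 13) (s := 1) (by omega) (by omega)
                  rw [show j + 13 + 1 = j + 14 by omega] at hcl; clear * - hcl hend y13; exfalso; omega
                · have A : (ω (j - 3) 0 = 2 * ω (j + 1) 0 - ω (j + 2) 0 ∧ ω (j - 3) 1 = -1) ∨ (ω (j - 3) 0 = 4 * ω (j + 1) 0 - 3 * ω (j + 2) 0 ∧ ω (j - 3) 1 = -1) ∨ (ω (j - 3) 0 = 3 * ω (j + 1) 0 - 2 * ω (j + 2) 0 ∧ ω (j - 3) 1 = 0) := by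
                    have s := hpw_step hωh (a := j - 3) (b := j - 2) (by omega) (by omega); clear * - s xm2 ym2 hX2 hxe; omega
                  rcases A with ⟨xm3, ym3⟩ | ⟨xm3, ym3⟩ | ⟨xm3, ym3⟩
                  · exact (clash hωh (xm3.trans xm1.symm) (ym3.trans ym1.symm) (by omega) (by omega) (by omega)).elim
                  · exact (clash hωh (xm3.trans x11.symm) (ym3.trans y11.symm) (by omega) (by omega) (by omega)).elim
                  · have A : (ω (j - 4) 0 = 2 * ω (j + 1) 0 - ω (j + 2) 0 ∧ ω (j - 4) 1 = 0) ∨ (ω (j - 4) 0 = 4 * ω (j + 1) 0 - 3 * ω (j + 2) 0 ∧ ω (j - 4) 1 = 0) ∨ (ω (j - 4) 0 = 3 * ω (j + 1) 0 - 2 * ω (j + 2) 0 ∧ ω (j - 4) 1 = -1) := by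
                      have s := hpw_step hωh (a := j - 4) (b := j - 3) (by omega) (by omega); clear * - s xm3 ym3 hX2 hxe; omega
                    rcases A with ⟨xm4, ym4⟩ | ⟨xm4, ym4⟩ | ⟨xm4, ym4⟩
                    · have A : (ω (j - 5) 0 = ω (j + 1) 0 ∧ ω (j - 5) 1 = 0) ∨ (ω (j - 5) 0 = 3 * ω (j + 1) 0 - 2 * ω (j + 2) 0 ∧ ω (j - 5) 1 = 0) := by
                        have s := hpw_step hωh (a := j - 5) (b := j - 4) (by omega) (by omega); clear * - s xm4 ym4 hX2 hxe; omega
                      rcases A with ⟨xm5, ym5⟩ | ⟨xm5, ym5⟩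
                      · exact (clash hωh xm5 (ym5.trans hY1.symm) (by omega) (by omega) (by omega)).elim
                      · exact (clash hωh (xm5.trans xm3.symm) (ym5.trans ym3.symm) (by omega) (by omega) (by omega)).elim
                    · have A : (ω (j - 5) 0 = 3 * ω (j + 1) 0 - 2 * ω (j + 2) 0 ∧ ω (j - 5) 1 = 0) ∨ (ω (j - 5) 0 = 5 * ω (j + 1) 0 - 4 * ω (j + 2) 0 ∧ ω (j - 5) 1 = 0) := by
                        have s := hpw_step hωh (a := j - 5) (b := j - 4) (by omega) (by omega); clear * - s xm4 ym4 hX2 hxe; omega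
                      rcases A with ⟨xm5, ym5⟩ | ⟨xm5, ym5⟩
                      · exact (clash hωh (xm5.trans xm3.symm) (ym5.trans ym3.symm) (by omega) (by omega) (by omega)).elim
                      · exact (clash hωh (xm5.trans x13.symm) (ym5.trans y13.symm) (by omega) (by omega) (by omega)).elim
                    · exact (clash hωh (xm4.trans xm2.symm) (ym4.trans ym2.symm) (by omega) (by omega) (by omega)).elim
              · exact (clash hωh (x12.trans x10.symm) (y12.trans y10.symm) (by omega) (by omega) (by omega)).elim
            · exact (clash hωh (xm2.trans x8.symm) (ym2.trans y8.symm) (by omega) (by omega) (by omega)).elim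
          · exact (clash hωh xm1 (ym1.trans hY1.symm) (by omega) (by omega) (by omega)).elim
    · have hcl := climb_le_even (hpw_subset hωh) (t := j + 10) (s := 4) (by omega) (by omega)
      rw [show j + 10 + 4 = j + 14 by omega] at hcl; clear * - hcl hend y10; exfalso; omega
  · have A : (ω (j + 10) 0 = ω (j + 1) 0 ∧ ω (j + 10) 1 = -1) ∨ (ω (j + 10) 0 = 3 * ω (j + 1) 0 - 2 * ω (j + 2) 0 ∧ ω (j + 10) 1 = -1) ∨ (ω (j + 10) 0 = 2 * ω (j + 1) 0 - ω (j + 2) 0 ∧ ω (j + 10) 1 = -2) := by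
      have s := hpw_step hωh (a := j + 9) (b := j + 10) (by omega) (by omega); clear * - s x9 y9 hX2 hxe; omega
    rcases A with ⟨x10, y10⟩ | ⟨x10, y10⟩ | ⟨x10, y10⟩
    · have A : (ω (j + 11) 0 = ω (j + 2) 0 ∧ ω (j + 11) 1 = -1) ∨ (ω (j + 11) 0 = 2 * ω (j + 1) 0 - ω (j + 2) 0 ∧ ω (j + 11) 1 = -1) ∨ (ω (j + 11) 0 = ω (j + 1) 0 ∧ ω (j + 11) 1 = 0) := by
        have s := hpw_step hωh (a := j + 10) (b := j + 11) (by omega) (by omega); clear * - s x10 y10 hX2 hxe; omega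
      rcases A with ⟨x11, y11⟩ | ⟨x11, y11⟩ | ⟨x11, y11⟩
      · exact (clash hωh (x11.trans x5.symm) (y11.trans y5.symm) (by omega) (by omega) (by omega)).elim
      · exact (clash hωh (x11.trans x9.symm) (y11.trans y9.symm) (by omega) (by omega) (by omega)).elim
      · exact (clash hωh x11 (y11.trans hY1.symm) (by omega) (by omega) (by omega)).elim
    · have A : (ω j 0 = ω (j + 2) 0 ∧ ω j 1 = 0) ∨ (ω j 0 = 2 * ω (j + 1) 0 - ω (j + 2) 0 ∧ ω j 1 = 0) ∨ (ω j 0 = ω (j + 1) 0 ∧ ω j 1 = -1) := by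
        have s := hpw_step hωh (a := j) (b := j + 1) (by omega) (by omega); clear * - s hY1 hX2 hxe; omega
      rcases A with ⟨x0, y0⟩ | ⟨x0, y0⟩ | ⟨x0, y0⟩
      · exact (clash hωh x0 (y0.trans hkY.symm) (by omega) (by omega) (by omega)).elim
      · have A : (ω (j - 1) 0 = ω (j + 1) 0 ∧ ω (j - 1) 1 = 0) ∨ (ω (j - 1) 0 = 3 * ω (j + 1) 0 - 2 * ω (j + 2) 0 ∧ ω (j - 1) 1 = 0) := by
          have s := hpw_step hωh (a := j - 1) (b := j) (by omega) (by omega); clear * - s x0 y0 hX2 hxe; omega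
        rcases A with ⟨xm1, ym1⟩ | ⟨xm1, ym1⟩
        · exact (clash hωh xm1 (ym1.trans hY1.symm) (by omega) (by omega) (by omega)).elim
        · have A : (ω (j + 11) 0 = 2 * ω (j + 1) 0 - ω (j + 2) 0 ∧ ω (j + 11) 1 = -1) ∨ (ω (j + 11) 0 = 4 * ω (j + 1) 0 - 3 * ω (j + 2) 0 ∧ ω (j + 11) 1 = -1) ∨ (ω (j + 11) 0 = 3 * ω (j + 1) 0 - 2 * ω (j + 2) 0 ∧ ω (j + 11) 1 = 0) := by
            have s := hpw_step hωh (a := j + 10) (b := j + 11) (by omega) (by omega); clear * - s x10 y10 hX2 hxe; omega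
          rcases A with ⟨x11, y11⟩ | ⟨x11, y11⟩ | ⟨x11, y11⟩
          · exact (clash hωh (x11.trans x9.symm) (y11.trans y9.symm) (by omega) (by omega) (by omega)).elim
          · have A : (ω (j + 12) 0 = 3 * ω (j + 1) 0 - 2 * ω (j + 2) 0 ∧ ω (j + 12) 1 = -1) ∨ (ω (j + 12) 0 = 5 * ω (j + 1) 0 - 4 * ω (j + 2) 0 ∧ ω (j + 12) 1 = -1) ∨ (ω (j + 12) 0 = 4 * ω (j + 1) 0 - 3 * ω (j + 2) 0 ∧ ω (j + 12) 1 = -2) := by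
              have s := hpw_step hωh (a := j + 11) (b := j + 12) (by omega) (by omega); clear * - s x11 y11 hX2 hxe; omega
            rcases A with ⟨x12, y12⟩ | ⟨x12, y12⟩ | ⟨x12, y12⟩
            · exact (clash hωh (x12.trans x10.symm) (y12.trans y10.symm) (by omega) (by omega) (by omega)).elim
            · have A : (ω (j + 13) 0 = 4 * ω (j + 1) 0 - 3 * ω (j + 2) 0 ∧ ω (j + 13) 1 = -1) ∨ (ω (j + 13) 0 = 6 * ω (j + 1) 0 - 5 * ω (j + 2) 0 ∧ ω (j + 13) 1 = -1) ∨ (ω (j + 13) 0 = 5 * ω (j + 1) 0 - 4 * ω (j + 2) 0 ∧ ω (j + 13) 1 = 0) := by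
                have s := hpw_step hωh (a := j + 12) (b := j + 13) (by omega) (by omega); clear * - s x12 y12 hX2 hxe; omega
              rcases A with ⟨x13, y13⟩ | ⟨x13, y13⟩ | ⟨x13, y13⟩
              · exact (clash hωh (x13.trans x11.symm) (y13.trans y11.symm) (by omega) (by omega) (by omega)).elim
              · have hcl := climb_le_odd (hpw_subset hωh) (t := j + 13) (s := 1) (by omega) (by omega)
                rw [show j + 13 + 1 = j + 14 by omega] at hcl; clear * - hcl hend y13; exfalso; omega
              · have A : (ω (j - 2) 0 = 2 * ω (j + 1) 0 - ω (j + 2) 0 ∧ ω (j - 2) 1 = 0) ∨ (ω (j - 2) 0 = 4 * ω (j + 1) 0 - 3 * ω (j + 2) 0 ∧ ω (j - 2) 1 = 0) ∨ (ω (j - 2) 0 = 3 * ω (j + 1) 0 - 2 * ω (j + 2) 0 ∧ ω (j - 2) 1 = -1) := by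
                  have s := hpw_step hωh (a := j - 2) (b := j - 1) (by omega) (by omega); clear * - s xm1 ym1 hX2 hxe; omega
                rcases A with ⟨xm2, ym2⟩ | ⟨xm2, ym2⟩ | ⟨xm2, ym2⟩
                · exact (clash hωh (xm2.trans x0.symm) (ym2.trans y0.symm) (by omega) (by omega) (by omega)).elim
                · have A : (ω (j - 3) 0 = 3 * ω (j + 1) 0 - 2 * ω (j + 2) 0 ∧ ω (j - 3) 1 = 0) ∨ (ω (j - 3) 0 = 5 * ω (j + 1) 0 - 4 * ω (j + 2) 0 ∧ ω (j - 3) 1 = 0) := by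
                    have s := hpw_step hωh (a := j - 3) (b := j - 2) (by omega) (by omega); clear * - s xm2 ym2 hX2 hxe; omega
                  rcases A with ⟨xm3, ym3⟩ | ⟨xm3, ym3⟩
                  · exact (clash hωh (xm3.trans xm1.symm) (ym3.trans ym1.symm) (by omega) (by omega) (by omega)).elim
                  · exact (clash hωh (xm3.trans x13.symm) (ym3.trans y13.symm) (by omega) (by omega) (by omega)).elim
                · exact (clash hωh (xm2.trans x10.symm) (ym2.trans y10.symm) (by omega) (by omega) (by omega)).elim
            · have hcl := climb_le_even (hpw_subset hωh) (t := j + 12) (s := 2) (by omega) (by omega)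
              rw [show j + 12 + 2 = j + 14 by omega] at hcl; clear * - hcl hend y12; exfalso; omega
          · exact (clash hωh (x11.trans xm1.symm) (y11.trans ym1.symm) (by omega) (by omega) (by omega)).elim
      · have A : (ω (j - 1) 0 = ω (j + 2) 0 ∧ ω (j - 1) 1 = -1) ∨ (ω (j - 1) 0 = 2 * ω (j + 1) 0 - ω (j + 2) 0 ∧ ω (j - 1) 1 = -1) ∨ (ω (j - 1) 0 = ω (j + 1) 0 ∧ ω (j - 1) 1 = 0) := by
          have s := hpw_step hωh (a := j - 1) (b := j) (by omega) (by omega); clear * - s x0 y0 hX2 hxe; omega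
        rcases A with ⟨xm1, ym1⟩ | ⟨xm1, ym1⟩ | ⟨xm1, ym1⟩
        · exact (clash hωh (xm1.trans x5.symm) (ym1.trans y5.symm) (by omega) (by omega) (by omega)).elim
        · exact (clash hωh (xm1.trans x9.symm) (ym1.trans y9.symm) (by omega) (by omega) (by omega)).elim
        · exact (clash hωh xm1 (ym1.trans hY1.symm) (by omega) (by omega) (by omega)).elim
    · exact (clash hωh (x10.trans x8.symm) (y10.trans y8.symm) (by omega) (by omega) (by omega)).elim

set_option maxHeartbeats 400000 in
/-- Case analysis of the twelve-fibre under seven-step extendability (generated; 29 steps): branch excursion prefix ⟨(1, 0), (1, -1), (0, -1)⟩. [cite: EntingJensen2009, §7.4.2, Fig. 7.10 (brickwork form of the honeycomb lattice); HammersleyTorrieWhittington1982, §2] -/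
theorem twelve_c6 {j : ℕ} (hj : 5 ≤ j) (hωh : ω ∈ hpw (j + 14)) (hend : ω (j + 14) 1 = 0) (hkY : ω (j + 2) 1 = 0)
    (hno : ∀ i, j + 2 < i → i ≤ j + 12 → ¬ (i % 2 = 0 ∧ ω i 1 = 0)) (hE : ExtK k (j + 14) ω) (hk : 7 ≤ k)
    (hX2 : ω (j + 2) 0 = ω (j + 1) 0 + 1 ∨ ω (j + 1) 0 = ω (j + 2) 0 + 1) (hY1 : ω (j + 1) 1 = 0) (hxe : ω (j + 2) 0 % 2 = 0) (hj2 : j % 2 = 0)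
    (h3 : ω (j + 3) 0 = 2 * ω (j + 2) 0 - ω (j + 1) 0 ∧ ω (j + 3) 1 = 0) (h4 : ω (j + 4) 0 = 2 * ω (j + 2) 0 - ω (j + 1) 0 ∧ ω (j + 4) 1 = -1)
    (h5 : ω (j + 5) 0 = ω (j + 2) 0 ∧ ω (j + 5) 1 = -1)
    : ∃ s : Fin 9, ∀ i ≤ 12, ω (j + 2 + i) 0 = ω (j + 2) 0 + Twelve.TX s i * (ω (j + 2) 0 - ω (j + 1) 0) ∧ ω (j + 2 + i) 1 = Twelve.TY s i := by
  obtain ⟨x3, y3⟩ := h3; obtain ⟨x4, y4⟩ := h4; obtain ⟨x5, y5⟩ := h5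
  have A : (ω (j + 6) 0 = 2 * ω (j + 2) 0 - ω (j + 1) 0 ∧ ω (j + 6) 1 = -1) ∨ (ω (j + 6) 0 = ω (j + 1) 0 ∧ ω (j + 6) 1 = -1) ∨ (ω (j + 6) 0 = ω (j + 2) 0 ∧ ω (j + 6) 1 = -2) := by
    have s := hpw_step hωh (a := j + 5) (b := j + 6) (by omega) (by omega); clear * - s x5 y5 hX2 hxe; omega
  rcases A with ⟨x6, y6⟩ | ⟨x6, y6⟩ | ⟨x6, y6⟩
  · exact (clash hωh (x6.trans x4.symm) (y6.trans y4.symm) (by omega) (by omega) (by omega)).elim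
  · have A : (ω (j + 7) 0 = ω (j + 2) 0 ∧ ω (j + 7) 1 = -1) ∨ (ω (j + 7) 0 = 2 * ω (j + 1) 0 - ω (j + 2) 0 ∧ ω (j + 7) 1 = -1) ∨ (ω (j + 7) 0 = ω (j + 1) 0 ∧ ω (j + 7) 1 = 0) := by
      have s := hpw_step hωh (a := j + 6) (b := j + 7) (by omega) (by omega); clear * - s x6 y6 hX2 hxe; omega
    rcases A with ⟨x7, y7⟩ | ⟨x7, y7⟩ | ⟨x7, y7⟩
    · exact (clash hωh (x7.trans x5.symm) (y7.trans y5.symm) (by omega) (by omega) (by omega)).elim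
    · have A : (ω j 0 = ω (j + 2) 0 ∧ ω j 1 = 0) ∨ (ω j 0 = 2 * ω (j + 1) 0 - ω (j + 2) 0 ∧ ω j 1 = 0) ∨ (ω j 0 = ω (j + 1) 0 ∧ ω j 1 = -1) := by
        have s := hpw_step hωh (a := j) (b := j + 1) (by omega) (by omega); clear * - s hY1 hX2 hxe; omega
      rcases A with ⟨x0, y0⟩ | ⟨x0, y0⟩ | ⟨x0, y0⟩
      · exact (clash hωh x0 (y0.trans hkY.symm) (by omega) (by omega) (by omega)).elim
      · have A : (ω (j - 1) 0 = ω (j + 1) 0 ∧ ω (j - 1) 1 = 0) ∨ (ω (j - 1) 0 = 3 * ω (j + 1) 0 - 2 * ω (j + 2) 0 ∧ ω (j - 1) 1 = 0) := by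
          have s := hpw_step hωh (a := j - 1) (b := j) (by omega) (by omega); clear * - s x0 y0 hX2 hxe; omega
        rcases A with ⟨xm1, ym1⟩ | ⟨xm1, ym1⟩
        · exact (clash hωh xm1 (ym1.trans hY1.symm) (by omega) (by omega) (by omega)).elim
        · have A : (ω (j + 8) 0 = ω (j + 1) 0 ∧ ω (j + 8) 1 = -1) ∨ (ω (j + 8) 0 = 3 * ω (j + 1) 0 - 2 * ω (j + 2) 0 ∧ ω (j + 8) 1 = -1) ∨ (ω (j + 8) 0 = 2 * ω (j + 1) 0 - ω (j + 2) 0 ∧ ω (j + 8) 1 = -2) := by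
            have s := hpw_step hωh (a := j + 7) (b := j + 8) (by omega) (by omega); clear * - s x7 y7 hX2 hxe; omega
          rcases A with ⟨x8, y8⟩ | ⟨x8, y8⟩ | ⟨x8, y8⟩
          · exact (clash hωh (x8.trans x6.symm) (y8.trans y6.symm) (by omega) (by omega) (by omega)).elim
          · have A : (ω (j + 9) 0 = 2 * ω (j + 1) 0 - ω (j + 2) 0 ∧ ω (j + 9) 1 = -1) ∨ (ω (j + 9) 0 = 4 * ω (j + 1) 0 - 3 * ω (j + 2) 0 ∧ ω (j + 9) 1 = -1) ∨ (ω (j + 9) 0 = 3 * ω (j + 1) 0 - 2 * ω (j + 2) 0 ∧ ω (j + 9) 1 = 0) := by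
              have s := hpw_step hωh (a := j + 8) (b := j + 9) (by omega) (by omega); clear * - s x8 y8 hX2 hxe; omega
            rcases A with ⟨x9, y9⟩ | ⟨x9, y9⟩ | ⟨x9, y9⟩
            · exact (clash hωh (x9.trans x7.symm) (y9.trans y7.symm) (by omega) (by omega) (by omega)).elim
            · have A : (ω (j + 10) 0 = 3 * ω (j + 1) 0 - 2 * ω (j + 2) 0 ∧ ω (j + 10) 1 = -1) ∨ (ω (j + 10) 0 = 5 * ω (j + 1) 0 - 4 * ω (j + 2) 0 ∧ ω (j + 10) 1 = -1) ∨ (ω (j + 10) 0 = 4 * ω (j + 1) 0 - 3 * ω (j + 2) 0 ∧ ω (j + 10) 1 = -2) := by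
                have s := hpw_step hωh (a := j + 9) (b := j + 10) (by omega) (by omega); clear * - s x9 y9 hX2 hxe; omega
              rcases A with ⟨x10, y10⟩ | ⟨x10, y10⟩ | ⟨x10, y10⟩
              · exact (clash hωh (x10.trans x8.symm) (y10.trans y8.symm) (by omega) (by omega) (by omega)).elim
              · have A : (ω (j - 2) 0 = 2 * ω (j + 1) 0 - ω (j + 2) 0 ∧ ω (j - 2) 1 = 0) ∨ (ω (j - 2) 0 = 4 * ω (j + 1) 0 - 3 * ω (j + 2) 0 ∧ ω (j - 2) 1 = 0) ∨ (ω (j - 2) 0 = 3 * ω (j + 1) 0 - 2 * ω (j + 2) 0 ∧ ω (j - 2) 1 = -1) := by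
                  have s := hpw_step hωh (a := j - 2) (b := j - 1) (by omega) (by omega); clear * - s xm1 ym1 hX2 hxe; omega
                rcases A with ⟨xm2, ym2⟩ | ⟨xm2, ym2⟩ | ⟨xm2, ym2⟩
                · exact (clash hωh (xm2.trans x0.symm) (ym2.trans y0.symm) (by omega) (by omega) (by omega)).elim
                · have A : (ω (j - 3) 0 = 3 * ω (j + 1) 0 - 2 * ω (j + 2) 0 ∧ ω (j - 3) 1 = 0) ∨ (ω (j - 3) 0 = 5 * ω (j + 1) 0 - 4 * ω (j + 2) 0 ∧ ω (j - 3) 1 = 0) := by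
                    have s := hpw_step hωh (a := j - 3) (b := j - 2) (by omega) (by omega); clear * - s xm2 ym2 hX2 hxe; omega
                  rcases A with ⟨xm3, ym3⟩ | ⟨xm3, ym3⟩
                  · exact (clash hωh (xm3.trans xm1.symm) (ym3.trans ym1.symm) (by omega) (by omega) (by omega)).elim
                  · have A : (ω (j + 11) 0 = 4 * ω (j + 1) 0 - 3 * ω (j + 2) 0 ∧ ω (j + 11) 1 = -1) ∨ (ω (j + 11) 0 = 6 * ω (j + 1) 0 - 5 * ω (j + 2) 0 ∧ ω (j + 11) 1 = -1) ∨ (ω (j + 11) 0 = 5 * ω (j + 1) 0 - 4 * ω (j + 2) 0 ∧ ω (j + 11) 1 = 0) := by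
                      have s := hpw_step hωh (a := j + 10) (b := j + 11) (by omega) (by omega); clear * - s x10 y10 hX2 hxe; omega
                    rcases A with ⟨x11, y11⟩ | ⟨x11, y11⟩ | ⟨x11, y11⟩
                    · exact (clash hωh (x11.trans x9.symm) (y11.trans y9.symm) (by omega) (by omega) (by omega)).elim
                    · have A : (ω (j + 12) 0 = 5 * ω (j + 1) 0 - 4 * ω (j + 2) 0 ∧ ω (j + 12) 1 = -1) ∨ (ω (j + 12) 0 = 7 * ω (j + 1) 0 - 6 * ω (j + 2) 0 ∧ ω (j + 12) 1 = -1) ∨ (ω (j + 12) 0 = 6 * ω (j + 1) 0 - 5 * ω (j + 2) 0 ∧ ω (j + 12) 1 = -2) := by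
                        have s := hpw_step hωh (a := j + 11) (b := j + 12) (by omega) (by omega); clear * - s x11 y11 hX2 hxe; omega
                      rcases A with ⟨x12, y12⟩ | ⟨x12, y12⟩ | ⟨x12, y12⟩
                      · exact (clash hωh (x12.trans x10.symm) (y12.trans y10.symm) (by omega) (by omega) (by omega)).elim
                      · have A : (ω (j + 13) 0 = 6 * ω (j + 1) 0 - 5 * ω (j + 2) 0 ∧ ω (j + 13) 1 = -1) ∨ (ω (j + 13) 0 = 8 * ω (j + 1) 0 - 7 * ω (j + 2) 0 ∧ ω (j + 13) 1 = -1) ∨ (ω (j + 13) 0 = 7 * ω (j + 1) 0 - 6 * ω (j + 2) 0 ∧ ω (j + 13) 1 = 0) := by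
                          have s := hpw_step hωh (a := j + 12) (b := j + 13) (by omega) (by omega); clear * - s x12 y12 hX2 hxe; omega
                        rcases A with ⟨x13, y13⟩ | ⟨x13, y13⟩ | ⟨x13, y13⟩
                        · exact (clash hωh (x13.trans x11.symm) (y13.trans y11.symm) (by omega) (by omega) (by omega)).elim
                        · have hcl := climb_le_odd (hpw_subset hωh) (t := j + 13) (s := 1) (by omega) (by omega)
                          rw [show j + 13 + 1 = j + 14 by omega] at hcl; clear * - hcl hend y13; exfalso; omega
                        · have A : (ω (j - 4) 0 = 4 * ω (j + 1) 0 - 3 * ω (j + 2) 0 ∧ ω (j - 4) 1 = 0) ∨ (ω (j - 4) 0 = 6 * ω (j + 1) 0 - 5 * ω (j + 2) 0 ∧ ω (j - 4) 1 = 0) ∨ (ω (j - 4) 0 = 5 * ω (j + 1) 0 - 4 * ω (j + 2) 0 ∧ ω (j - 4) 1 = -1) := by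
                            have s := hpw_step hωh (a := j - 4) (b := j - 3) (by omega) (by omega); clear * - s xm3 ym3 hX2 hxe; omega
                          rcases A with ⟨xm4, ym4⟩ | ⟨xm4, ym4⟩ | ⟨xm4, ym4⟩
                          · exact (clash hωh (xm4.trans xm2.symm) (ym4.trans ym2.symm) (by omega) (by omega) (by omega)).elim
                          · have A : (ω (j - 5) 0 = 5 * ω (j + 1) 0 - 4 * ω (j + 2) 0 ∧ ω (j - 5) 1 = 0) ∨ (ω (j - 5) 0 = 7 * ω (j + 1) 0 - 6 * ω (j + 2) 0 ∧ ω (j - 5) 1 = 0) := by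
                              have s := hpw_step hωh (a := j - 5) (b := j - 4) (by omega) (by omega); clear * - s xm4 ym4 hX2 hxe; omega
                            rcases A with ⟨xm5, ym5⟩ | ⟨xm5, ym5⟩
                            · exact (clash hωh (xm5.trans xm3.symm) (ym5.trans ym3.symm) (by omega) (by omega) (by omega)).elim
                            · exact (clash hωh (xm5.trans x13.symm) (ym5.trans y13.symm) (by omega) (by omega) (by omega)).elim
                          · exact (clash hωh (xm4.trans x10.symm) (ym4.trans y10.symm) (by omega) (by omega) (by omega)).elim
                      · have hcl := climb_le_even (hpw_subset hωh) (t := j + 12) (s := 2) (by omega) (by omega)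
                        rw [show j + 12 + 2 = j + 14 by omega] at hcl; clear * - hcl hend y12; exfalso; omega
                    · exact (clash hωh (x11.trans xm3.symm) (y11.trans ym3.symm) (by omega) (by omega) (by omega)).elim
                · exact (clash hωh (xm2.trans x8.symm) (ym2.trans y8.symm) (by omega) (by omega) (by omega)).elim
              · have A : (ω (j + 11) 0 = 3 * ω (j + 1) 0 - 2 * ω (j + 2) 0 ∧ ω (j + 11) 1 = -2) ∨ (ω (j + 11) 0 = 5 * ω (j + 1) 0 - 4 * ω (j + 2) 0 ∧ ω (j + 11) 1 = -2) ∨ (ω (j + 11) 0 = 4 * ω (j + 1) 0 - 3 * ω (j + 2) 0 ∧ ω (j + 11) 1 = -1) := by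
                  have s := hpw_step hωh (a := j + 10) (b := j + 11) (by omega) (by omega); clear * - s x10 y10 hX2 hxe; omega
                rcases A with ⟨x11, y11⟩ | ⟨x11, y11⟩ | ⟨x11, y11⟩
                · have hcl := climb_le_odd (hpw_subset hωh) (t := j + 11) (s := 3) (by omega) (by omega)
                  rw [show j + 11 + 3 = j + 14 by omega] at hcl; clear * - hcl hend y11; exfalso; omega
                · have hcl := climb_le_odd (hpw_subset hωh) (t := j + 11) (s := 3) (by omega) (by omega)
                  rw [show j + 11 + 3 = j + 14 by omega] at hcl; clear * - hcl hend y11; exfalso; omega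
                · exact (clash hωh (x11.trans x9.symm) (y11.trans y9.symm) (by omega) (by omega) (by omega)).elim
            · exact (clash hωh (x9.trans xm1.symm) (y9.trans ym1.symm) (by omega) (by omega) (by omega)).elim
          · have A : (ω (j + 9) 0 = ω (j + 1) 0 ∧ ω (j + 9) 1 = -2) ∨ (ω (j + 9) 0 = 3 * ω (j + 1) 0 - 2 * ω (j + 2) 0 ∧ ω (j + 9) 1 = -2) ∨ (ω (j + 9) 0 = 2 * ω (j + 1) 0 - ω (j + 2) 0 ∧ ω (j + 9) 1 = -1) := by
              have s := hpw_step hωh (a := j + 8) (b := j + 9) (by omega) (by omega); clear * - s x8 y8 hX2 hxe; omega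
            rcases A with ⟨x9, y9⟩ | ⟨x9, y9⟩ | ⟨x9, y9⟩
            · have A : (ω (j + 10) 0 = ω (j + 2) 0 ∧ ω (j + 10) 1 = -2) ∨ (ω (j + 10) 0 = 2 * ω (j + 1) 0 - ω (j + 2) 0 ∧ ω (j + 10) 1 = -2) ∨ (ω (j + 10) 0 = ω (j + 1) 0 ∧ ω (j + 10) 1 = -3) := by
                have s := hpw_step hωh (a := j + 9) (b := j + 10) (by omega) (by omega); clear * - s x9 y9 hX2 hxe; omega
              rcases A with ⟨x10, y10⟩ | ⟨x10, y10⟩ | ⟨x10, y10⟩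
              · have A : (ω (j + 11) 0 = 2 * ω (j + 2) 0 - ω (j + 1) 0 ∧ ω (j + 11) 1 = -2) ∨ (ω (j + 11) 0 = ω (j + 1) 0 ∧ ω (j + 11) 1 = -2) ∨ (ω (j + 11) 0 = ω (j + 2) 0 ∧ ω (j + 11) 1 = -1) := by
                  have s := hpw_step hωh (a := j + 10) (b := j + 11) (by omega) (by omega); clear * - s x10 y10 hX2 hxe; omega
                rcases A with ⟨x11, y11⟩ | ⟨x11, y11⟩ | ⟨x11, y11⟩
                · have hcl := climb_le_odd (hpw_subset hωh) (t := j + 11) (s := 3) (by omega) (by omega)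
                  rw [show j + 11 + 3 = j + 14 by omega] at hcl; clear * - hcl hend y11; exfalso; omega
                · exact (clash hωh (x11.trans x9.symm) (y11.trans y9.symm) (by omega) (by omega) (by omega)).elim
                · exact (clash hωh (x11.trans x5.symm) (y11.trans y5.symm) (by omega) (by omega) (by omega)).elim
              · exact (clash hωh (x10.trans x8.symm) (y10.trans y8.symm) (by omega) (by omega) (by omega)).elim
              · have hcl := climb_le_even (hpw_subset hωh) (t := j + 10) (s := 4) (by omega) (by omega)
                rw [show j + 10 + 4 = j + 14 by omega] at hcl; clear * - hcl hend y10; exfalso; omega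
            · have A : (ω (j + 10) 0 = 2 * ω (j + 1) 0 - ω (j + 2) 0 ∧ ω (j + 10) 1 = -2) ∨ (ω (j + 10) 0 = 4 * ω (j + 1) 0 - 3 * ω (j + 2) 0 ∧ ω (j + 10) 1 = -2) ∨ (ω (j + 10) 0 = 3 * ω (j + 1) 0 - 2 * ω (j + 2) 0 ∧ ω (j + 10) 1 = -3) := by
                have s := hpw_step hωh (a := j + 9) (b := j + 10) (by omega) (by omega); clear * - s x9 y9 hX2 hxe; omega
              rcases A with ⟨x10, y10⟩ | ⟨x10, y10⟩ | ⟨x10, y10⟩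
              · exact (clash hωh (x10.trans x8.symm) (y10.trans y8.symm) (by omega) (by omega) (by omega)).elim
              · have A : (ω (j + 11) 0 = 3 * ω (j + 1) 0 - 2 * ω (j + 2) 0 ∧ ω (j + 11) 1 = -2) ∨ (ω (j + 11) 0 = 5 * ω (j + 1) 0 - 4 * ω (j + 2) 0 ∧ ω (j + 11) 1 = -2) ∨ (ω (j + 11) 0 = 4 * ω (j + 1) 0 - 3 * ω (j + 2) 0 ∧ ω (j + 11) 1 = -1) := by
                  have s := hpw_step hωh (a := j + 10) (b := j + 11) (by omega) (by omega); clear * - s x10 y10 hX2 hxe; omega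
                rcases A with ⟨x11, y11⟩ | ⟨x11, y11⟩ | ⟨x11, y11⟩
                · exact (clash hωh (x11.trans x9.symm) (y11.trans y9.symm) (by omega) (by omega) (by omega)).elim
                · have hcl := climb_le_odd (hpw_subset hωh) (t := j + 11) (s := 3) (by omega) (by omega)
                  rw [show j + 11 + 3 = j + 14 by omega] at hcl; clear * - hcl hend y11; exfalso; omega
                · have A : (ω (j + 12) 0 = 3 * ω (j + 1) 0 - 2 * ω (j + 2) 0 ∧ ω (j + 12) 1 = -1) ∨ (ω (j + 12) 0 = 5 * ω (j + 1) 0 - 4 * ω (j + 2) 0 ∧ ω (j + 12) 1 = -1) ∨ (ω (j + 12) 0 = 4 * ω (j + 1) 0 - 3 * ω (j + 2) 0 ∧ ω (j + 12) 1 = -2) := by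
                    have s := hpw_step hωh (a := j + 11) (b := j + 12) (by omega) (by omega); clear * - s x11 y11 hX2 hxe; omega
                  rcases A with ⟨x12, y12⟩ | ⟨x12, y12⟩ | ⟨x12, y12⟩
                  · have A : (ω (j + 13) 0 = 2 * ω (j + 1) 0 - ω (j + 2) 0 ∧ ω (j + 13) 1 = -1) ∨ (ω (j + 13) 0 = 4 * ω (j + 1) 0 - 3 * ω (j + 2) 0 ∧ ω (j + 13) 1 = -1) ∨ (ω (j + 13) 0 = 3 * ω (j + 1) 0 - 2 * ω (j + 2) 0 ∧ ω (j + 13) 1 = 0) := by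
                      have s := hpw_step hωh (a := j + 12) (b := j + 13) (by omega) (by omega); clear * - s x12 y12 hX2 hxe; omega
                    rcases A with ⟨x13, y13⟩ | ⟨x13, y13⟩ | ⟨x13, y13⟩
                    · exact (clash hωh (x13.trans x7.symm) (y13.trans y7.symm) (by omega) (by omega) (by omega)).elim
                    · exact (clash hωh (x13.trans x11.symm) (y13.trans y11.symm) (by omega) (by omega) (by omega)).elim
                    · exact (clash hωh (x13.trans xm1.symm) (y13.trans ym1.symm) (by omega) (by omega) (by omega)).elim
                  · have A : (ω (j + 13) 0 = 4 * ω (j + 1) 0 - 3 * ω (j + 2) 0 ∧ ω (j + 13) 1 = -1) ∨ (ω (j + 13) 0 = 6 * ω (j + 1) 0 - 5 * ω (j + 2) 0 ∧ ω (j + 13) 1 = -1) ∨ (ω (j + 13) 0 = 5 * ω (j + 1) 0 - 4 * ω (j + 2) 0 ∧ ω (j + 13) 1 = 0) := by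
                      have s := hpw_step hωh (a := j + 12) (b := j + 13) (by omega) (by omega); clear * - s x12 y12 hX2 hxe; omega
                    rcases A with ⟨x13, y13⟩ | ⟨x13, y13⟩ | ⟨x13, y13⟩
                    · exact (clash hωh (x13.trans x11.symm) (y13.trans y11.symm) (by omega) (by omega) (by omega)).elim
                    · have hcl := climb_le_odd (hpw_subset hωh) (t := j + 13) (s := 1) (by omega) (by omega)
                      rw [show j + 13 + 1 = j + 14 by omega] at hcl; clear * - hcl hend y13; exfalso; omega
                    · have A : (ω (j - 2) 0 = 2 * ω (j + 1) 0 - ω (j + 2) 0 ∧ ω (j - 2) 1 = 0) ∨ (ω (j - 2) 0 = 4 * ω (j + 1) 0 - 3 * ω (j + 2) 0 ∧ ω (j - 2) 1 = 0) ∨ (ω (j - 2) 0 = 3 * ω (j + 1) 0 - 2 * ω (j + 2) 0 ∧ ω (j - 2) 1 = -1) := by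
                        have s := hpw_step hωh (a := j - 2) (b := j - 1) (by omega) (by omega); clear * - s xm1 ym1 hX2 hxe; omega
                      rcases A with ⟨xm2, ym2⟩ | ⟨xm2, ym2⟩ | ⟨xm2, ym2⟩
                      · exact (clash hωh (xm2.trans x0.symm) (ym2.trans y0.symm) (by omega) (by omega) (by omega)).elim
                      · have A : (ω (j - 3) 0 = 3 * ω (j + 1) 0 - 2 * ω (j + 2) 0 ∧ ω (j - 3) 1 = 0) ∨ (ω (j - 3) 0 = 5 * ω (j + 1) 0 - 4 * ω (j + 2) 0 ∧ ω (j - 3) 1 = 0) := by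
                          have s := hpw_step hωh (a := j - 3) (b := j - 2) (by omega) (by omega); clear * - s xm2 ym2 hX2 hxe; omega
                        rcases A with ⟨xm3, ym3⟩ | ⟨xm3, ym3⟩
                        · exact (clash hωh (xm3.trans xm1.symm) (ym3.trans ym1.symm) (by omega) (by omega) (by omega)).elim
                        · exact (clash hωh (xm3.trans x13.symm) (ym3.trans y13.symm) (by omega) (by omega) (by omega)).elim
                      · have A : (ω (j - 3) 0 = 2 * ω (j + 1) 0 - ω (j + 2) 0 ∧ ω (j - 3) 1 = -1) ∨ (ω (j - 3) 0 = 4 * ω (j + 1) 0 - 3 * ω (j + 2) 0 ∧ ω (j - 3) 1 = -1) ∨ (ω (j - 3) 0 = 3 * ω (j + 1) 0 - 2 * ω (j + 2) 0 ∧ ω (j - 3) 1 = 0) := by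
                          have s := hpw_step hωh (a := j - 3) (b := j - 2) (by omega) (by omega); clear * - s xm2 ym2 hX2 hxe; omega
                        rcases A with ⟨xm3, ym3⟩ | ⟨xm3, ym3⟩ | ⟨xm3, ym3⟩
                        · exact (clash hωh (xm3.trans x7.symm) (ym3.trans y7.symm) (by omega) (by omega) (by omega)).elim
                        · exact (clash hωh (xm3.trans x11.symm) (ym3.trans y11.symm) (by omega) (by omega) (by omega)).elim
                        · exact (clash hωh (xm3.trans xm1.symm) (ym3.trans ym1.symm) (by omega) (by omega) (by omega)).elim
                  · exact (clash hωh (x12.trans x10.symm) (y12.trans y10.symm) (by omega) (by omega) (by omega)).elim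
              · have hcl := climb_le_even (hpw_subset hωh) (t := j + 10) (s := 4) (by omega) (by omega)
                rw [show j + 10 + 4 = j + 14 by omega] at hcl; clear * - hcl hend y10; exfalso; omega
            · exact (clash hωh (x9.trans x7.symm) (y9.trans y7.symm) (by omega) (by omega) (by omega)).elim
      · exact (clash hωh (x0.trans x6.symm) (y0.trans y6.symm) (by omega) (by omega) (by omega)).elim
    · exact (clash hωh x7 (y7.trans hY1.symm) (by omega) (by omega) (by omega)).elim
  · have A : (ω (j + 7) 0 = 2 * ω (j + 2) 0 - ω (j + 1) 0 ∧ ω (j + 7) 1 = -2) ∨ (ω (j + 7) 0 = ω (j + 1) 0 ∧ ω (j + 7) 1 = -2) ∨ (ω (j + 7) 0 = ω (j + 2) 0 ∧ ω (j + 7) 1 = -1) := by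
      have s := hpw_step hωh (a := j + 6) (b := j + 7) (by omega) (by omega); clear * - s x6 y6 hX2 hxe; omega
    rcases A with ⟨x7, y7⟩ | ⟨x7, y7⟩ | ⟨x7, y7⟩
    · exact twelve_c4 hωh hend hkY hno hE hk hX2 hxe hj2 ⟨x3, y3⟩ ⟨x4, y4⟩ ⟨x5, y5⟩ ⟨x6, y6⟩ ⟨x7, y7⟩
    · have A : (ω (j + 8) 0 = ω (j + 2) 0 ∧ ω (j + 8) 1 = -2) ∨ (ω (j + 8) 0 = 2 * ω (j + 1) 0 - ω (j + 2) 0 ∧ ω (j + 8) 1 = -2) ∨ (ω (j + 8) 0 = ω (j + 1) 0 ∧ ω (j + 8) 1 = -3) := by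
        have s := hpw_step hωh (a := j + 7) (b := j + 8) (by omega) (by omega); clear * - s x7 y7 hX2 hxe; omega
      rcases A with ⟨x8, y8⟩ | ⟨x8, y8⟩ | ⟨x8, y8⟩
      · exact (clash hωh (x8.trans x6.symm) (y8.trans y6.symm) (by omega) (by omega) (by omega)).elim
      · exact twelve_c5 hj hωh hend hkY hX2 hY1 hxe hj2 ⟨x5, y5⟩ ⟨x7, y7⟩ ⟨x8, y8⟩
      · have A : (ω (j + 9) 0 = ω (j + 2) 0 ∧ ω (j + 9) 1 = -3) ∨ (ω (j + 9) 0 = 2 * ω (j + 1) 0 - ω (j + 2) 0 ∧ ω (j + 9) 1 = -3) ∨ (ω (j + 9) 0 = ω (j + 1) 0 ∧ ω (j + 9) 1 = -2) := by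
          have s := hpw_step hωh (a := j + 8) (b := j + 9) (by omega) (by omega); clear * - s x8 y8 hX2 hxe; omega
        rcases A with ⟨x9, y9⟩ | ⟨x9, y9⟩ | ⟨x9, y9⟩
        · have hcl := climb_le_odd (hpw_subset hωh) (t := j + 9) (s := 5) (by omega) (by omega)
          rw [show j + 9 + 5 = j + 14 by omega] at hcl; clear * - hcl hend y9; exfalso; omega
        · have hcl := climb_le_odd (hpw_subset hωh) (t := j + 9) (s := 5) (by omega) (by omega)
          rw [show j + 9 + 5 = j + 14 by omega] at hcl; clear * - hcl hend y9; exfalso; omega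
        · exact (clash hωh (x9.trans x7.symm) (y9.trans y7.symm) (by omega) (by omega) (by omega)).elim
    · exact (clash hωh (x7.trans x5.symm) (y7.trans y5.symm) (by omega) (by omega) (by omega)).elim

/-- ★★ Case analysis of the twelve-fibre under seven-step extendability (generated; 6 steps): the nine admissible excursions. [cite: EntingJensen2009, §7.4.2, Fig. 7.10 (brickwork form of the honeycomb lattice); HammersleyTorrieWhittington1982, §2] -/
theorem twelve_main_gen {j : ℕ} (hj : 5 ≤ j) (hωh : ω ∈ hpw (j + 14)) (hend : ω (j + 14) 1 = 0) (hkY : ω (j + 2) 1 = 0)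
    (hno : ∀ i, j + 2 < i → i ≤ j + 12 → ¬ (i % 2 = 0 ∧ ω i 1 = 0)) (hE : ExtK k (j + 14) ω) (hk : 7 ≤ k)
    (hX2 : ω (j + 2) 0 = ω (j + 1) 0 + 1 ∨ ω (j + 1) 0 = ω (j + 2) 0 + 1) (hY1 : ω (j + 1) 1 = 0) (hxe : ω (j + 2) 0 % 2 = 0) (hj2 : j % 2 = 0)
    : ∃ s : Fin 9, ∀ i ≤ 12, ω (j + 2 + i) 0 = ω (j + 2) 0 + Twelve.TX s i * (ω (j + 2) 0 - ω (j + 1) 0) ∧ ω (j + 2 + i) 1 = Twelve.TY s i := by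
  have A : (ω (j + 3) 0 = 2 * ω (j + 2) 0 - ω (j + 1) 0 ∧ ω (j + 3) 1 = 0) ∨ (ω (j + 3) 0 = ω (j + 1) 0 ∧ ω (j + 3) 1 = 0) := by
    have s := hpw_step hωh (a := j + 2) (b := j + 3) (by omega) (by omega); clear * - s hkY hX2 hxe; omega
  rcases A with ⟨x3, y3⟩ | ⟨x3, y3⟩
  · have A : (ω (j + 4) 0 = 3 * ω (j + 2) 0 - 2 * ω (j + 1) 0 ∧ ω (j + 4) 1 = 0) ∨ (ω (j + 4) 0 = ω (j + 2) 0 ∧ ω (j + 4) 1 = 0) ∨ (ω (j + 4) 0 = 2 * ω (j + 2) 0 - ω (j + 1) 0 ∧ ω (j + 4) 1 = -1) := by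
      have s := hpw_step hωh (a := j + 3) (b := j + 4) (by omega) (by omega); clear * - s x3 y3 hX2 hxe; omega
    rcases A with ⟨x4, y4⟩ | ⟨x4, y4⟩ | ⟨x4, y4⟩
    · exact (hno (j + 4) (by omega) (by omega) ⟨by omega, y4⟩).elim
    · exact (clash hωh x4 (y4.trans hkY.symm) (by omega) (by omega) (by omega)).elim
    · have A : (ω (j + 5) 0 = 3 * ω (j + 2) 0 - 2 * ω (j + 1) 0 ∧ ω (j + 5) 1 = -1) ∨ (ω (j + 5) 0 = ω (j + 2) 0 ∧ ω (j + 5) 1 = -1) ∨ (ω (j + 5) 0 = 2 * ω (j + 2) 0 - ω (j + 1) 0 ∧ ω (j + 5) 1 = 0) := by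
        have s := hpw_step hωh (a := j + 4) (b := j + 5) (by omega) (by omega); clear * - s x4 y4 hX2 hxe; omega
      rcases A with ⟨x5, y5⟩ | ⟨x5, y5⟩ | ⟨x5, y5⟩
      · have A : (ω (j + 6) 0 = 4 * ω (j + 2) 0 - 3 * ω (j + 1) 0 ∧ ω (j + 6) 1 = -1) ∨ (ω (j + 6) 0 = 2 * ω (j + 2) 0 - ω (j + 1) 0 ∧ ω (j + 6) 1 = -1) ∨ (ω (j + 6) 0 = 3 * ω (j + 2) 0 - 2 * ω (j + 1) 0 ∧ ω (j + 6) 1 = -2) := by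
          have s := hpw_step hωh (a := j + 5) (b := j + 6) (by omega) (by omega); clear * - s x5 y5 hX2 hxe; omega
        rcases A with ⟨x6, y6⟩ | ⟨x6, y6⟩ | ⟨x6, y6⟩
        · have A : (ω (j + 7) 0 = 5 * ω (j + 2) 0 - 4 * ω (j + 1) 0 ∧ ω (j + 7) 1 = -1) ∨ (ω (j + 7) 0 = 3 * ω (j + 2) 0 - 2 * ω (j + 1) 0 ∧ ω (j + 7) 1 = -1) ∨ (ω (j + 7) 0 = 4 * ω (j + 2) 0 - 3 * ω (j + 1) 0 ∧ ω (j + 7) 1 = 0) := by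
            have s := hpw_step hωh (a := j + 6) (b := j + 7) (by omega) (by omega); clear * - s x6 y6 hX2 hxe; omega
          rcases A with ⟨x7, y7⟩ | ⟨x7, y7⟩ | ⟨x7, y7⟩
          · exact twelve_c1 hωh hend hkY hno hE hk hX2 hxe hj2 ⟨x3, y3⟩ ⟨x4, y4⟩ ⟨x5, y5⟩ ⟨x6, y6⟩ ⟨x7, y7⟩
          · exact (clash hωh (x7.trans x5.symm) (y7.trans y5.symm) (by omega) (by omega) (by omega)).elim
          · have A : (ω (j + 8) 0 = 5 * ω (j + 2) 0 - 4 * ω (j + 1) 0 ∧ ω (j + 8) 1 = 0) ∨ (ω (j + 8) 0 = 3 * ω (j + 2) 0 - 2 * ω (j + 1) 0 ∧ ω (j + 8) 1 = 0) ∨ (ω (j + 8) 0 = 4 * ω (j + 2) 0 - 3 * ω (j + 1) 0 ∧ ω (j + 8) 1 = -1) := by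
              have s := hpw_step hωh (a := j + 7) (b := j + 8) (by omega) (by omega); clear * - s x7 y7 hX2 hxe; omega
            rcases A with ⟨x8, y8⟩ | ⟨x8, y8⟩ | ⟨x8, y8⟩
            · exact (hno (j + 8) (by omega) (by omega) ⟨by omega, y8⟩).elim
            · exact (hno (j + 8) (by omega) (by omega) ⟨by omega, y8⟩).elim
            · exact (clash hωh (x8.trans x6.symm) (y8.trans y6.symm) (by omega) (by omega) (by omega)).elim
        · exact (clash hωh (x6.trans x4.symm) (y6.trans y4.symm) (by omega) (by omega) (by omega)).elim
        · exact twelve_c3 hj hωh hend hkY hno hE hk hX2 hY1 hxe hj2 ⟨x3, y3⟩ ⟨x4, y4⟩ ⟨x5, y5⟩ ⟨x6, y6⟩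
      · exact twelve_c6 hj hωh hend hkY hno hE hk hX2 hY1 hxe hj2 ⟨x3, y3⟩ ⟨x4, y4⟩ ⟨x5, y5⟩
      · exact (clash hωh (x5.trans x3.symm) (y5.trans y3.symm) (by omega) (by omega) (by omega)).elim
  · exact (clash hωh x3 (y3.trans hY1.symm) (by omega) (by omega) (by omega)).elim

/-! ### §5  THE TWELVE-FIBRE UNDER SEVEN-STEP EXTENDABILITY -/

/-- ★★★ **THE TWELVE-FIBRE UNDER SEVEN-STEP EXTENDABILITY** (`j ≥ 5`, `k ≥ 7`): an arch of length `j+14` whose last surface visit before the end is at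
time `j+2` and which admits a fresh seven-step continuation ends with one of NINE excursions: the nine one-visit seeds of length twelve of
`HexSAWSurfaceFifthOrderLower` (tables `Twelve.TX s`, `Twelve.TY s`, `s : Fin 9`), read after `x = X_{j+2}` in the direction `σ = X_{j+2} − X_{j+1}`.
[cite: EntingJensen2009, §7.4.2, Fig. 7.10 (brickwork form of the honeycomb lattice); HammersleyTorrieWhittington1982, §2] -/
theorem twelve_coords7 {j : ℕ} (hj : 5 ≤ j) (hω : ω ∈ fibW (j + 10) (j + 2)) (hE : ExtK k (j + 14) ω) (hk : 7 ≤ k) :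
    ∃ s : Fin 9, ∀ i ≤ 12, ω (j + 2 + i) 0 = ω (j + 2) 0 + Twelve.TX s i * (ω (j + 2) 0 - ω (j + 1) 0) ∧ ω (j + 2 + i) 1 = Twelve.TY s i := by
  have hω' : ω ∈ fibW (j + 10) (j + 2) := hω
  obtain ⟨hωh, -, hend, -, hk2, hkY, hno, -⟩ := fibW_anatomy hω'
  rw [show j + 10 + 4 = j + 14 by omega] at hωh hend
  obtain ⟨hωs, -⟩ := mem_hpw.1 hωh
  have hparx : (ω (j + 2) 0 + ω (j + 2) 1) % 2 = ((j + 2 : ℕ) : ℤ) % 2 := parity_apply hωs (i := j + 2) (by omega)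
  have hxe : ω (j + 2) 0 % 2 = 0 := by rw [hkY, add_zero] at hparx; push_cast at hparx; omega
  obtain ⟨hY1, hX2⟩ := surface_prev_step hωh (i := j + 1) (by omega) (by omega) (by rw [show j + 1 + 1 = j + 2 by omega]; exact hkY)
  rw [show j + 1 + 1 = j + 2 by omega] at hX2
  have hno' : ∀ i, j + 2 < i → i ≤ j + 12 → ¬ (i % 2 = 0 ∧ ω i 1 = 0) := fun i h1 h2 => hno i h1 (by omega)
  exact twelve_main_gen hj hωh hend hkY hno' hE hk hX2 hY1 hxe (by omega)

open Classical in
/-- ★★ **The twelve-fibre under `k`-step extendability (`k ≥ 7`) weighs at most `9y · X^{(k)}_{j+2}(y)`** (`j ≥ 5`, `y ≥ 0`): split by the nine shapes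
of `twelve_coords7` and inject each into `archsK k (j+2)` by the prefix map (`sum_shape_le_XK'`).
[cite: HammersleyTorrieWhittington1982, §2; EntingJensen2009, §7.4.2, Fig. 7.10] -/
theorem sum_fibW_twelve_le_XK {j : ℕ} (hj : 5 ≤ j) (hy : 0 ≤ y) (hk : 7 ≤ k) :
    ∑ ω ∈ (fibW (j + 10) (j + 2)).filter (ExtK k (j + 14)), y ^ visits (j + 14) ω ≤ 9 * y * XKw k (j + 2) y := by
  set S := (fibW (j + 10) (j + 2)).filter (ExtK k (j + 14)) with hS
  haveI dec : ∀ s : Fin 9, DecidablePred (fun ω : ℕ → Site 2 => ∀ i ≤ 12,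
      ω (j + 2 + i) 0 = ω (j + 2) 0 + Twelve.TX s i * (ω (j + 2) 0 - ω (j + 1) 0) ∧ ω (j + 2 + i) 1 = Twelve.TY s i) :=
    fun s => Classical.decPred _
  set T : Fin 9 → Finset (ℕ → Site 2) := fun s => S.filter (fun ω => ∀ i ≤ 12,
    ω (j + 2 + i) 0 = ω (j + 2) 0 + Twelve.TX s i * (ω (j + 2) 0 - ω (j + 1) 0) ∧ ω (j + 2 + i) 1 = Twelve.TY s i) with hT
  have hshape : ∀ s, ∑ ω ∈ T s, y ^ visits (j + 14) ω ≤ y * XKw k (j + 2) y := fun s =>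
    sum_shape_le_XK' (c := 10) (k := k) hy (Twelve.TX s) (Twelve.TY s) _ (Finset.filter_subset _ _) fun ω hω => (Finset.mem_filter.1 hω).2
  have hf : ∀ ω : ℕ → Site 2, 0 ≤ y ^ visits (j + 14) ω := fun _ => pow_nonneg hy _
  have hcover : S ⊆ T 0 ∪ T 1 ∪ T 2 ∪ T 3 ∪ T 4 ∪ T 5 ∪ T 6 ∪ T 7 ∪ T 8 := by
    intro ω hω
    obtain ⟨hωf, hE⟩ := Finset.mem_filter.1 hω
    obtain ⟨s, hs⟩ := twelve_coords7 hj hωf hE hk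
    have m : ω ∈ T s := Finset.mem_filter.2 ⟨hω, hs⟩
    fin_cases s
    · exact mem_union_left _ (mem_union_left _ (mem_union_left _ (mem_union_left _ (mem_union_left _ (mem_union_left _
        (mem_union_left _ (mem_union_left _ m)))))))
    · exact mem_union_left _ (mem_union_left _ (mem_union_left _ (mem_union_left _ (mem_union_left _ (mem_union_left _
        (mem_union_left _ (mem_union_right _ m)))))))
    · exact mem_union_left _ (mem_union_left _ (mem_union_left _ (mem_union_left _ (mem_union_left _ (mem_union_left _
        (mem_union_right _ m))))))
    · exact mem_union_left _ (mem_union_left _ (mem_union_left _ (mem_union_left _ (mem_union_left _ (mem_union_right _ m)))))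
    · exact mem_union_left _ (mem_union_left _ (mem_union_left _ (mem_union_left _ (mem_union_right _ m))))
    · exact mem_union_left _ (mem_union_left _ (mem_union_left _ (mem_union_right _ m)))
    · exact mem_union_left _ (mem_union_left _ (mem_union_right _ m))
    · exact mem_union_left _ (mem_union_right _ m)
    · exact mem_union_right _ m
  have u8 := sum_union_le_add' (T 0 ∪ T 1 ∪ T 2 ∪ T 3 ∪ T 4 ∪ T 5 ∪ T 6 ∪ T 7) (T 8) _ hf
  have u7 := sum_union_le_add' (T 0 ∪ T 1 ∪ T 2 ∪ T 3 ∪ T 4 ∪ T 5 ∪ T 6) (T 7) _ hf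
  have u6 := sum_union_le_add' (T 0 ∪ T 1 ∪ T 2 ∪ T 3 ∪ T 4 ∪ T 5) (T 6) _ hf
  have u5 := sum_union_le_add' (T 0 ∪ T 1 ∪ T 2 ∪ T 3 ∪ T 4) (T 5) _ hf
  have u4 := sum_union_le_add' (T 0 ∪ T 1 ∪ T 2 ∪ T 3) (T 4) _ hf
  have u3 := sum_union_le_add' (T 0 ∪ T 1 ∪ T 2) (T 3) _ hf
  have u2 := sum_union_le_add' (T 0 ∪ T 1) (T 2) _ hf
  have u1 := sum_union_le_add' (T 0) (T 1) _ hf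
  have h0 := hshape 0; have h1 := hshape 1; have h2 := hshape 2; have h3 := hshape 3; have h4 := hshape 4
  have h5 := hshape 5; have h6 := hshape 6; have h7 := hshape 7; have h8 := hshape 8
  have hc := Finset.sum_le_sum_of_subset_of_nonneg hcover fun ω _ _ => hf ω
  linarith

/-! ### §6  The recursion for the seven-step-extendable count and the growth bound -/

open Classical in
/-- ★★ **THE RECURSION** (`y ≥ 0`, `j ≥ 5`, arches of length `j+14`):
`X⁷_{j+14} ≤ y X⁷_{j+12} + y X⁷_{j+8} + y X⁷_{j+6} + 4y X⁷_{j+4} + 9y X⁷_{j+2} + 2y Σ_{t ≤ j} X⁷_t c_{j+13−t}(ℍ)` — the straight block, the dip, the flat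
excursion, the four excursions of length ten, the NINE of length twelve, and the excursions of length `≥ 14` bounded by all walks; characteristic equation
`1 = yz + yz³ + yz⁴ + 4yz⁵ + 9yz⁶ + O(yz⁷)` at `z = β⁻²`. [cite: HammersleyTorrieWhittington1982, §2; JansevanRensburg2000, §3.3.2, Lemma 3.20; MadrasSlade1993, §1.2, (1.2.3)] -/
theorem X7w_le_rec {j : ℕ} (hj : 5 ≤ j) (hy : 0 ≤ y) :
    XKw 7 (j + 14) y ≤ y * XKw 7 (j + 12) y + y * XKw 7 (j + 8) y + y * XKw 7 (j + 6) y + 4 * y * XKw 7 (j + 4) y + 9 * y * XKw 7 (j + 2) y +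
      2 * y * ∑ t ∈ range (j + 1), XKw 7 t y * #(saws (j + 13 - t)) := by
  classical
  set T : ℕ → ℝ := fun t => ∑ ω ∈ (archsK 7 (j + 14)).filter (fun ω => lastV (j + 12) ω = t), y ^ visits (j + 14) ω with hT
  have hf : ∀ ω ∈ archsK 7 (j + 14), lastV (j + 12) ω ∈ range (j + 13) :=
    fun ω _ => Finset.mem_range.2 (Nat.lt_succ_of_le (lastV_le _ _))
  have hX : XKw 7 (j + 14) y = ∑ t ∈ range (j + 13), T t := by
    rw [XKw, ← Finset.sum_fiberwise_of_maps_to hf]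
  have hsub : ∀ t, (archsK 7 (j + 14)).filter (fun ω => lastV (j + 12) ω = t) ⊆ (fibW (j + 10) t).filter (ExtK 7 (j + 14)) := by
    intro t ω hω
    obtain ⟨hωX, hl⟩ := Finset.mem_filter.1 hω
    obtain ⟨hωa, hE⟩ := mem_archsK.1 hωX
    refine Finset.mem_filter.2 ⟨Finset.mem_filter.2 ⟨?_, ?_⟩, hE⟩
    · rw [show j + 10 + 4 = j + 14 by omega]; exact hωa
    · rw [show j + 10 + 2 = j + 12 by omega]; exact hl
  have hTle : ∀ t, T t ≤ ∑ ω ∈ fibW (j + 10) t, y ^ visits (j + 14) ω := fun t =>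
    Finset.sum_le_sum_of_subset_of_nonneg ((hsub t).trans (Finset.filter_subset _ _)) fun _ _ _ => pow_nonneg hy _
  have hTle' : ∀ t, T t ≤ ∑ ω ∈ (fibW (j + 10) t).filter (ExtK 7 (j + 14)), y ^ visits (j + 14) ω := fun t =>
    Finset.sum_le_sum_of_subset_of_nonneg (hsub t) fun _ _ _ => pow_nonneg hy _
  have hT0 : ∀ ω : ℕ → Site 2, visits (j + 10 + 4) ω = visits (j + 14) ω := fun ω => by rw [show j + 10 + 4 = j + 14 by omega]
  -- the straight fibre
  have h12 : T (j + 12) ≤ y * XKw 7 (j + 12) y := by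
    refine (hTle' _).trans ?_
    have h := sum_fibW_self_le_XK (k := 7) (j + 10) hy
    rw [show j + 10 + 2 = j + 12 by omega] at h
    simpa only [hT0] using h
  -- empty fibres: odd times and the two near ones
  have hodd : ∀ t, (t + j) % 2 = 1 → T t ≤ 0 := fun t ht => (hTle _).trans (by
    refine (Finset.sum_eq_zero fun ω hω => ?_).le
    obtain ⟨-, hm, -, -, hk0, -⟩ := fibW_anatomy hω
    omega)
  have h11 : T (j + 11) ≤ 0 := hodd _ (by omega)
  have h10 : T (j + 10) ≤ 0 := (hTle _).trans (by
    have h := sum_fibW_eq_zero_of_near (m := j + 10) (k := j + 10) (by omega) (by omega) y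
    simpa only [hT0] using h.le)
  have h9 : T (j + 9) ≤ 0 := hodd _ (by omega)
  have h7 : T (j + 7) ≤ 0 := hodd _ (by omega)
  have h5 : T (j + 5) ≤ 0 := hodd _ (by omega)
  have h3 : T (j + 3) ≤ 0 := hodd _ (by omega)
  have h1 : T (j + 1) ≤ 0 := hodd _ (by omega)
  -- the dip fibre
  have h8 : T (j + 8) ≤ y * XKw 7 (j + 8) y := by
    refine (hTle' _).trans ?_
    have h := sum_fibW_dip_le_XK' (k := 7) (j + 6) hy (by norm_num)
    rw [show j + 6 + 4 = j + 10 by omega, show j + 6 + 2 = j + 8 by omega, show j + 6 + 8 = j + 14 by omega] at h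
    exact h
  -- the flat fibre
  have h6 : T (j + 6) ≤ y * XKw 7 (j + 6) y := by
    refine (hTle' _).trans ?_
    have h := sum_fibW_flat8_le_XK (k := 7) (j := j + 4) (by omega) hy (by norm_num) (by norm_num)
    rw [show j + 4 + 6 = j + 10 by omega, show j + 4 + 2 = j + 6 by omega, show j + 4 + 10 = j + 14 by omega] at h
    exact h
  -- the ten fibre
  have h4 : T (j + 4) ≤ 4 * y * XKw 7 (j + 4) y := by
    refine (hTle' _).trans ?_
    have h := sum_fibW_ten_le_XK (k := 7) (j := j + 2) (by omega) hy (by norm_num)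
    rw [show j + 2 + 8 = j + 10 by omega, show j + 2 + 2 = j + 4 by omega, show j + 2 + 12 = j + 14 by omega] at h
    exact h
  -- the twelve fibre
  have h2 : T (j + 2) ≤ 9 * y * XKw 7 (j + 2) y := (hTle' _).trans (sum_fibW_twelve_le_XK hj hy le_rfl)
  -- the long fibres
  have h0 : ∑ t ∈ range (j + 1), T t ≤ 2 * y * ∑ t ∈ range (j + 1), XKw 7 t y * #(saws (j + 13 - t)) := by
    rw [Finset.mul_sum]
    refine Finset.sum_le_sum fun t ht => (hTle t).trans ?_
    have ht' := Finset.mem_range.1 ht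
    have h := sum_fibW_le_XK (k := 7) (j + 10) hy (t := t) (by omega)
    rw [show j + 10 + 3 - t = j + 13 - t by omega] at h
    simpa only [hT0] using h
  rw [hX, Finset.sum_range_succ, Finset.sum_range_succ, Finset.sum_range_succ, Finset.sum_range_succ, Finset.sum_range_succ,
    Finset.sum_range_succ, Finset.sum_range_succ, Finset.sum_range_succ, Finset.sum_range_succ, Finset.sum_range_succ,
    Finset.sum_range_succ, Finset.sum_range_succ]
  linarith

open Classical in
/-- A priori: `X^{(k)}_n(y) ≤ 3ⁿ yⁿ` for `y ≥ 1`. [cite: MadrasSlade1993, §1.2, (1.2.3)] -/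
theorem XKw_le_three_pow_mul_pow (k n : ℕ) (hy : 1 ≤ y) : XKw k n y ≤ 3 ^ n * y ^ n := by
  have hy0 : 0 ≤ y := by linarith
  have h1 := (XKw_le_Aw k n hy0).trans (Aw_le_card_mul_pow n hy0)
  rw [max_eq_right hy] at h1
  exact h1.trans (mul_le_mul_of_nonneg_right (Arm.card_saws_le_three_pow n) (pow_nonneg hy0 _))

open Classical in
/-- **The growth bound** (`y ≥ 1`): if `ρ ≥ 6` and `y/ρ² + y/ρ⁶ + y/ρ⁸ + 4y/ρ¹⁰ + 9y/ρ¹² + 6377292·y/ρ¹⁴ ≤ 1` then `X⁷_n(y) ≤ 3¹⁹ y¹⁹ · ρⁿ` for every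
`n` (strong induction on `X7w_le_rec` from `n = 20`; `c_m(ℍ) ≤ 3^m`; geometric tail `Σ_{t ≤ j} ρ^t 3^{j+13−t} ≤ 2·3¹³ ρ^j`; `6377292 = 4·3¹³`).
[cite: HammersleyTorrieWhittington1982, §2; MadrasSlade1993, §1.2, Lemma 1.2.2] -/
theorem X7w_le_mul_pow (hy : 1 ≤ y) {ρ : ℝ} (hρ : 6 ≤ ρ)
    (hc : y / ρ ^ 2 + y / ρ ^ 6 + y / ρ ^ 8 + 4 * y / ρ ^ 10 + 9 * y / ρ ^ 12 + 6377292 * y / ρ ^ 14 ≤ 1)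
    (n : ℕ) : XKw 7 n y ≤ 3 ^ 19 * y ^ 19 * ρ ^ n := by
  have hy0 : 0 ≤ y := by linarith
  have hρ1 : 1 ≤ ρ := by linarith
  have hρ0 : 0 < ρ := by linarith
  induction n using Nat.strong_induction_on with
  | _ n ih =>
  rcases Nat.lt_or_ge n 20 with hn | hn
  · have h1 := XKw_le_three_pow_mul_pow 7 n hy
    have h3 : (3 : ℝ) ^ n ≤ 3 ^ 19 := pow_le_pow_right₀ (by norm_num) (by omega)
    have h4 : y ^ n ≤ y ^ 19 := pow_le_pow_right₀ hy (by omega)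
    have h5 : (1 : ℝ) ≤ ρ ^ n := one_le_pow₀ hρ1
    calc XKw 7 n y ≤ 3 ^ n * y ^ n := h1
      _ ≤ 3 ^ 19 * y ^ 19 := mul_le_mul h3 h4 (pow_nonneg hy0 _) (by positivity)
      _ = 3 ^ 19 * y ^ 19 * 1 := (mul_one _).symm
      _ ≤ 3 ^ 19 * y ^ 19 * ρ ^ n := mul_le_mul_of_nonneg_left h5 (by positivity)
  · obtain ⟨j, rfl⟩ : ∃ j, n = j + 14 := ⟨n - 14, by omega⟩
    set M : ℝ := 3 ^ 19 * y ^ 19 with hM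
    have hM0 : 0 ≤ M := by positivity
    have hrec := X7w_le_rec (j := j) (by omega) hy0
    have b12 : XKw 7 (j + 12) y ≤ M * ρ ^ (j + 12) := ih (j + 12) (by omega)
    have b8 : XKw 7 (j + 8) y ≤ M * ρ ^ (j + 8) := ih (j + 8) (by omega)
    have b6 : XKw 7 (j + 6) y ≤ M * ρ ^ (j + 6) := ih (j + 6) (by omega)
    have b4 : XKw 7 (j + 4) y ≤ M * ρ ^ (j + 4) := ih (j + 4) (by omega)
    have b2 : XKw 7 (j + 2) y ≤ M * ρ ^ (j + 2) := ih (j + 2) (by omega)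
    have bS : ∑ t ∈ range (j + 1), XKw 7 t y * (#(saws (j + 13 - t)) : ℝ) ≤ M * (2 * 3 ^ 13 * ρ ^ j) := by
      calc ∑ t ∈ range (j + 1), XKw 7 t y * (#(saws (j + 13 - t)) : ℝ)
          ≤ ∑ t ∈ range (j + 1), M * ρ ^ t * 3 ^ (j + 13 - t) := by
            refine Finset.sum_le_sum fun t ht => ?_
            exact mul_le_mul (ih t (by have := Finset.mem_range.1 ht; omega)) (Arm.card_saws_le_three_pow _)
              (by positivity) (by positivity)
        _ = M * ∑ t ∈ range (j + 1), ρ ^ t * 3 ^ (j + 13 - t) := by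
            rw [Finset.mul_sum]; exact Finset.sum_congr rfl fun t _ => by ring
        _ ≤ M * (2 * 3 ^ 13 * ρ ^ j) := mul_le_mul_of_nonneg_left (Arm.sum_pow_mul_three_pow_le hρ j 13) hM0
    have key : y * ρ ^ (j + 12) + y * ρ ^ (j + 8) + y * ρ ^ (j + 6) + 4 * y * ρ ^ (j + 4) + 9 * y * ρ ^ (j + 2) + 6377292 * y * ρ ^ j ≤
        ρ ^ (j + 14) := by
      have h := mul_le_mul_of_nonneg_right hc (pow_nonneg hρ0.le (j + 14))
      rw [one_mul] at h
      have e : (y / ρ ^ 2 + y / ρ ^ 6 + y / ρ ^ 8 + 4 * y / ρ ^ 10 + 9 * y / ρ ^ 12 + 6377292 * y / ρ ^ 14) * ρ ^ (j + 14) =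
          y * ρ ^ (j + 12) + y * ρ ^ (j + 8) + y * ρ ^ (j + 6) + 4 * y * ρ ^ (j + 4) + 9 * y * ρ ^ (j + 2) + 6377292 * y * ρ ^ j := by
        field_simp
        ring
      linarith
    have c12 := mul_le_mul_of_nonneg_left b12 hy0
    have c8 := mul_le_mul_of_nonneg_left b8 hy0
    have c6 := mul_le_mul_of_nonneg_left b6 hy0
    have c4 : 4 * y * XKw 7 (j + 4) y ≤ 4 * y * (M * ρ ^ (j + 4)) := mul_le_mul_of_nonneg_left b4 (by positivity)
    have c2 : 9 * y * XKw 7 (j + 2) y ≤ 9 * y * (M * ρ ^ (j + 2)) := mul_le_mul_of_nonneg_left b2 (by positivity)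
    have cS : 2 * y * ∑ t ∈ range (j + 1), XKw 7 t y * (#(saws (j + 13 - t)) : ℝ) ≤ 2 * y * (M * (2 * 3 ^ 13 * ρ ^ j)) :=
      mul_le_mul_of_nonneg_left bS (by positivity)
    have key' := mul_le_mul_of_nonneg_left key hM0
    calc XKw 7 (j + 14) y
        ≤ y * XKw 7 (j + 12) y + y * XKw 7 (j + 8) y + y * XKw 7 (j + 6) y + 4 * y * XKw 7 (j + 4) y + 9 * y * XKw 7 (j + 2) y +
            2 * y * ∑ t ∈ range (j + 1), XKw 7 t y * (#(saws (j + 13 - t)) : ℝ) := hrec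
      _ ≤ y * (M * ρ ^ (j + 12)) + y * (M * ρ ^ (j + 8)) + y * (M * ρ ^ (j + 6)) + 4 * y * (M * ρ ^ (j + 4)) + 9 * y * (M * ρ ^ (j + 2)) +
            2 * y * (M * (2 * 3 ^ 13 * ρ ^ j)) := by linarith
      _ = M * (y * ρ ^ (j + 12) + y * ρ ^ (j + 8) + y * ρ ^ (j + 6) + 4 * y * ρ ^ (j + 4) + 9 * y * ρ ^ (j + 2) + 6377292 * y * ρ ^ j) := by
          ring
      _ ≤ M * ρ ^ (j + 14) := key'

/-! ### §7  THE FIFTH-ORDER UPPER WINDOW -/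

/-- The polynomial inequality behind the renewal condition: for `y ≥ 1`,
`5y¹² − 12y¹¹ + 26y¹⁰ − 28y⁹ + 38y⁸ + y⁷ + 24y⁶ + 46y⁵ + 19y⁴ + 41y³ + 20y² + 11y + 8 ≥ 0` (all coefficients in `y − 1` are positive).
[cite: JansevanRensburg2000, §3.3.2, Lemma 3.20] -/
theorem fifth_poly_nonneg (hy : 1 ≤ y) :
    0 ≤ 5 * y ^ 12 - 12 * y ^ 11 + 26 * y ^ 10 - 28 * y ^ 9 + 38 * y ^ 8 + y ^ 7 + 24 * y ^ 6 + 46 * y ^ 5 + 19 * y ^ 4 + 41 * y ^ 3 +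
      20 * y ^ 2 + 11 * y + 8 := by
  obtain ⟨z, hz, rfl⟩ : ∃ z : ℝ, 0 ≤ z ∧ y = z + 1 := ⟨y - 1, by linarith, by ring⟩
  have e : 5 * (z + 1) ^ 12 - 12 * (z + 1) ^ 11 + 26 * (z + 1) ^ 10 - 28 * (z + 1) ^ 9 + 38 * (z + 1) ^ 8 + (z + 1) ^ 7 +
      24 * (z + 1) ^ 6 + 46 * (z + 1) ^ 5 + 19 * (z + 1) ^ 4 + 41 * (z + 1) ^ 3 + 20 * (z + 1) ^ 2 + 11 * (z + 1) + 8 =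
      5 * z ^ 12 + 48 * z ^ 11 + 224 * z ^ 10 + 672 * z ^ 9 + 1451 * z ^ 8 + 2417 * z ^ 7 + 3279 * z ^ 6 + 3779 * z ^ 5 + 3751 * z ^ 4 +
      3108 * z ^ 3 + 1994 * z ^ 2 + 871 * z + 199 := by ring
  rw [e]
  positivity

/-- **The renewal condition at `B = y + 1/y + 1/y² + 2/y³ + 4/y⁴ + 6377300/y⁵`** (`y ≥ 1`):
`y/B + y/B³ + y/B⁴ + 4y/B⁵ + 9y/B⁶ + 6377292·y/B⁷ ≤ 1`.  The two cancellations — in `y/B² = 1/y − 2/y³ − 2/y⁴ + …` and `y/B³ = 1/y² − 3/y⁴ + …` — are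
handled with `B ≥ y + 1/y + 1/y²` and `B ≥ y + 1/y`, everything else with `B ≥ y`; what remains is `fifth_poly_nonneg`.
[cite: JansevanRensburg2000, §3.3.2, Lemma 3.20; MadrasSlade1993, §1.2, Lemma 1.2.2] -/
theorem fifthB_condition (hy : 1 ≤ y) :
    y / (y + 1 / y + 1 / y ^ 2 + 2 / y ^ 3 + 4 / y ^ 4 + 6377300 / y ^ 5) + y / (y + 1 / y + 1 / y ^ 2 + 2 / y ^ 3 + 4 / y ^ 4 + 6377300 / y ^ 5) ^ 3 +
        y / (y + 1 / y + 1 / y ^ 2 + 2 / y ^ 3 + 4 / y ^ 4 + 6377300 / y ^ 5) ^ 4 +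
        4 * y / (y + 1 / y + 1 / y ^ 2 + 2 / y ^ 3 + 4 / y ^ 4 + 6377300 / y ^ 5) ^ 5 +
        9 * y / (y + 1 / y + 1 / y ^ 2 + 2 / y ^ 3 + 4 / y ^ 4 + 6377300 / y ^ 5) ^ 6 +
        6377292 * y / (y + 1 / y + 1 / y ^ 2 + 2 / y ^ 3 + 4 / y ^ 4 + 6377300 / y ^ 5) ^ 7 ≤ 1 := by
  have hy0 : 0 < y := by linarith
  set B : ℝ := y + 1 / y + 1 / y ^ 2 + 2 / y ^ 3 + 4 / y ^ 4 + 6377300 / y ^ 5 with hB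
  set u : ℝ := 1 / y + 1 / y ^ 2 + 2 / y ^ 3 + 4 / y ^ 4 + 6377300 / y ^ 5 with hu
  have hBu : B = y + u := by rw [hB, hu]; ring
  have hp1 : (0 : ℝ) < 1 / y := by positivity
  have hp2 : (0 : ℝ) < 1 / y ^ 2 := by positivity
  have hp3 : (0 : ℝ) ≤ 2 / y ^ 3 := by positivity
  have hp4 : (0 : ℝ) ≤ 4 / y ^ 4 := by positivity
  have hp5 : (0 : ℝ) ≤ 6377300 / y ^ 5 := by positivity
  have hyB : y ≤ B := by rw [hB]; linarith
  have hB1 : y + 1 / y ≤ B := by rw [hB]; linarith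
  have hB2 : y + 1 / y + 1 / y ^ 2 ≤ B := by rw [hB]; linarith
  have hB0 : 0 < B := by linarith
  have t1 : y / B ^ 2 ≤ y ^ 5 / (y ^ 3 + y + 1) ^ 2 := by
    have e : y ^ 5 / (y ^ 3 + y + 1) ^ 2 = y / (y + 1 / y + 1 / y ^ 2) ^ 2 := by field_simp
    rw [e]
    exact div_le_div_of_nonneg_left hy0.le (by positivity) (pow_le_pow_left₀ (by positivity) hB2 2)
  have t2 : y / B ^ 3 ≤ y ^ 4 / (y ^ 2 + 1) ^ 3 := by
    have e : y ^ 4 / (y ^ 2 + 1) ^ 3 = y / (y + 1 / y) ^ 3 := by field_simp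
    rw [e]
    exact div_le_div_of_nonneg_left hy0.le (by positivity) (pow_le_pow_left₀ (by positivity) hB1 3)
  have t3 : 4 * y / B ^ 4 ≤ 4 / y ^ 3 := by
    rw [div_le_div_iff₀ (by positivity) (by positivity)]
    calc 4 * y * y ^ 3 = 4 * y ^ 4 := by ring
      _ ≤ 4 * B ^ 4 := mul_le_mul_of_nonneg_left (pow_le_pow_left₀ hy0.le hyB 4) (by norm_num)
  have t4 : 9 * y / B ^ 5 ≤ 9 / y ^ 4 := by
    rw [div_le_div_iff₀ (by positivity) (by positivity)]
    calc 9 * y * y ^ 4 = 9 * y ^ 5 := by ring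
      _ ≤ 9 * B ^ 5 := mul_le_mul_of_nonneg_left (pow_le_pow_left₀ hy0.le hyB 5) (by norm_num)
  have t5 : 6377292 * y / B ^ 6 ≤ 6377292 / y ^ 5 := by
    rw [div_le_div_iff₀ (by positivity) (by positivity)]
    calc 6377292 * y * y ^ 5 = 6377292 * y ^ 6 := by ring
      _ ≤ 6377292 * B ^ 6 := mul_le_mul_of_nonneg_left (pow_le_pow_left₀ hy0.le hyB 6) (by norm_num)
  have poly : y ^ 5 / (y ^ 3 + y + 1) ^ 2 + y ^ 4 / (y ^ 2 + 1) ^ 3 + 4 / y ^ 3 + 9 / y ^ 4 + 6377292 / y ^ 5 ≤ u := by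
    rw [hu, ← sub_nonneg]
    have e : 1 / y + 1 / y ^ 2 + 2 / y ^ 3 + 4 / y ^ 4 + 6377300 / y ^ 5 -
        (y ^ 5 / (y ^ 3 + y + 1) ^ 2 + y ^ 4 / (y ^ 2 + 1) ^ 3 + 4 / y ^ 3 + 9 / y ^ 4 + 6377292 / y ^ 5) =
        (5 * y ^ 12 - 12 * y ^ 11 + 26 * y ^ 10 - 28 * y ^ 9 + 38 * y ^ 8 + y ^ 7 + 24 * y ^ 6 + 46 * y ^ 5 + 19 * y ^ 4 + 41 * y ^ 3 +
          20 * y ^ 2 + 11 * y + 8) / (y ^ 5 * (y ^ 3 + y + 1) ^ 2 * (y ^ 2 + 1) ^ 3) := by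
      field_simp
      ring
    rw [e]
    exact div_nonneg (fifth_poly_nonneg hy) (by positivity)
  have hBy : B - y = u := by rw [hBu]; ring
  have hsum : y / B ^ 2 + y / B ^ 3 + 4 * y / B ^ 4 + 9 * y / B ^ 5 + 6377292 * y / B ^ 6 ≤ B - y := by rw [hBy]; linarith
  have e : y / B + y / B ^ 3 + y / B ^ 4 + 4 * y / B ^ 5 + 9 * y / B ^ 6 + 6377292 * y / B ^ 7 =
      (y + (y / B ^ 2 + y / B ^ 3 + 4 * y / B ^ 4 + 9 * y / B ^ 5 + 6377292 * y / B ^ 6)) / B := by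
    field_simp
    ring
  rw [e, div_le_one hB0]
  linarith

/-- ★★★ **THE FIFTH-ORDER UPPER WINDOW: `β(y)² ≤ y + 1/y + 1/y² + 2/y³ + 4/y⁴ + 6377300/y⁵` for every `y ≥ 36`** (the threshold only serves
`ρ ≥ 6` in the geometric tail).  With `B` the right-hand side and `ρ = √B`: `B^w_n(y) ≤ X⁷_n(y) ≤ 3¹⁹ y¹⁹ ρⁿ` (`fifthB_condition`, `X7w_le_mul_pow`)
and the Fekete transfer `wallRate_le_of_WB_le` give `β(y) ≤ ρ`. [cite: BeatonBousquetMelouDeGierDuminilCopinGuttmann2014, §3.1, Proposition 5 (arXiv v5 p. 9) and p. 10 (first-order remark, stated without proof); JansevanRensburg2000, §3.3.2, Lemma 3.20] -/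
theorem wallRate_sq_le_fifth (hy : 36 ≤ y) : wallRate y ^ 2 ≤ y + 1 / y + 1 / y ^ 2 + 2 / y ^ 3 + 4 / y ^ 4 + 6377300 / y ^ 5 := by
  have hy1 : 1 ≤ y := by linarith
  have hy0 : 0 < y := by linarith
  set B : ℝ := y + 1 / y + 1 / y ^ 2 + 2 / y ^ 3 + 4 / y ^ 4 + 6377300 / y ^ 5 with hB
  have hyB : y ≤ B := by
    have h1 : (0 : ℝ) ≤ 1 / y := by positivity
    have h2 : (0 : ℝ) ≤ 1 / y ^ 2 := by positivity
    have h3 : (0 : ℝ) ≤ 2 / y ^ 3 := by positivity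
    have h4 : (0 : ℝ) ≤ 4 / y ^ 4 := by positivity
    have h5 : (0 : ℝ) ≤ 6377300 / y ^ 5 := by positivity
    rw [hB]; linarith
  have hB36 : 36 ≤ B := hy.trans hyB
  have hB0 : 0 < B := by linarith
  set ρ := Real.sqrt B with hρ
  have hρ0 : 0 < ρ := Real.sqrt_pos.2 hB0
  have hρsq : ρ ^ 2 = B := Real.sq_sqrt hB0.le
  have hρ6 : 6 ≤ ρ := by
    rw [hρ, ← Real.sqrt_sq (by norm_num : (0 : ℝ) ≤ 6)]
    exact Real.sqrt_le_sqrt (by norm_num; exact hB36)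
  have hc : y / ρ ^ 2 + y / ρ ^ 6 + y / ρ ^ 8 + 4 * y / ρ ^ 10 + 9 * y / ρ ^ 12 + 6377292 * y / ρ ^ 14 ≤ 1 := by
    have h6 : ρ ^ 6 = B ^ 3 := by rw [show (6 : ℕ) = 2 * 3 by norm_num, pow_mul, hρsq]
    have h8 : ρ ^ 8 = B ^ 4 := by rw [show (8 : ℕ) = 2 * 4 by norm_num, pow_mul, hρsq]
    have h10 : ρ ^ 10 = B ^ 5 := by rw [show (10 : ℕ) = 2 * 5 by norm_num, pow_mul, hρsq]
    have h12 : ρ ^ 12 = B ^ 6 := by rw [show (12 : ℕ) = 2 * 6 by norm_num, pow_mul, hρsq]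
    have h14 : ρ ^ 14 = B ^ 7 := by rw [show (14 : ℕ) = 2 * 7 by norm_num, pow_mul, hρsq]
    rw [hρsq, h6, h8, h10, h12, h14, show y / B = y / (y + 1 / y + 1 / y ^ 2 + 2 / y ^ 3 + 4 / y ^ 4 + 6377300 / y ^ 5) by rw [hB]]
    exact fifthB_condition hy1
  have hA := X7w_le_mul_pow hy1 hρ6 hc
  have hW : ∀ n, WB n y ≤ 3 ^ 19 * y ^ 19 * ρ ^ n := fun n => (WB_le_XKw 7 n hy0.le).trans (hA n)
  have hβρ : wallRate y ≤ ρ := wallRate_le_of_WB_le hy0 (by positivity) hρ0 hW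
  calc wallRate y ^ 2 ≤ ρ ^ 2 := pow_le_pow_left₀ (wallRate_pos y).le hβρ 2
    _ = B := hρsq

/-- ★★★ **`y⁴ · (β(y)² − y − 1/y − 1/y² − 2/y³) ≤ 4 + 6377300/y`** (`y ≥ 36`): `limsup_{y → ∞} y⁴ (β(y)² − y − 1/y − 1/y² − 2/y³) ≤ 4`.
[cite: BeatonBousquetMelouDeGierDuminilCopinGuttmann2014, §3.1 (arXiv v5 p. 10 remark); JansevanRensburg2000, §3.3.2, Lemma 3.20] -/
theorem pow_four_mul_wallRate_sq_sub_le (hy : 36 ≤ y) :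
    y ^ 4 * (wallRate y ^ 2 - y - 1 / y - 1 / y ^ 2 - 2 / y ^ 3) ≤ 4 + 6377300 / y := by
  have hy0 : 0 < y := by linarith
  have h := wallRate_sq_le_fifth hy
  have e : y ^ 4 * (wallRate y ^ 2 - y - 1 / y - 1 / y ^ 2 - 2 / y ^ 3) =
      y ^ 4 * (wallRate y ^ 2 - (y + 1 / y + 1 / y ^ 2 + 2 / y ^ 3 + 4 / y ^ 4 + 6377300 / y ^ 5)) + (4 + 6377300 / y) := by
    field_simp
    ring
  rw [e]
  have : y ^ 4 * (wallRate y ^ 2 - (y + 1 / y + 1 / y ^ 2 + 2 / y ^ 3 + 4 / y ^ 4 + 6377300 / y ^ 5)) ≤ 0 :=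
    mul_nonpos_of_nonneg_of_nonpos (pow_nonneg hy0.le 4) (by linarith)
  linarith

/-- ★★★ **`limsup ≤ 4` in the elementary form**: every `a > 4` eventually dominates `y⁴ (β(y)² − y − 1/y − 1/y² − 2/y³)`.
[cite: BeatonBousquetMelouDeGierDuminilCopinGuttmann2014, §3.1 (arXiv v5 p. 10 remark); JansevanRensburg2000, §3.3.2, Lemma 3.20] -/
theorem eventually_pow_four_mul_wallRate_sq_sub_le {a : ℝ} (ha : 4 < a) :
    ∀ᶠ y : ℝ in atTop, y ^ 4 * (wallRate y ^ 2 - y - 1 / y - 1 / y ^ 2 - 2 / y ^ 3) ≤ a := by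
  have h1 : ∀ᶠ y : ℝ in atTop, 36 ≤ y := eventually_ge_atTop 36
  have h2 : ∀ᶠ y : ℝ in atTop, 6377300 / (a - 4) ≤ y := eventually_ge_atTop _
  filter_upwards [h1, h2] with y hy hy2
  have hy0 : 0 < y := by linarith
  have h := pow_four_mul_wallRate_sq_sub_le hy
  have h3 : 6377300 / y ≤ a - 4 := by
    rw [div_le_iff₀ hy0]
    have := (div_le_iff₀ (by linarith : (0:ℝ) < a - 4)).1 hy2
    linarith
  linarith

/-! ### §8  THE FIFTH COEFFICIENT IS EXACTLY FOUR -/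

/-- ★★ **`y⁴ (β(y)² − y − 1/y − 1/y² − 2/y³) ∈ [4 − 53853213/y, 4 + 6377300/y]`** (`y ≥ 36`; lower end from the tree's
`four_sub_div_le_pow_four_mul`). [cite: BeatonBousquetMelouDeGierDuminilCopinGuttmann2014, §3.1, Proposition 5 (arXiv v5 p. 9); p. 10 (first-order remark)] [cite: JansevanRensburg2000, §3.3.2, Lemma 3.20] -/
theorem pow_four_mul_wallRate_sq_sub_mem_Icc (hy : 36 ≤ y) :
    y ^ 4 * (wallRate y ^ 2 - y - 1 / y - 1 / y ^ 2 - 2 / y ^ 3) ∈ Set.Icc (4 - 53853213 / y) (4 + 6377300 / y) :=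
  ⟨four_sub_div_le_pow_four_mul hy, pow_four_mul_wallRate_sq_sub_le hy⟩

/-- ★★★ **THE FIFTH COEFFICIENT IS EXACTLY FOUR: `y⁴ (β(y)² − y − 1/y − 1/y² − 2/y³) → 4`** as `y → ∞`, i.e.
`β(y)² = y + 1/y + 1/y² + 2/y³ + 4/y⁴ + O(y⁻⁵)`. [cite: BeatonBousquetMelouDeGierDuminilCopinGuttmann2014, §3.1, Proposition 5 (arXiv v5 p. 9); p. 10 (first-order remark)] [cite: JansevanRensburg2000, §3.3.2, Lemma 3.20] -/
theorem tendsto_pow_four_mul_wallRate_sq_sub :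
    Tendsto (fun y : ℝ => y ^ 4 * (wallRate y ^ 2 - y - 1 / y - 1 / y ^ 2 - 2 / y ^ 3)) atTop (𝓝 4) := by
  have hlow : Tendsto (fun y : ℝ => 4 - 53853213 / y) atTop (𝓝 4) := by
    have h := (tendsto_const_nhds (x := (53853213 : ℝ))).div_atTop tendsto_id
    simpa using (tendsto_const_nhds (x := (4 : ℝ))).sub h
  have hup : Tendsto (fun y : ℝ => 4 + 6377300 / y) atTop (𝓝 4) := by
    have h := (tendsto_const_nhds (x := (6377300 : ℝ))).div_atTop tendsto_id
    simpa using (tendsto_const_nhds (x := (4 : ℝ))).add h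
  refine tendsto_of_tendsto_of_tendsto_of_le_of_le' hlow hup ?_ ?_
  · filter_upwards [eventually_ge_atTop (36 : ℝ)] with y hy using (pow_four_mul_wallRate_sq_sub_mem_Icc hy).1
  · filter_upwards [eventually_ge_atTop (36 : ℝ)] with y hy using (pow_four_mul_wallRate_sq_sub_mem_Icc hy).2

/-- ★★ **THE FIFTH-ORDER WINDOW** (`y ≥ 36`): `β(y)² − y − 1/y − 1/y² − 2/y³ − 4/y⁴ ∈ [−53853213/y⁵, 6377300/y⁵]`.
[cite: BeatonBousquetMelouDeGierDuminilCopinGuttmann2014, §3.1, Proposition 5 (arXiv v5 p. 9); p. 10 (first-order remark)] [cite: JansevanRensburg2000, §3.3.2, Lemma 3.20] -/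
theorem wallRate_sq_fifth_mem_Icc (hy : 36 ≤ y) :
    wallRate y ^ 2 - y - 1 / y - 1 / y ^ 2 - 2 / y ^ 3 - 4 / y ^ 4 ∈ Set.Icc (-(53853213 / y ^ 5)) (6377300 / y ^ 5) := by
  have hy0 : 0 < y := by linarith
  obtain ⟨h1, h2⟩ := pow_four_mul_wallRate_sq_sub_mem_Icc hy
  have hp : 0 < y ^ 4 := by positivity
  have hD : wallRate y ^ 2 - y - 1 / y - 1 / y ^ 2 - 2 / y ^ 3 - 4 / y ^ 4 =
      (y ^ 4 * (wallRate y ^ 2 - y - 1 / y - 1 / y ^ 2 - 2 / y ^ 3) - 4) / y ^ 4 := by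
    field_simp
  have e1 : -(53853213 / y ^ 5) = (4 - 53853213 / y - 4) / y ^ 4 := by
    field_simp
    ring
  have e2 : (6377300 : ℝ) / y ^ 5 = (4 + 6377300 / y - 4) / y ^ 4 := by
    field_simp
    ring
  rw [hD, Set.mem_Icc, e1, e2]
  exact ⟨div_le_div_of_nonneg_right (by linarith) hp.le, div_le_div_of_nonneg_right (by linarith) hp.le⟩

/-- ★★ **`β(y)² − y − 1/y − 1/y² − 2/y³ − 4/y⁴ = O(y⁻⁵)`** (`y → ∞`). [cite: BeatonBousquetMelouDeGierDuminilCopinGuttmann2014, §3.1, Proposition 5 (arXiv v5 p. 9); p. 10 (first-order remark)] [cite: JansevanRensburg2000, §3.3.2, Lemma 3.20] -/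
theorem isBigO_wallRate_sq_fifth :
    (fun y : ℝ => wallRate y ^ 2 - y - 1 / y - 1 / y ^ 2 - 2 / y ^ 3 - 4 / y ^ 4) =O[atTop] (fun y : ℝ => (y ^ 5)⁻¹) := by
  refine Asymptotics.IsBigO.of_bound 53853213 ?_
  filter_upwards [eventually_ge_atTop (36 : ℝ)] with y hy
  have hy0 : 0 < y := by linarith
  obtain ⟨h1, h2⟩ := wallRate_sq_fifth_mem_Icc hy
  rw [Real.norm_eq_abs, Real.norm_eq_abs, abs_of_pos (by positivity : (0 : ℝ) < (y ^ 5)⁻¹), abs_le]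
  constructor
  · rw [div_eq_mul_inv] at h1; exact h1
  · have : (6377300 : ℝ) / y ^ 5 ≤ 53853213 * (y ^ 5)⁻¹ := by
      rw [div_eq_mul_inv]; exact mul_le_mul_of_nonneg_right (by norm_num) (by positivity)
    linarith

/-! ### §9  The same for BBdGDCG's `μ(y)` -/

/-- ★★★ **`μ(y)² ≤ y + 1/y + 1/y² + 2/y³ + 4/y⁴ + 6377300/y⁵`** (`y ≥ 36`) for BBdGDCG's `μ(y) = HV.surfaceMu y`.
[cite: BeatonBousquetMelouDeGierDuminilCopinGuttmann2014, §3.1, Proposition 5 (arXiv v5 p. 9); p. 10 (first-order remark)] -/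
theorem surfaceMu_sq_le_fifth (hy : 36 ≤ y) : HV.surfaceMu y ^ 2 ≤ y + 1 / y + 1 / y ^ 2 + 2 / y ^ 3 + 4 / y ^ 4 + 6377300 / y ^ 5 := by
  rw [← HV.wallRate_eq_surfaceMu (by linarith)]
  exact wallRate_sq_le_fifth hy

/-- ★★★ **`y⁴ (μ(y)² − y − 1/y − 1/y² − 2/y³) → 4`** for BBdGDCG's surface growth rate `μ(y) = HV.surfaceMu y`.
[cite: BeatonBousquetMelouDeGierDuminilCopinGuttmann2014, §3.1, Proposition 5 (arXiv v5 p. 9); p. 10 (first-order remark)] [cite: JansevanRensburg2000, §3.3.2, Lemma 3.20] -/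
theorem tendsto_pow_four_mul_surfaceMu_sq_sub :
    Tendsto (fun y : ℝ => y ^ 4 * (HV.surfaceMu y ^ 2 - y - 1 / y - 1 / y ^ 2 - 2 / y ^ 3)) atTop (𝓝 4) := by
  refine tendsto_pow_four_mul_wallRate_sq_sub.congr' ?_
  filter_upwards [eventually_gt_atTop (0 : ℝ)] with y hy
  rw [HV.wallRate_eq_surfaceMu hy]

/-- ★★ **`μ(y)² − y − 1/y − 1/y² − 2/y³ − 4/y⁴ ∈ [−53853213/y⁵, 6377300/y⁵]`** (`y ≥ 36`).
[cite: BeatonBousquetMelouDeGierDuminilCopinGuttmann2014, §3.1, Proposition 5 (arXiv v5 p. 9); p. 10 (first-order remark)] [cite: JansevanRensburg2000, §3.3.2, Lemma 3.20] -/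
theorem surfaceMu_sq_fifth_mem_Icc (hy : 36 ≤ y) :
    HV.surfaceMu y ^ 2 - y - 1 / y - 1 / y ^ 2 - 2 / y ^ 3 - 4 / y ^ 4 ∈ Set.Icc (-(53853213 / y ^ 5)) (6377300 / y ^ 5) := by
  rw [← HV.wallRate_eq_surfaceMu (by linarith)]
  exact wallRate_sq_fifth_mem_Icc hy

end Literature.Probability.RandomPlanarGeometry.SAW.HexBW.Wall
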